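import Summits.HodgeConjecture.HodgeConjecture.Theorems.F0P3bQCMTSignedOfSteinberg    -- ★ the consumer «QCMTS ⟸ ST» (`qcmtSigned_of_steinbergCharTransferSigned`; brings the P3b line's ★ cone = every notion of the head)
import Summits.HodgeConjecture.HodgeConjecture.Theorems.F0P3cStCharTSOfQuasiSplitTransfer    -- ★ (LH6-p01) organ «QS»: `stCharTS_of_quasiSplit_of_transferExists` — the head from its quasi-split, sign-free, per-place form + N6-ns, BY NAME
import Literature.NumberTheory.Automorphic.IrreducibleClassesUnitarizable              -- ★ `IrrClass.IsUnitarizable` (Prop. 13.8.1: «irreducible unitary representation», read on classes)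
import Literature.NumberTheory.Rogawski1990.LocalTransferExplicitNonsplit               -- ★ `LocalTransferExplicitNonsplitClosed` (= closer row `stub_N6ns`, BY NAME)
import Literature.NumberTheory.Rogawski1990.LocalTransferExistence                     -- ★ `IsLocalDeltaTransferExists` (Prop. 4.9.1 (a) as a relation: the organs' hypothesis (T_v))
import Summits.HodgeConjecture.HodgeConjecture.Theorems.F0P3cStCharTSEllComposeLB         -- [ED. 26: `_LB` twin `stEllipticNormTwo_of_carpet_of_lds_not_L2_LB` (UP-TR DEAL #4), imports its parent] ★ (LH6-p01) p848567 «ELL-COMPOSE»: `stEllipticNormTwo_of_carpet_of_lds_not_L2` — (S-b1) ⟸ the §12.5–12.6 datum + carpets + sockets (ED. 2)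
import Summits.HodgeConjecture.HodgeConjecture.Theorems.F0P3cStCharTSSgnCompose         -- ★ (LH6-p04) p848889 «SGN-COMPOSE»: `stSignBalance_of_carpet` — (S-b2) ⟸ the datum + ★ `PseudoCoeffExists` + (PL)(T3)(GERM-3) (ED. 2)
import Summits.HodgeConjecture.HodgeConjecture.Theorems.F0P3cStCharTSSaHead              -- ★ (LH6-p01 g2) p849145 «Sa-HEAD»: `stSupportFiniteSqInt_of_carpet_of_F` — (S-a) ⟸ the datum + carpets + sockets + (F) (ED. 3); brings ★ (R) p848976, ★ «Sa-COMPOSE» p848625, ★ K1b, ★ «L2-FIN», ★ «FIN-OF-L2»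
import Summits.HodgeConjecture.HodgeConjecture.Theorems.F0P3cStCharTSSaHeadTorus         -- ★ (LH6-p01 g2) p849458 «Sa-HEAD★ CONCRETE»: `stSupportFiniteSqInt_of_carpet_torus` — (S-a) ⟸ the datum + carpets + sockets + (SPLIT-NOT-ELL) + (TOR) (ED. 5; binds ★ p849333 ∕ ★ p849400 «TOR-DATA★», ★ p849428 «PSE★»)
import Summits.HodgeConjecture.HodgeConjecture.Theorems.F0P3cStCharTSSaHeadTorus2        -- ★ (LH6-p01 g2) p849719 «Sa-HEAD★ (PSM) OUT, NAMED TERMS IN»: `stSupportFiniteSqInt_of_carpet_torus₂` — (S-a) ⟸ the package with (TOR′) at `torusTransform`∕`hyperbolicSet`∕`pairChar` (ED. 6 cand, LH6-p01)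
import Summits.HodgeConjecture.HodgeConjecture.Theorems.F0P3cStCharTSSaHeadTorus3        -- ★ (LH6-p01 g2) p849901 «Sa-HEAD★ (WM)+(HM) OUT, WEYL DENSITY IN»: `stSupportFiniteSqInt_of_carpet_torus₃` — (S-a) ⟸ the package with (CHAR-G) + (TOR″) (ED. 7 cand, LH6-p01)
import Summits.HodgeConjecture.HodgeConjecture.Theorems.F0P3cStCharTSSaHeadTorus4        -- ★ (LH6-p01 g3) p850157 «Sa-HEAD★ Ω° CUT»: `stSupportFiniteSqInt_of_carpet_torus₄` — (TOR‴) on the trace-open core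
import Summits.HodgeConjecture.HodgeConjecture.Theorems.F0P3cStCharTSSaHeadTorus6        -- ★ (LH6-p01 g3) «Sa-HEAD★ (WIF)+(SHF′) OUT»: `stSupportFiniteSqInt_of_carpet_torus₆` — (TOR⁗) = Casselman's (L1M)(L1M-up) at print's `D_G = |D_G|^{1∕2} = Δ ∘ ι` (★ `vanDijkWeight`)
import Summits.HodgeConjecture.HodgeConjecture.Theorems.F0P3cStCharTSSaHeadTorus7        -- ★ (LH6-p01 g3) «Sa-HEAD★ (CHAR-G) OUT»: `stSupportFiniteSqInt_of_carpet_torus₇` — HC input = the package's (M1) `CharRegularity` + (CHAR-CL); (TOR⁗) verbatim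
import Summits.HodgeConjecture.HodgeConjecture.Theorems.F0P3cStCharTSSaHeadTorus8        -- ★ (LH6-p01 g3) «Sa-HEAD★ (L1M) OUT, MEASURE-FREE»: `stSupportFiniteSqInt_of_carpet_torus₈` — (TOR⁵) = (HCB)(DEC)(HCB-up)(DEC-up); (L1M) by ★ `…L1MSplit`
import Summits.HodgeConjecture.HodgeConjecture.Theorems.F0P3cStCharTSSaHeadTorus10LB       -- [ED. 26: `_LB` twin `stSupportFiniteSqInt_of_carpet_torus₁₀_LB` (UP-TR DEAL #4), imports its parent] ★ (LH6-p01 g3) «Sa-HEAD★ TORUS BLOCK = HC-BOUNDED + (HCB-up)»: `stSupportFiniteSqInt_of_carpet_torus₁₀` — over ★ HbOnMc, ★ DecSigma, ★ DecUp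
import Summits.HodgeConjecture.HodgeConjecture.Theorems.F0P3cStCharTSClassFn           -- ★ (LH6-p04 g4) «CLASS-FN★»: `isClassFunOn_char_of_charRegularity` — (CHAR-CL) from (M1) + admissibility ★
import Summits.HodgeConjecture.HodgeConjecture.Theorems.F0P3cStCharTSSocketsOut        -- ★ (LH6-p02 g4) «SOCKETS-OUT★»: `ldsElliptic_of_prop1261c` ((LDSE) ⟸ Prop1261c+(LDS2)+(C2)), `weylDensity_gqs_of_ellCartanAE` ((DENS) ⟸ (C2)+(E⊆R)), `packetInnerDefined_of_l2UpOnTorus_of_innerHDefined` ((DEF) ⟸ (U2)+(DEF-H))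
import Summits.HodgeConjecture.HodgeConjecture.Theorems.F0P3cStCharTSLdsuOut           -- ★ (LH6-p04 g5) p851084 «LDSU-OUT★»: `ldsEllipticPartner_of_prop1261bc` — (LDSU) ⟸ Prop. 12.6.1 (b)(c) + «χ_{π¹} = −χ_{π²} on G^e» + (LDS2) + (C2)
import Summits.HodgeConjecture.HodgeConjecture.Theorems.F0P3cStCharTSEllOut            -- ★ (LH6-p03 g4) p851130 «ELL-OUT★»: `ellipticOfL2_of_PL` — (ELL) ⟸ the (PL) pair («f_π(1) = d(π)», «0 < d(π)»)
import Summits.HodgeConjecture.HodgeConjecture.Theorems.F0P3cStCharTSMateUniqOut       -- ★ (LH6-p02 g4) p851141 «MATE-UNIQ-OUT★»: `mateUniq_of_carpet` — (MATE-UNIQ) ⟸ (PS2) + (NONL2-PAR) + ★ «PSE★» ED. 2 + Prop. 12.6.1 (b)(c) + pseudo-coefficients + (C2) + (SPLIT-NOT-ELL)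
import Summits.HodgeConjecture.HodgeConjecture.Theorems.F0P3cStCharTSL2dEll            -- ★ (LH6-p02 g4) p851173 «L2D-ELL★»: `l2CharOnTorusAll_of_elliptic` — (L2D∀) ⟸ (L2D-ell) «… for every ELLIPTIC class» + (C2)
import Summits.HodgeConjecture.HodgeConjecture.Theorems.F0P3cStCharTSPctOut           -- ★ (LH6-p01 g4) «PCT-OUT★»: `pseudoCoeffTrace_Gqs` — the carpet `PseudoCoeffTrace` («by the Weyl integration formula», p. 187) ⟸ WIF + (M1∀) + (C1)(C2)(C3) + (L2D∀) + ★ CLASS-FN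
import Summits.HodgeConjecture.HodgeConjecture.Theorems.F0P3cStCharTSDatumJunction17    -- ★ junction fold of ED. 36: `ellipticPackage_body_of_inputs₁₇` (62 hypotheses; the (S-𝔇) package adds the RUNG0 export(s) `eRegH`)
import Summits.HodgeConjecture.HodgeConjecture.Theorems.F0P3cStCharTSRung0TwentyTwo    -- ★ RUNG0 (ED. 36 «L²-UNR + NOT-WILD + (b)-REST + K4′ NOT-WILD — J17 + R22»): `ellipticPackage_hyps_of_namedBlock₂₂` derives (S-𝔇)⁗ from the organ `stub_EllipticInputs`
import Summits.HodgeConjecture.HodgeConjecture.Theorems.K2E3Rung0LeThree              -- NR-1′ (director s1979∕s1980): RUNG0₂₃ under the narrowed letters hHC₃∕hHCB₃ (architect K2E3-p25 (g3) sweep)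
import Summits.HodgeConjecture.HodgeConjecture.Theorems.K2E3DatumJunction17LeThree     -- NR-1′ twin of ★ junction fold J17 (package conjunct hHCB₃)
import Summits.HodgeConjecture.HodgeConjecture.Theorems.K2E3SaHeadTorus10LBLeThree      -- NR-1′ twin of ★ (S-a) head (hHCB₃)
import Summits.HodgeConjecture.HodgeConjecture.Theorems.F0P3cStCharTSNoncuspidalOfXIGEx    -- ★ (LH6-p03 g0) p849285 «B6-EX»: `stNoncuspidalMember_of_XIGEx` — (S-i) ⟸ «XIG-St» ∃-form (ED. 4); over ★ B6 (LH6-p02) and the shell kit ★ p848983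
import Summits.HodgeConjecture.HodgeConjecture.Theorems.F0P3cStCharTSCuspidalOfXIG         -- ★ (LH6-p03 g0) p849298: `stCuspidalMember_of_XIG` — (S-ii) ⟸ «XIG-St» ∃-form (ED. 4); over ★ «CuspidalCore» p849246, ★ JAC-LEN1 p849054, ★ «KEYS-JQ», ★ «JDIM2»
import Summits.HodgeConjecture.HodgeConjecture.Theorems.F0P3cStCharTSMembersOfXIGPkg       -- ★ (LH6-p03 g2) «XIG′ CONSUMERS»: `stNoncuspidalMember_of_XIGPkg` ∕ `stCuspidalMember_of_XIGPkg` — (S-i)∕(S-ii) ⟸ (S-X)′ (ED. 8)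
import Summits.HodgeConjecture.HodgeConjecture.Theorems.F0P3cStCharTSXIGAssembly         -- ★ (road (D) «DEEP-FL»: head-filer A-p16 g34, 0-sorry head LH6-p02 g3 on LH6-p04 g3's v3e) p850653 «XIG-ASSEMBLY»: `stXIGSt'` — (S-X)′ PROVED (ED. 10 «(S-X) IN»; transfer third ★ p849876, value third ★ p850420∕p850493, H-package ★ p850442, XIG-DATA ★ p850103∕p850150)
import HarnessLib

/-!
# LINE «StCharTS» — F0∕P3c∕LH6 pay-down skeleton for the closer row `stub_StCharTS` (#169 (N-1273S)): the STEINBERG CHARACTER-TRANSFER LEMMA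
# [Rogawski1990, §12.7 Lemma 12.7.2 + Lemma 12.7.3] CUT AT PRINT'S OWN SEAMS, ON PRINT'S OWN GROUP `U(3)_{qs}(L⁺_v)`  (ED. 4 «XIG SOCKET» — (S-i)∕(S-ii) in, LH6 line planner F0P3b-plan (g23), 2026-09-02)

Crux H413 = `stmt-HodgeConjecture-24833`; route of record `HCCMUnconditional`; cell `hodgecm-mathlib`, GO-500 §1B row LH6 (director g25 s1158).
HEAD = the closer's registered stub `F0U3LettersRung1.stub_StCharTS` (`Cruxes/H413/Lines/F0_U3LettersRung1.lean` ED. 38, registry row sig16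
5af19639adcc0d33) TOKEN FOR TOKEN up to the reducible abbreviations {`Places` ↦ `Pl`, `HLocal` ↦ `HLoc`, `GpLocal` ↦ `GLoc`} (= the P3b line's
`F0P3bCMCharIdentityTestPaydown.stub_steinbergCharTransferSigned`, whose consumer ★ `F0P3bQCMTSignedOfSteinberg.qcmtSigned_of_steinbergCharTransferSigned`
closes `stub_QCMTS`).  This file imports ★ modules only (no `Lines` import).  ED. 4: THREE `sorry`s — the organs (S-β) `stub_StSpectralHyp`, (S-𝔇) `stub_EllipticPackage`, (S-X) `stub_StXIGSt`; the ED. 1 organs (S-a)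
`stub_StSupportFiniteSqInt`, (S-b1) `stub_StEllipticNormTwo`, (S-b2) `stub_StSignBalance`, (S-i) `stub_StNoncuspidalMember` and (S-ii) `stub_StCuspidalMember` keep their
ED. 1 statements byte for byte and are THEOREMS here: (S-a)∕(S-b1)∕(S-b2) from the organ (S-𝔇) (the §12.5–12.6 local package; ED. 2, re-lettered in ED. 3) by LH6-p01 (g2)'s ★
`F0P3cStCharTSSaHead.stSupportFiniteSqInt_of_carpet_of_F` (p849145), LH6-p01's ★ `F0P3cStCharTSEllCompose.stEllipticNormTwo_of_carpet_of_lds_not_L2` (p848567)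
and LH6-p04's ★ `F0P3cStCharTSSgnCompose.stSignBalance_of_carpet` (p848889); (S-i)∕(S-ii) from the organ (S-X) (the «XIG-St» shell-trace socket, ED. 4) by LH6-p03 (g0)'s ★
`F0P3cStCharTSNoncuspidalOfXIGEx.stNoncuspidalMember_of_XIGEx` (p849285, over LH6-p02's ★ B6) and ★ `F0P3cStCharTSCuspidalOfXIG.stCuspidalMember_of_XIG` (p849298)
(«split, not growth»: 6 → 5 → 4 → 3 `sorry`s, head and `QST_of_organs` unchanged).  Kernel-checked compositions:
`QST_of_organs : ‹S-β› → ‹S-a› → ‹S-b1› → ‹S-b2› → ‹S-i› → ‹S-ii› → QS_T` (logic, integer arithmetic, a two-point `tsum`), where **QS_T = (N-1273S) ON THE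
QUASI-SPLIT MODEL, PER PLACE, SIGN-FREE, GIVEN SMOOTH TRANSFER** — Rogawski's L. 12.7.3 ∕ Cor. 12.7.4 for `U(Φ₃)(L⁺_v)` in the tree's currency (the hypothesis
of LH6-p01's ★ `F0P3cStCharTSOfQuasiSplit.stCharTS_of_quasiSplit` with the single extra hypothesis (T_v) below) — and
`StCharTS_of_organs : ‹S-β› → … → ‹S-ii› → LocalTransferExplicitNonsplitClosed → ‹stub_StCharTS›` := LH6-p01's ★ `stCharTS_of_quasiSplit_of_transferExists`
(inner form `U(H)(L⁺_v) ≃ U(Φ₃)(L⁺_v)` along the frame `e`, the sign `ε_v(H) = χ(a)` of the tree's Δ‴ [§4.3 (4.3.2); §14.4], smooth transfer at the frame from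
the CLOSER's registered row `stub_N6ns` = ★ `LocalTransferExplicitNonsplitClosed` [Prop. 4.9.1 (a)] BY NAME — count-neutral) applied to `QST_of_organs`.
HONEST LABEL: HC_CM is proved only modulo the 7 printed citations (2 remaining: hLiu418 = `stmt-HodgeConjecture-24832`, h413 = `stmt-HodgeConjecture-24833`)
until rung 0 closes; (N-1273S) stays ONE printed input of the books until its organs close — nothing of it is proved here.

## Thesis (the print cut; memo `F0/P3b/MEMO-N1273S-print-road.F0P3b-plan-g21.md` c1ef97d76ed1b224)
[Rogawski1990, Lemma 12.7.3 p. 195] AS PRINTED is an implication «(β) ⟹ (π¹ = π²(ξ) with a(π¹) = 1, π² =: πs(ξ) supercuspidal with a(π²) = −1)» about the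
quasi-split group `G = U(3)(L⁺_v) = U(Φ₃)(L⁺_v)` and its elliptic endoscopic group `H = U(2) × U(1)`, where (β) = the HYPOTHESIS of [L.12.7.2 p. 191] for
`ρ = St_H(ξ)`: a virtual character `χ^G_π = Σ a(π) χ_π` of irreducible UNITARY classes of `G`, absolutely convergent, equal to the transfer `χ^G_ρ`
(`χ^G_ρ(f) := χ_ρ(f^H)` on Δ-matched pairs).  In print (β) is obtained ONLY GLOBALLY — [§13.8 pp. 212–217, Props. 13.8.1 (ψ-expansion of the φ₁-part of the
simple trace formula), 13.8.2, 13.8.3 (globalise `St_H(ξ)` at `w`, compare with `H`, isolate `w`): «The hypothesis of Lemma 12.7.2 is thus satisfied for ρ₀»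
(end of the proof of Prop. 13.8.3)] — and everything after it is LOCAL harmonic analysis on `U(Φ₃)(L⁺_v)`.  The inner form `U(H)(L⁺_v)` of the head and the sign `ε_v(H)` of the tree's
Δ‴ (★ `finExplicitCollection`, ruling «K») enter ONLY through LH6-p01's ★ «QS» [§14.4 pp. 234–237; §4.3 (4.3.2) p. 43].  The organs, all on the model:
* (S-β) `stub_StSpectralHyp` — (β) in the tree's currency: `∃ aX : IrrClass (U(Φ₃)(L⁺_v)) → ℤ`, countable support, unitarizable members, and for every smooth
  Δ‴_{Φ₃}-matched pair `(f^H, φ)`: `Σ' aX(π)·Tr π(φ)` converges absolutely and equals `Tr St_H(ξ_v)(f^H)` [§13.8 Props. 13.8.1–13.8.3; GLOBAL in print;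
  programme-sized; strictly weaker than QS_T];
* (S-a) `stub_StSupportFiniteSqInt` — [L.12.7.2, first half of the proof, pp. 191–193: pseudo-coefficients (finiteness of `X″`), Fourier analysis of
  `χ(π^{nt})`, `χ(i_{G,M}(θ))` on the split torus `M ≅ E^*` against unitarity (`X‴ = ∅`)]: the support of `aX` is FINITE and consists of classes
  square-integrable modulo the centre (★ `IrrClass.IsSquareIntegrable μZ`, `μZ` the head's Haar measure on `U(Φ₃)(L⁺_v) ⧸ Z`);
* (S-b1) `stub_StEllipticNormTwo` — [L.12.7.2 p. 194, first display: orthogonality relations for square-integrable characters + Prop. 12.5.2: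
  `Σ a(π)² = ⟨χ^G_ρ, χ^G_ρ⟩_e = 2⟨χ_ρ, χ_ρ⟩_{H,e} = 2·Card(ρ)`, `Card(St_H(ξ)) = 1`]: `Σᶠ aX(π)² = 2`;
* (S-b2) `stub_StSignBalance` — [L.12.7.2 p. 194, second display: germ expansions (§8.1, (12.6.1)) give `f^H(1) = 0`, the Plancherel formula and
  `f_π(1) = d(π)` give `Σ a(π) d(π) = 0`; formal degrees are positive]: the `aX(π)` are NOT all of one sign;
* (S-𝔇) `stub_EllipticPackage` (ED. 2, re-lettered ED. 3) — [§12.1–12.2 pp. 171–174, §12.5 pp. 182–187, §12.6 pp. 187–189 as used on pp. 191–194]: existence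
  of the §12.5 datum `𝔇 : EllipticData (U(Φ₃)(L⁺_v)) (H_v)` COMPATIBLE with the organs' currency (with a formal degree `d`, a type-(3) Cartan subgroup `T` and a
  principal-series parameter map `par` of the non-square-integrable classes), at which the carpet relations (Weyl integration formula, (12.5.1), Prop. 12.5.2,
  pseudo-coefficients [K] (their traces «by the Weyl integration formula» DERIVED since ED. 17), Prop. 12.6.1 (a)(b)(c), Prop. 12.6.2, the elliptic classification) and the printed inputs (M1)…(R0), (MATE-UNIQ),
  (ST-L2), (PI2-L2), (PS1)…(UNIQ-PAR), (PL), (T3), (GERM-3) and (F) «the principal-series disjunct of (12.7.1) is void» hold — exactly what the three ★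
  compose∕head theorems consume; (S-a), (S-b1) and (S-b2) follow IN THIS FILE;
* (S-X) `stub_StXIGSt` (ED. 4) — [Lemma 12.7.3 proof p. 195; Prop. 12.5.1 p. 183; §4.9 Prop. 4.9.1 (a)]: the «XIG-St» SHELL-TRACE SOCKET (∃-form): for the
  Iwahori shells `K_n (z·a^m) K_n` deep in the positive chamber some smooth Δ‴_{Φ₃}-transfer `f^H` of `𝟙_{K_n (z·a^m) K_n}` exists with `Tr St_H(ξ_v)(f^H) =
  ν(K_n)·#R·δ_P^{1/2}(z·a^m)·χ_{ξ,μ}(z·a^m)` (fundamental lemma for the Hecke shells + Casselman on `H`); (S-i) and (S-ii) follow IN THIS FILE;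
* (S-i) `stub_StNoncuspidalMember` — [Lemma 12.7.3 proof, first part p. 195: Casselman's theorem + [BZ 2.9] (Jacquet module of `π²(ξ)`, character
  `ξμ|α|^{1/2}` on `M⁻`) against Prop. 12.5.1 + §4.9 (`D_G τ Δ_{G/H} = D_H` on `M`, `τ(γ) = μ(α)`): `a(π²(ξ)) = +1`], i.e. `aX(π²) = 1` for Keys' label `π²`
  (★ `KeysCaseTwoLabels`: the constituent of `i_G(χ_{ξ,v})` other than the non-square-integrable `πⁿ`);
* (S-ii) `stub_StCuspidalMember` — [Lemma 12.7.3 proof, end p. 195: the remaining character vanishes on `M` far from the walls, so the remaining member is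
  compactly supported modulo the centre, i.e. SUPERCUSPIDAL (classification §12.1–12.2; [Casselman1995] 6.3)]: every member other than `π²` is supercuspidal.
(T_v) — the hypothesis «`f^H` a smooth Δ‴_{Φ₃}-transfer of `φ` EXISTS for every smooth `φ`» of (S-a)…(S-ii) and of QS_T [§4.9 Prop. 4.9.1 (a); print uses it on
p. 191 (pseudo-coefficients `f_{π′}` and their transfers) and p. 194 (`f = Σ a(π) f_π`)] is NOT an organ: LH6-p01's ★ discharges it from the closer's row N6-ns
read at the inner form's canonical families and transported along `e` [§4.3 (4.3.2)].
GLUE proved here: two members with coefficients `(1, −1)` from (S-a)+(S-b1)+(S-b2) (integer arithmetic, `pair_of_finsum_sq_eq_two`); the two-point `tsum`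
(`tsum_pair`); `πs ≠ πⁿ` because `πs` is square-integrable ((S-a)) and `πⁿ` is not (Keys); `πs ≠ π²` because `aX(πs) = −1 ≠ 1 = aX(π²)`.
WHY THIS CUT: each organ is a displayed sub-statement of print with its OWN tool (trace formula ∕ pseudo-coefficients + split-torus Fourier analysis ∕ elliptic
orthogonality ∕ germs + Plancherel ∕ Jacquet-module exponents ∕ compact-support criterion); none restates the head or QS_T ((β) is strictly weaker: no
finiteness, no signs, no supercuspidality; (S-a)…(S-ii) are conditional on the (β)-datum); no bookkeeping stub (the arithmetic and the two-point sum are proved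
below; the inner form, the frame and the sign are LH6-p01's ★, not stubs).  v1 (ccb08fd2121d3e32) typed the same organs on the inner form `U(H)(L⁺_v)` with
the frame `(T, a)` and `ε_v(H)` inside every organ; v2 re-sites them where print states them.
DEAD LINES honoured (P3b card §4, `Lines/F0_P3b_QCMJunkObstruction.lean`): the UNSIGNED inner-form texts (N-492)/(N-1273) are false where `ε_v(H) = −1` — the
sign is produced by ★ «QS» from the frame, no organ asserts an unsigned inner-form identity; PK-ε per-ξ signs on the `H`-side are print-false — no organ puts a
sign on `Tr St_H(ξ_v)(f^H)`; no local print road to (β) exists (memo census: Adler–Lansky, Blasco, Tam, Kaletha all rest on the global comparison) — (β) is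
labelled GLOBAL-in-print, not dressed as local.

## References
* [Rogawski1990] J. D. Rogawski, *Automorphic Representations of Unitary Groups in Three Variables*, Ann. of Math. Stud. 123 (1990): §4.3 (4.3.1)–(4.3.2)
  p. 43; §4.9 Prop. 4.9.1 (a) p. 55; §8.1; §12.1–12.2 pp. 171–174; §12.5 Props. 12.5.1–12.5.2 pp. 183–185; (12.6.1); §12.7 Lemma 12.7.2 (proof) pp. 191–194,
  Lemma 12.7.3 & Cor. 12.7.4 p. 195 (proof pp. 195–196); §13.8 Props. 13.8.1–13.8.3 pp. 212–217; §14.4 pp. 234–237.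
* [Casselman1995] W. Casselman, *Introduction to the theory of admissible representations of p-adic reductive groups* (1974/1995): §6.3 (Jacquet modules and
  square-integrability ∕ compact support criteria).
* [BernsteinZelevinsky1977] I. N. Bernstein, A. V. Zelevinsky, *Induced representations of reductive p-adic groups I*, Ann. Sci. ÉNS 10 (1977): 2.9.
* [HarishChandra1970] Harish-Chandra, *Harmonic analysis on reductive p-adic groups*, LNM 162 (1970): Part I §3 (supercuspidal ⇒ compactly supported
  matrix coefficients modulo the centre).
-/

set_option autoImplicit false
set_option linter.dupNamespace false

noncomputable section

open NumberField IsDedekindDomain MeasureTheory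
open scoped Matrix MatrixGroups
open Literature.NumberTheory.Rogawski1990 Literature.NumberTheory.Automorphic Literature.NumberTheory.Automorphic.UnitaryGroup
open Literature.NumberTheory.Automorphic.UnitaryGroup.CotangentForms Literature.NumberTheory.GaloisRepresentations
open Literature.NumberTheory.Automorphic.Arthur2013.Leaves.TECR

namespace Summit.HodgeConjecture.HodgeConjecture.Cruxes.H413.F0P3cStCharTSPaydown

/-! ## §0 Local currency (reducible abbreviations, byte-identical with the P3b line's `Pl`/`HLoc`/`GLoc` = the closer's `Places`/`HLocal`/`GpLocal`;
the model group is ★ `Gqs L v = (cmDatum L 3 (qsForm L)).Local v`, `qsForm L = Φ₃` the antidiagonal unit form) -/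

/-- Finite places of `L⁺` (reducible; = the closer's `Places`). [folklore] -/
abbrev Pl (L : Type) [Field L] [NumberField L] [IsCMField L] : Type := HeightOneSpectrum (𝓞 ↥(maximalRealSubfield L))

/-- `H_v = U(Φ₂)(L⁺_v) × U(Φ₁)(L⁺_v)` (reducible; token-identical with the closer's `HLocal`). [cite: Rogawski1990, §4.9 p. 54] -/
abbrev HLoc (L : Type) [Field L] [NumberField L] [IsCMField L] (v : Pl L) : Type :=
  (UnitaryGroup.cmDatum L 2 (Matrix.of fun i j : Fin 2 => if i.val + j.val + 1 = 2 then (1 : L) else 0)).Local v ×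
    (UnitaryGroup.cmDatum L 1 (Matrix.of fun i j : Fin 1 => if i.val + j.val + 1 = 1 then (1 : L) else 0)).Local v

/-- `G′_v = U(H)(L⁺_v)` (reducible; token-identical with the closer's `GpLocal`). [folklore] -/
abbrev GLoc (L : Type) [Field L] [NumberField L] [IsCMField L] (H : Matrix (Fin 3) (Fin 3) L) (v : Pl L) : Type :=
  (UnitaryGroup.cmDatum L 3 H).Local v


/-! ## §1 The organs = the printed sub-statements of [Rogawski1990, §12.7] for `ρ = St_H(ξ_v)` ON THE QUASI-SPLIT MODEL `U(Φ₃)(L⁺_v)` (six registered stubs) -/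

/-- **(S-β) — THE SPECTRAL HYPOTHESIS (β) of [Rogawski1990, Lemma 12.7.2 p. 191] FOR `ρ = St_H(ξ_v)`, ON THE QUASI-SPLIT MODEL, in the tree's currency.**
At a finite place `v` of `L⁺` NON-SPLIT in `L`, with Haar measures and CANONICAL orbital families on `H_v` and on `U(Φ₃)(L⁺_v)` (over binder-supplied Borel
structures), for the `H_v`-class `πSt` labelled `St_H(ξ_v)` by ★ `HLengthTwoLabels` (its partner `π₁` being the character `ξ_v` as a distribution): there is an
integer-valued `aX` on `Irr(U(Φ₃)(L⁺_v))` with countable support and unitarizable members such that for every smooth pair `(f^H, φ)` matched for the Δ‴_{Φ₃} of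
record (★ `IsLocalDeltaTransfer L Φ₃ v (finExplicitCollection …) v mHv mQv`) the series `Σ' aX(π)·Tr π(φ)` converges absolutely to `Tr πSt(f^H)`.
GLOBAL IN PRINT: obtained only from the simple trace formula [§13.8 Props. 13.8.1–13.8.3 pp. 212–217; «The hypothesis of Lemma 12.7.2 is thus satisfied for ρ₀» at the end of the proof of Prop. 13.8.3];
programme-sized (the T1∕K9 engine); an honest NAMED printed input, strictly weaker than QS_T (no finiteness, no signs, no supercuspidality).
Why it might fail AS TYPED: the tree's Δ‴_{Φ₃} at a non-split `v` must be print's transfer factor for `(U(3)_{qs}, H)` up to a sign absorbed in `aX` (ruling «K»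
K1∕K2: on the quasi-split form `κ ≡ 1`, so it is print's factor with the `μ`-normalisation of [§4.9]); absolute convergence is asked on test functions only.
[cite: Rogawski1990, §13.8 Props. 13.8.1–13.8.3 pp. 212–217; Lemma 12.7.2 p. 191] -/
theorem stub_StSpectralHyp :
  ∀ (L : Type) [Field L] [NumberField L] [IsCMField L] (μ : HeckeCharacter L) (ξ : OneDimAutRepH L) (v : Pl L),
    (∀ w : PlacesOver L v, IsCMField.complexConj L • w.1 = w.1) → μ.IsUnitary →
    (∀ x : Literature.NumberTheory.GaloisRepresentations.ideleGroup ↥(maximalRealSubfield L),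
      μ (AdeleRing.ideleBaseChange (↥(maximalRealSubfield L)) L x) = quadraticHeckeCharCM L x) →
    ∀ [MeasurableSpace (HLoc L v)] [BorelSpace (HLoc L v)] [MeasurableSpace (Gqs L v)] [BorelSpace (Gqs L v)]
      (νHv : Measure (HLoc L v)) (νQv : Measure (Gqs L v))
      [νHv.IsHaarMeasure] [νHv.IsMulRightInvariant] [νQv.IsHaarMeasure] [νQv.IsMulRightInvariant],
    letI : ∀ a : HLoc L v, MeasurableSpace (HLoc L v ⧸ Subgroup.centralizer ({a} : Set (HLoc L v))) := fun _ => borel _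
    haveI : ∀ a : HLoc L v, BorelSpace (HLoc L v ⧸ Subgroup.centralizer ({a} : Set (HLoc L v))) := fun _ => ⟨rfl⟩
    letI : ∀ γ : Gqs L v, MeasurableSpace (Gqs L v ⧸ Subgroup.centralizer ({γ} : Set (Gqs L v))) := fun _ => borel _
    haveI : ∀ γ : Gqs L v, BorelSpace (Gqs L v ⧸ Subgroup.centralizer ({γ} : Set (Gqs L v))) := fun _ => ⟨rfl⟩
    ∀ (mHv : OrbitalMeasureFamily (HLoc L v)) (mQv : OrbitalMeasureFamily (Gqs L v)),
      mHv.IsCanonical (IsLocalGRegular L v) νHv →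
      mQv.IsCanonical (fun γ => IsRegularElt (γ.val : GL (Fin 3) (UnitaryGroup.LocalRing L v))) νQv →
      ∀ (π₁ πSt : IrrClass (HLoc L v)),
        HLengthTwoLabels L v
          (torusCharPair (conjLocal L (IsCMField.complexConj L) v) (cmLocalForm L 2 v) (cmLocalForm_eq_over L 2 v) 0
            ((torusLocalComponent L (IsCMField.complexConj L) v ξ.η).comp
                (quotConj (conjLocal L (IsCMField.complexConj L) v) (conjLocal_conjLocal_cm L v)) *
              halfModulusChar (UnitaryGroup.LocalRing L v))
            (torusLocalComponent L (IsCMField.complexConj L) v ξ.ψ))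
          ((torusLocalComponent L (IsCMField.complexConj L) v ξ.ψ).comp (localDet (IsCMField.complexConj L) v (isUnit_antidiagOne_det L 1))) π₁ πSt →
        (∀ fH : HLoc L v → ℂ, IsLocSmooth fH → π₁.smoothTrace νHv fH = charDist (ξ.xiLocalChar v) νHv fH) →
        ∃ aX : IrrClass (Gqs L v) → ℤ, (Function.support aX).Countable ∧ (∀ π : IrrClass (Gqs L v), aX π ≠ 0 → π.IsUnitarizable) ∧
          ∀ (fH : HLoc L v → ℂ) (φ : Gqs L v → ℂ), IsLocSmooth fH → IsLocSmooth φ →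
            IsLocalDeltaTransfer L (qsForm L) v ((finExplicitCollection L (qsForm L) μ (finExplicitDelta_conj_left_all L (qsForm L) μ) (finExplicitDelta_conj_right_all L (qsForm L) μ)) v) mHv mQv fH φ →
            Summable (fun π : IrrClass (Gqs L v) => (aX π : ℂ) * π.smoothTrace νQv φ) ∧
              ∑' π : IrrClass (Gqs L v), (aX π : ℂ) * π.smoothTrace νQv φ = πSt.smoothTrace νHv fH := by
  sorry

set_option maxHeartbeats 1600000 in
open Filter Topology Pointwise Summit.HodgeConjecture.HodgeConjecture.Cruxes.H413.F0P3cStCharTSTorusDefs in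
open scoped Classical in
/-- **(S-𝔑) NEW ORGAN (ED. 22 «RUNG0 CONSUMED») — the INPUTS over print's objects from which ★ RUNG0 `F0P3cStCharTSRung0Three.ellipticPackage_hyps_of_namedBlock₃` (LH6-p01, datum-road rung 0) DERIVES the (S-𝔇) ∃-package `stub_EllipticPackage` (now a THEOREM in-leaf).**  Under the organ prefix (verbatim): §1.6 `Ch1.characterLocallyIntegrable` ∧ (HC-B) `normalizedCharacter_locallyBounded` ∧ ∃ CARTAN DATA `Sell μTf SH μTHf T` with their print properties [Rogawski1990 §3.6, §12.5 pp. 182–184] ∧ the remaining outer named facts ∧ the NAMED BLOCK `hBlock` (for every `𝔇 par` whose fields satisfy the PINS — equations ∕ ★-pin transports at the datum — the printed statements of §12.5–§12.6 used in the proof of Lemma 12.7.2 hold: WIF [§12.5 p. 182] · the transfer of `α^G` [p. 183] · Prop. 12.5.2 · [K] pseudo-coefficients · Prop. 12.6.1 (a)(b)(c) · «elliptic ⟸ not principal series» [§12.6 p. 187] · (M5) · (R0) · formal degrees [§12.6 p. 189]) — the hypothesis list of ★ `ellipticPackage_hyps_of_namedBlock₃` after its `μZ` binder VERBATIM, in order,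 as ONE conjunction (22 blocks, names as comments: `hHC hHCB hcartO hcovGO hncGO hHaarGO hcoreGO hHaarMO hcoreMO hKHO hcovHO hncHO hHaarHO hprobHO hstab hT3 hGerm hμq hKeysRed hLdsTwo hDGliO hBlock`; model-level named facts among them: Keys' list [§12.2 p. 173; Keys1984 §7], l.d.s.-two [§12.2 (3) p. 174], (HC-D) [HarishChandra1970 VII §1 Thm. 15], GERM-RESIDUE ★ `ShalikaGermResidueAtTorus` [§8.1]). Count-neutral: literal sorries 2 = 2 ((S-β) + this organ); (S-𝔇)'s ∃-package is proved from this organ by the ★ theorem. [cite: Rogawski1990, §12.5 pp. 182–187; §12.6 pp. 187–189; Lemma 12.7.2 (proof) pp. 191–194]  EDITIONS ED. 23 → ED. 33: the organ BODY was RE-LETTERED at each edition to the outer hypothesis list of the then-current ★ RUNG0 module (each fold retiring outer objects∕letters into ★ theorems: Cartan data, WIF, (HC-D), `hLdsRedTwo ↦ hKeysRed3`, (UP-TR), (M5), (1252), (EONPS), SC∕EP∕TAME splits, `hKeysRed3`) — per-edition sentences in the card § History (folded out of this docstring at ED. 34 «TRIM», docstring-only).  CURRENT (ED. 34): body = the outer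 hypotheses of ★ `F0P3cStCharTSRung0Nineteen.ellipticPackage_hyps_of_namedBlock₁₉` after its `μZ` binder VERBATIM — `hHC ∧ hHCB ∧ ∃ T, hT3 ∧ hGerm ∧ hKeysRed ∧ hBlock′` (`hBlock′`: ∀ Cartan data `Sell μTf SH μTHf` with 12 print properties, ∀ `𝔇 par` with 54 pins → the guarded printed consequents K1 · K2′ · Prop. 12.6.1 (b) · K4′ · (R0) · POS-ONE).  ED. 34 «2b′ NOT-WILD EP-PAIRS — J14 + R19»: RE-LETTERED to the outer hypotheses of ★ `F0P3cStCharTSRung0Nineteen.ellipticPackage_hyps_of_namedBlock₁₉` (6 blocks `hHC hHCB hT3 hGerm hKeysRed hBlock`, ∃-data `T`) — consequent 3 of `hBlock′` (Prop. 12.6.1 (b)ns,EP) gets the same ONE-token widening of the guard's place conjunct, in lockstep with ★ J14 (★ R19, rider pen LH6-p01 (g7)); outer letters 7, Cartan binders 12, pins 54, consequents 1∕2∕4∕5∕6 ≡ ED. 33; the ED. 23 → ED. 33 re-letter sentences of this docstring are folded into the card § History at this edition («TRIM»).  ED. 35 «K1-UNR — J15 + R20»: RE-LETTERED to the outer hypotheses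 of ★ `F0P3cStCharTSRung0Twenty.ellipticPackage_hyps_of_namedBlock₂₀` (6 blocks `hHC hHCB hT3 hGerm hKeysRed hBlock`, ∃-data `T`) — `hBlock′` consequent 1 (K1) gets the same inserted antecedent, lockstep with ★ J15 (★ R20, rider pen LH6-p01 (g7)); outer letters 7, Cartan binders 12, pins 54, consequents 2–6 ≡ ED. 34.  ED. 36 «L²-UNR + NOT-WILD + (b)-REST + K4′ NOT-WILD — J17 + R22»: RE-LETTERED to the outer hypotheses of ★ `F0P3cStCharTSRung0TwentyTwo.ellipticPackage_hyps_of_namedBlock₂₂` (6 blocks `hHC hHCB hT3 hGerm hKeysRed hBlock`, ∃-data `T`) — `hBlock′` consequents 1–4 (K1, K2′, 12.6.1 (b), K4′) get the same guards in LOCKSTEP with ★ J17 (★ R22, rider pen LH6-p01 (g7)); outer letters 7, Cartan binders 12, pins 54, consequents 5–6 ((R0), POS-ONE) ≡ ED. 35. -/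
theorem stub_EllipticInputs :
  ∀ (L : Type) [Field L] [NumberField L] [IsCMField L] (μ : HeckeCharacter L) (ξ : OneDimAutRepH L) (v : Pl L),
    (∀ w : PlacesOver L v, IsCMField.complexConj L • w.1 = w.1) → μ.IsUnitary →
    (∀ x : Literature.NumberTheory.GaloisRepresentations.ideleGroup ↥(maximalRealSubfield L),
      μ (AdeleRing.ideleBaseChange (↥(maximalRealSubfield L)) L x) = quadraticHeckeCharCM L x) →
    ∀ [MeasurableSpace (HLoc L v)] [BorelSpace (HLoc L v)] [MeasurableSpace (Gqs L v)] [BorelSpace (Gqs L v)]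
      (νHv : Measure (HLoc L v)) (νQv : Measure (Gqs L v))
      [νHv.IsHaarMeasure] [νHv.IsMulRightInvariant] [νQv.IsHaarMeasure] [νQv.IsMulRightInvariant],
    letI : ∀ a : HLoc L v, MeasurableSpace (HLoc L v ⧸ Subgroup.centralizer ({a} : Set (HLoc L v))) := fun _ => borel _
    haveI : ∀ a : HLoc L v, BorelSpace (HLoc L v ⧸ Subgroup.centralizer ({a} : Set (HLoc L v))) := fun _ => ⟨rfl⟩
    letI : ∀ γ : Gqs L v, MeasurableSpace (Gqs L v ⧸ Subgroup.centralizer ({γ} : Set (Gqs L v))) := fun _ => borel _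
    haveI : ∀ γ : Gqs L v, BorelSpace (Gqs L v ⧸ Subgroup.centralizer ({γ} : Set (Gqs L v))) := fun _ => ⟨rfl⟩
    ∀ (mHv : OrbitalMeasureFamily (HLoc L v)) (mQv : OrbitalMeasureFamily (Gqs L v)),
      mHv.IsCanonical (IsLocalGRegular L v) νHv →
      mQv.IsCanonical (fun γ => IsRegularElt (γ.val : GL (Fin 3) (UnitaryGroup.LocalRing L v))) νQv →
      IsLocalDeltaTransferExists L (qsForm L) v ((finExplicitCollection L (qsForm L) μ (finExplicitDelta_conj_left_all L (qsForm L) μ) (finExplicitDelta_conj_right_all L (qsForm L) μ)) v) mHv mQv IsLocSmooth IsLocSmooth →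
      ∀ (π₁ πSt : IrrClass (HLoc L v)),
        HLengthTwoLabels L v
          (torusCharPair (conjLocal L (IsCMField.complexConj L) v) (cmLocalForm L 2 v) (cmLocalForm_eq_over L 2 v) 0
            ((torusLocalComponent L (IsCMField.complexConj L) v ξ.η).comp
                (quotConj (conjLocal L (IsCMField.complexConj L) v) (conjLocal_conjLocal_cm L v)) *
              halfModulusChar (UnitaryGroup.LocalRing L v))
            (torusLocalComponent L (IsCMField.complexConj L) v ξ.ψ))
          ((torusLocalComponent L (IsCMField.complexConj L) v ξ.ψ).comp (localDet (IsCMField.complexConj L) v (isUnit_antidiagOne_det L 1))) π₁ πSt →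
        (∀ fH : HLoc L v → ℂ, IsLocSmooth fH → π₁.smoothTrace νHv fH = charDist (ξ.xiLocalChar v) νHv fH) →
      ∀ [MeasurableSpace (Gqs L v ⧸ Subgroup.center (Gqs L v))] [BorelSpace (Gqs L v ⧸ Subgroup.center (Gqs L v))]
        (μZ : Measure (Gqs L v ⧸ Subgroup.center (Gqs L v))) [μZ.IsHaarMeasure],
      -- hHC
      Summit.HodgeConjecture.HodgeConjecture.Cruxes.H413.K2E3CharLettersLeThreeDefs.characterLocallyIntegrableLeThree ∧
      -- hHCB
      Summit.HodgeConjecture.HodgeConjecture.Cruxes.H413.K2E3CharLettersLeThreeDefs.normalizedCharacter_locallyBoundedLeThree ∧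
      ∃ (T : Subgroup (Gqs L v)),
      -- hT3
      (∀ γ ∈ T, IsRegularElt (γ.val : GL (Fin 3) (UnitaryGroup.LocalRing L v)) → ∀ c : UnitaryGroup.LocalRing L v, ¬ ((γ.val.val : Matrix (Fin 3) (Fin 3) (UnitaryGroup.LocalRing L v)).charpoly).IsRoot c) ∧
      -- hGerm
      ShalikaGermResidueAtTorus L (qsForm L) v mQv T ∧
      -- hKeysRed
      (∀ (χ₁ : (UnitaryGroup.LocalRing L v)ˣ →* ℂˣ) (χ₂ : ↥(normOneUnits (conjLocal L (IsCMField.complexConj L) v)) →* ℂˣ), Continuous (fun x => ((χ₁ x : ℂˣ) : ℂ)) → Continuous (fun x => ((χ₂ x : ℂˣ) : ℂ)) → (∃ N : Subrepresentation (UnitaryGroup.cmPrincipalSeries L 3 v (UnitaryGroup.cmTorusCharPair L v χ₁ χ₂)), N ≠ ⊥ ∧ N ≠ ⊤) → (χ₁ = halfModulusChar (UnitaryGroup.LocalRing L v) * halfModulusChar (UnitaryGroup.LocalRing L v) ∨ χ₁ = (halfModulusChar (UnitaryGroup.LocalRing L v) * halfModulusChar (UnitaryGroup.LocalRing L v))⁻¹)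 ∨ (∃ η : (UnitaryGroup.LocalRing L v)ˣ →* ℂˣ, IsQuadraticCharExtension (conjLocal L (IsCMField.complexConj L) v) η ∧ Continuous (fun x => ((η x : ℂˣ) : ℂ)) ∧ (χ₁ = η * halfModulusChar (UnitaryGroup.LocalRing L v) ∨ χ₁ = η * (halfModulusChar (UnitaryGroup.LocalRing L v))⁻¹)) ∨ (χ₁ ≠ 1 ∧ ∀ a : (UnitaryGroup.LocalRing L v)ˣ, (conjLocal L (IsCMField.complexConj L) v) (a : UnitaryGroup.LocalRing L v) = a → χ₁ a = 1)) ∧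
      -- hBlock
      (∀ (Sell : Finset (Subgroup (Gqs L v))) (μTf : (T' : Subgroup (Gqs L v)) → Measure ↥T') (SH : Finset (Subgroup ((UnitaryGroup.cmDatum L 2 (Matrix.of fun i j : Fin 2 => if i.val + j.val + 1 = 2 then (1 : L) else 0)).Local v × (UnitaryGroup.cmDatum L 1 (Matrix.of fun i j : Fin 1 => if i.val + j.val + 1 = 1 then (1 : L) else 0)).Local v))) (μTHf : (T' : Subgroup ((UnitaryGroup.cmDatum L 2 (Matrix.of fun i j : Fin 2 => if i.val + j.val + 1 = 2 then (1 : L) else 0)).Local v × (UnitaryGroup.cmDatum L 1 (Matrix.of fun i j : Fin 1 => if i.val + j.val + 1 = 1 then (1 : L) else 0)).Local v)) → Measure ↥T'),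
        (∀ T ∈ Sell, IsCompact (T : Set (Gqs L v)) ∧ ∃ γ₀ : Gqs L v, IsRegularElt (γ₀.val : GL (Fin 3) (UnitaryGroup.LocalRing L v)) ∧ T = Subgroup.centralizer ({γ₀} : Set (Gqs L v))) →  -- hcartO
        (∀ γ : (Gqs L v), IsRegularElt (γ.val : GL (Fin 3) (UnitaryGroup.LocalRing L v)) → ∃ T' ∈ insert (cmBorelTriple L 3 v).M Sell, ∃ x : (Gqs L v), ∀ g : (Gqs L v), g ∈ Subgroup.centralizer ({γ} : Set (Gqs L v)) ↔ x⁻¹ * g * x ∈ T') →  -- hcovGO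
        (∀ T' ∈ insert (cmBorelTriple L 3 v).M Sell, ∀ T'' ∈ insert (cmBorelTriple L 3 v).M Sell, T' ≠ T'' → ∀ y : (Gqs L v), ¬ ∀ h : (Gqs L v), h ∈ T'' ↔ y⁻¹ * h * y ∈ T') →  -- hncGO
        (∀ T ∈ Sell, (μTf T).IsHaarMeasure) →  -- hHaarGO
        (∀ T' ∈ Sell, μTf T' (compactCore ↥T') = 1) →  -- hcoreGO
        (μTf (cmBorelTriple L 3 v).M).IsHaarMeasure →  -- hHaarMO
        (μTf (cmBorelTriple L 3 v).M (compactCore ↥(cmBorelTriple L 3 v).M) = 1) →  -- hcoreMO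
        (∀ T' ∈ SH, IsCompact (T' : Set ((UnitaryGroup.cmDatum L 2 (Matrix.of fun i j : Fin 2 => if i.val + j.val + 1 = 2 then (1 : L) else 0)).Local v × (UnitaryGroup.cmDatum L 1 (Matrix.of fun i j : Fin 1 => if i.val + j.val + 1 = 1 then (1 : L) else 0)).Local v)) ∧ ∃ γ₀ : ((UnitaryGroup.cmDatum L 2 (Matrix.of fun i j : Fin 2 => if i.val + j.val + 1 = 2 then (1 : L) else 0)).Local v × (UnitaryGroup.cmDatum L 1 (Matrix.of fun i j : Fin 1 => if i.val + j.val + 1 = 1 then (1 : L) else 0)).Local v), IsLocalGRegular L v γ₀ ∧ T' = Subgroup.centralizer ({γ₀} : Set ((UnitaryGroup.cmDatum L 2 (Matrix.of fun i j : Fin 2 => if i.val + j.val + 1 = 2 then (1 : L) else 0)).Local v × (UnitaryGroup.cmDatum L 1 (Matrix.of fun i j : Fin 1 => if i.val + j.val + 1 = 1 then (1 : L) else 0)).Local v))) →  -- hKHO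
        (∀ γ₀ : ((UnitaryGroup.cmDatum L 2 (Matrix.of fun i j : Fin 2 => if i.val + j.val + 1 = 2 then (1 : L) else 0)).Local v × (UnitaryGroup.cmDatum L 1 (Matrix.of fun i j : Fin 1 => if i.val + j.val + 1 = 1 then (1 : L) else 0)).Local v), IsLocalGRegular L v γ₀ → IsCompact ((Subgroup.centralizer ({γ₀} : Set ((UnitaryGroup.cmDatum L 2 (Matrix.of fun i j : Fin 2 => if i.val + j.val + 1 = 2 then (1 : L) else 0)).Local v × (UnitaryGroup.cmDatum L 1 (Matrix.of fun i j : Fin 1 => if i.val + j.val + 1 = 1 then (1 : L) else 0)).Local v)) : Subgroup ((UnitaryGroup.cmDatum L 2 (Matrix.of fun i j : Fin 2 => if i.val + j.val + 1 = 2 then (1 : L) else 0)).Local v × (UnitaryGroup.cmDatum L 1 (Matrix.of fun i j : Fin 1 => if i.val + j.val + 1 = 1 then (1 : L) else 0)).Local v)) : Set ((UnitaryGroup.cmDatum L 2 (Matrix.of fun i j : Fin 2 => if i.val + j.val + 1 = 2 then (1 : L) else 0)).Local v × (UnitaryGroup.cmDatum L 1 (Matrix.of fun i j : Fin 1 =>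 if i.val + j.val + 1 = 1 then (1 : L) else 0)).Local v)) → ∃ T' ∈ SH, ∃ x : ((UnitaryGroup.cmDatum L 2 (Matrix.of fun i j : Fin 2 => if i.val + j.val + 1 = 2 then (1 : L) else 0)).Local v × (UnitaryGroup.cmDatum L 1 (Matrix.of fun i j : Fin 1 => if i.val + j.val + 1 = 1 then (1 : L) else 0)).Local v), Subgroup.centralizer ({x * γ₀ * x⁻¹} : Set ((UnitaryGroup.cmDatum L 2 (Matrix.of fun i j : Fin 2 => if i.val + j.val + 1 = 2 then (1 : L) else 0)).Local v × (UnitaryGroup.cmDatum L 1 (Matrix.of fun i j : Fin 1 => if i.val + j.val + 1 = 1 then (1 : L) else 0)).Local v)) = T') →  -- hcovHO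
        (∀ T' ∈ SH, ∀ T'' ∈ SH, (∃ x : ((UnitaryGroup.cmDatum L 2 (Matrix.of fun i j : Fin 2 => if i.val + j.val + 1 = 2 then (1 : L) else 0)).Local v × (UnitaryGroup.cmDatum L 1 (Matrix.of fun i j : Fin 1 => if i.val + j.val + 1 = 1 then (1 : L) else 0)).Local v), T'.map (MulAut.conj x).toMonoidHom = T'') → T' = T'') →  -- hncHO
        (∀ T' ∈ SH, (μTHf T').IsHaarMeasure) →  -- hHaarHO
        (∀ T' ∈ SH, IsProbabilityMeasure (μTHf T')) →  -- hprobHO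
        ∀ (𝔇 : Ch12Sec5.EllipticData (Gqs L v) ((UnitaryGroup.cmDatum L 2 (Matrix.of fun i j : Fin 2 => if i.val + j.val + 1 = 2 then (1 : L) else 0)).Local v × (UnitaryGroup.cmDatum L 1 (Matrix.of fun i j : Fin 1 => if i.val + j.val + 1 = 1 then (1 : L) else 0)).Local v)) (par : (IrrClass (Gqs L v) → ((((UnitaryGroup.LocalRing L v)ˣ →* ℂˣ) × (↥(normOneUnits (conjLocal L (IsCMField.complexConj L) v)) →* ℂˣ))))),
          𝔇.μG = νQv →  -- hC01
          𝔇.μH = νHv →  -- hC02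
          𝔇.μGZ = μZ →  -- hC03
          𝔇.orb = mQv →  -- hC04
          (∀ γ : Gqs L v, γ ∈ 𝔇.regG ↔ IsRegularElt (γ.val : GL (Fin 3) (UnitaryGroup.LocalRing L v))) →  -- hC05
          (∀ (φ : Gqs L v → ℂ) (fH : ((UnitaryGroup.cmDatum L 2 (Matrix.of fun i j : Fin 2 => if i.val + j.val + 1 = 2 then (1 : L) else 0)).Local v × (UnitaryGroup.cmDatum L 1 (Matrix.of fun i j : Fin 1 => if i.val + j.val + 1 = 1 then (1 : L) else 0)).Local v) → ℂ), 𝔇.IsTransfer φ fH ↔ IsLocalDeltaTransfer L (qsForm L) v ((finExplicitCollection L (qsForm L) μ (finExplicitDelta_conj_left_all L (qsForm L) μ) (finExplicitDelta_conj_right_all L (qsForm L) μ)) v) mHv mQv fH φ) →  -- hC06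
          ({πSt} : Finset (IrrClass (((UnitaryGroup.cmDatum L 2 (Matrix.of fun i j : Fin 2 => if i.val + j.val + 1 = 2 then (1 : L) else 0)).Local v × (UnitaryGroup.cmDatum L 1 (Matrix.of fun i j : Fin 1 => if i.val + j.val + 1 = 1 then (1 : L) else 0)).Local v)))) ∈ 𝔇.sqPacketsH →  -- hC07
          (∀ γ : Gqs L v, γ ∈ 𝔇.ellG ↔ IsRegularElt (γ.val : GL (Fin 3) (UnitaryGroup.LocalRing L v)) ∧ γ ∉ hyperbolicSet L v) →  -- hE
          (∀ π : IrrClass (Gqs L v), Measurable (𝔇.char π) ∧ LocallyIntegrable (𝔇.char π) 𝔇.μG ∧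
          (∀ x ∈ 𝔇.regG, ∀ᶠ y in 𝓝 x, 𝔇.char π y = 𝔇.char π x) ∧
          ∀ φ : Gqs L v → ℂ, IsLocSmooth φ → π.smoothTrace 𝔇.μG φ = ∫ x, φ x * 𝔇.char π x ∂𝔇.μG) →  -- hchar
          (∀ T : Subgroup (Gqs L v), T ∈ 𝔇.cartanAll ↔ T = (cmBorelTriple L 3 v).M ∨ T ∈ 𝔇.cartanG) →  -- hAll
          (𝔇.μT (cmBorelTriple L 3 v).M).IsHaarMeasure →  -- hHaar
          (∀ T ∈ 𝔇.cartanG, IsCompact (T : Set (Gqs L v)) ∧ ∃ γ₀ : Gqs L v, IsRegularElt (γ₀.val : GL (Fin 3) (UnitaryGroup.LocalRing L v)) ∧ T = Subgroup.centralizer ({γ₀} : Set (Gqs L v))) →  -- hcart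
          (∀ T ∈ 𝔇.cartanG, (𝔇.μT T).IsHaarMeasure) →  -- hHaarG
          (∀ T ∈ 𝔇.cartanG, IsFiniteMeasure (𝔇.μT T)) →  -- hfinG
          (∀ T ∈ 𝔇.cartanG, ∃ s : Finset (Subgroup ↥T), (∀ K ∈ s, IsClosed (K : Set ↥T) ∧ ¬ IsOpen (K : Set ↥T)) ∧ ∀ t : ↥T, ¬ IsRegularElt ((t : Gqs L v).val : GL (Fin 3) (UnitaryGroup.LocalRing L v)) → ∃ K ∈ s, t ∈ K) →  -- hker
          (∀ g : Gqs L v, 𝔇.DG g = ((NNReal.sqrt (NNReal.sqrt ((∏ w : PlacesOver L v, IsNonarchimedeanLocalField.normAbs (w.1.adicCompletion L) (((g.val : GL (Fin 3) (UnitaryGroup.LocalRing L v)).val.charpoly.discr) w)) * ((∏ w : PlacesOver L v, IsNonarchimedeanLocalField.normAbs (w.1.adicCompletion L) (((g.val : GL (Fin 3) (UnitaryGroup.LocalRing L v)).val.det) w)) ^ 2)⁻¹)) : NNReal) : ℝ)) →  -- eDG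
          (∀ s : ((UnitaryGroup.cmDatum L 2 (Matrix.of fun i j : Fin 2 => if i.val + j.val + 1 = 2 then (1 : L) else 0)).Local v × (UnitaryGroup.cmDatum L 1 (Matrix.of fun i j : Fin 1 => if i.val + j.val + 1 = 1 then (1 : L) else 0)).Local v), 𝔇.DH s = ((NNReal.sqrt (NNReal.sqrt ((∏ w : PlacesOver L v, IsNonarchimedeanLocalField.normAbs (w.1.adicCompletion L) (((s.1.val : GL (Fin 2) (UnitaryGroup.LocalRing L v)).val.charpoly.discr) w)) * (∏ w : PlacesOver L v, IsNonarchimedeanLocalField.normAbs (w.1.adicCompletion L) (((s.1.val : GL (Fin 2) (UnitaryGroup.LocalRing L v)).val.det) w))⁻¹)) : NNReal) : ℝ)) →  -- eDH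
          (∀ T ∈ 𝔇.cartanH, IsCompact (T : Set ((UnitaryGroup.cmDatum L 2 (Matrix.of fun i j : Fin 2 => if i.val + j.val + 1 = 2 then (1 : L) else 0)).Local v × (UnitaryGroup.cmDatum L 1 (Matrix.of fun i j : Fin 1 => if i.val + j.val + 1 = 1 then (1 : L) else 0)).Local v))) →  -- hKH
          (∀ T ∈ 𝔇.cartanH, IsFiniteMeasure (𝔇.μTH T)) →  -- hFH
          (∀ ρ ∈ 𝔇.sqPacketsH, ∀ T ∈ 𝔇.cartanH, ∀ C : Set ((UnitaryGroup.cmDatum L 2 (Matrix.of fun i j : Fin 2 => if i.val + j.val + 1 = 2 then (1 : L) else 0)).Local v × (UnitaryGroup.cmDatum L 1 (Matrix.of fun i j : Fin 1 => if i.val + j.val + 1 = 1 then (1 : L) else 0)).Local v), IsCompact C → C ⊆ (T : Set ((UnitaryGroup.cmDatum L 2 (Matrix.of fun i j : Fin 2 => if i.val + j.val + 1 = 2 then (1 : L) else 0)).Local v × (UnitaryGroup.cmDatum L 1 (Matrix.of fun i j : Fin 1 => if i.val + j.val + 1 = 1 then (1 : L) else 0)).Local v)) → ∃ B : ℝ,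 ∀ γ ∈ C, ‖(𝔇.DH γ : ℂ) * 𝔇.packetCharH ρ γ‖ ≤ B) →  -- hHBH
          (∀ π : IrrClass (Gqs L v), ¬ π.IsSquareIntegrable μZ → π.IsConstituentOf (UnitaryGroup.cmPrincipalSeries L 3 v (UnitaryGroup.cmTorusCharPair L v (par π).1 (par π).2)) ∧ Continuous (par π).1 ∧ Continuous (par π).2) →  -- hNL
          (∀ π : IrrClass (Gqs L v), (∃ (χ₁ : (UnitaryGroup.LocalRing L v)ˣ →* ℂˣ) (χ₂ : ↥(normOneUnits (conjLocal L (IsCMField.complexConj L) v)) →* ℂˣ), Continuous (fun x => ((χ₁ x : ℂˣ) : ℂ)) ∧ Continuous (fun x => ((χ₂ x : ℂˣ) : ℂ)) ∧ (UnitaryGroup.cmPrincipalSeries L 3 v (UnitaryGroup.cmTorusCharPair L v χ₁ χ₂)).IsIrreducible ∧ π.IsConstituentOf (UnitaryGroup.cmPrincipalSeries L 3 v (UnitaryGroup.cmTorusCharPair L v χ₁ χ₂))) → (UnitaryGroup.cmPrincipalSeries L 3 v (UnitaryGroup.cmTorusCharPair L v (par π).1 (par π).2)).IsIrreducible ∧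 π.IsConstituentOf (UnitaryGroup.cmPrincipalSeries L 3 v (UnitaryGroup.cmTorusCharPair L v (par π).1 (par π).2)) ∧ Continuous (par π).1 ∧ Continuous (par π).2 ∧ Continuous (fun x => (((par π).1 x : ℂˣ) : ℂ)) ∧ Continuous (fun x => (((par π).2 x : ℂˣ) : ℂ)) ∧ ∀ (ν : Measure (Gqs L v)) (f : Gqs L v → ℂ), π.smoothTrace ν f = Representation.smoothTrace (G := Gqs L v) (UnitaryGroup.cmPrincipalSeries L 3 v (UnitaryGroup.cmTorusCharPair L v (par π).1 (par π).2)) ν f) →  -- hPSpar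
          (∀ P : Finset (IrrClass (Gqs L v)), P ∈ 𝔇.ldsPackets ↔ (P.card = 2 ∧ ∃ (χ₁ : (UnitaryGroup.LocalRing L v)ˣ →* ℂˣ) (χ₂ : ↥(normOneUnits (conjLocal L (IsCMField.complexConj L) v)) →* ℂˣ), Continuous (fun x => ((χ₁ x : ℂˣ) : ℂ)) ∧ Continuous (fun x => ((χ₂ x : ℂˣ) : ℂ)) ∧ (∀ a : (UnitaryGroup.LocalRing L v)ˣ, (conjLocal L (IsCMField.complexConj L) v) (a : UnitaryGroup.LocalRing L v) = a → χ₁ a = 1) ∧ χ₁ ≠ 1 ∧ ∀ c : IrrClass (Gqs L v), c ∈ P ↔ c.IsConstituentOf (UnitaryGroup.cmPrincipalSeries L 3 v (UnitaryGroup.cmTorusCharPair L v χ₁ χ₂)))) →  -- hLdsF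
          (∀ (χ₁ : (UnitaryGroup.LocalRing L v)ˣ →* ℂˣ) (χ₂ : ↥(normOneUnits (conjLocal L (IsCMField.complexConj L) v)) →* ℂˣ), Continuous (fun x => ((χ₁ x : ℂˣ) : ℂ)) → Continuous (fun x => ((χ₂ x : ℂˣ) : ℂ)) → ∀ π π' : IrrClass (Gqs L v), ¬ π.IsSquareIntegrable μZ → ¬ π'.IsSquareIntegrable μZ → π.IsConstituentOf (UnitaryGroup.cmPrincipalSeries L 3 v (UnitaryGroup.cmTorusCharPair L v χ₁ χ₂)) → π'.IsConstituentOf (UnitaryGroup.cmPrincipalSeries L 3 v (UnitaryGroup.cmTorusCharPair L v χ₁ χ₂)) → par π = par π') →  -- hW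
          (∀ a b : ((UnitaryGroup.cmDatum L 2 (Matrix.of fun i j : Fin 2 => if i.val + j.val + 1 = 2 then (1 : L) else 0)).Local v × (UnitaryGroup.cmDatum L 1 (Matrix.of fun i j : Fin 1 => if i.val + j.val + 1 = 1 then (1 : L) else 0)).Local v), 𝔇.stConjH a b ↔ IsLocalStablyConjH L v a b) →  -- hStH
          (∀ a : ((UnitaryGroup.cmDatum L 2 (Matrix.of fun i j : Fin 2 => if i.val + j.val + 1 = 2 then (1 : L) else 0)).Local v × (UnitaryGroup.cmDatum L 1 (Matrix.of fun i j : Fin 1 => if i.val + j.val + 1 = 1 then (1 : L) else 0)).Local v), IsLocalGRegular L v a → a ∈ 𝔇.regH) →  -- hRegH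
          (∀ (α : ((UnitaryGroup.cmDatum L 2 (Matrix.of fun i j : Fin 2 => if i.val + j.val + 1 = 2 then (1 : L) else 0)).Local v × (UnitaryGroup.cmDatum L 1 (Matrix.of fun i j : Fin 1 => if i.val + j.val + 1 = 1 then (1 : L) else 0)).Local v) → ℂ) (x : Gqs L v), 𝔇.up α x = if IsRegularElt (x.val : GL (Fin 3) (UnitaryGroup.LocalRing L v)) then ((𝔇.DG x : ℂ))⁻¹ * ∑ᶠ q : Quot (IsLocalStablyConjH L v), (if IsLocalGRegular L v q.out ∧ IsLocalNormPair L (qsForm L) v q.out x then finTau L v q.out μ * (𝔇.DH q.out : ℂ) * ((finKappaAt L v (qsForm L) q.out x : ℤ) : ℂ) * α q.out else 0) else 0) →  -- hUp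
          (∀ ρ ∈ 𝔇.sqPacketsH, ∀ C : Set ((UnitaryGroup.cmDatum L 2 (Matrix.of fun i j : Fin 2 => if i.val + j.val + 1 = 2 then (1 : L) else 0)).Local v × (UnitaryGroup.cmDatum L 1 (Matrix.of fun i j : Fin 1 => if i.val + j.val + 1 = 1 then (1 : L) else 0)).Local v), IsCompact C → ∃ B : ℝ, ∀ s ∈ C, IsLocalGRegular L v s → ‖(𝔇.DH s : ℂ) * 𝔇.packetCharH ρ s‖ ≤ B) →  -- hHBHP
          (∀ ξ' : ((UnitaryGroup.cmDatum L 2 (Matrix.of fun i j : Fin 2 => if i.val + j.val + 1 = 2 then (1 : L) else 0)).Local v × (UnitaryGroup.cmDatum L 1 (Matrix.of fun i j : Fin 1 => if i.val + j.val + 1 = 1 then (1 : L) else 0)).Local v) →* ℂˣ, Continuous ξ' → ∃ (η₁ η₂ : ↥(normOneUnits (conjLocal L (IsCMField.complexConj L) v)) →* ℂˣ), Continuous (fun x => ((η₁ x : ℂˣ) : ℂ)) ∧ Continuous (fun x => ((η₂ x : ℂˣ) : ℂ)) ∧ KeysCaseTwoLabels L v (μ.semilocalComponent L v) η₁ η₂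 (𝔇.pi2 ξ') (𝔇.piN ξ')) →  -- hlabels
          (∀ ψ' : ↥(Subgroup.center (Gqs L v)) →* ℂˣ, Continuous ψ' → ∃ ψ : ↥(normOneUnits (conjLocal L (IsCMField.complexConj L) v)) →* ℂˣ, Continuous ψ ∧ 𝔇.stG ψ' ≠ 𝔇.detG ψ' ∧ ∀ c : IrrClass (Gqs L v), c.IsConstituentOf (UnitaryGroup.cmPrincipalSeries L 3 v (UnitaryGroup.cmTorusCharPair L v (halfModulusChar (UnitaryGroup.LocalRing L v) * halfModulusChar (UnitaryGroup.LocalRing L v))⁻¹ ψ)) ↔ (c = 𝔇.stG ψ' ∨ c = 𝔇.detG ψ')) →  -- hSt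
          (∀ ψ₀ : ↥(normOneUnits (conjLocal L (IsCMField.complexConj L) v)) →* ℂˣ, Continuous (fun x => ((ψ₀ x : ℂˣ) : ℂ)) → ∃ ψ : ↥(Subgroup.center (Gqs L v)) →* ℂˣ, Continuous ψ ∧ ∀ c : IrrClass (Gqs L v), c.IsConstituentOf (UnitaryGroup.cmPrincipalSeries L 3 v (UnitaryGroup.cmTorusCharPair L v (halfModulusChar (UnitaryGroup.LocalRing L v) * halfModulusChar (UnitaryGroup.LocalRing L v))⁻¹ ψ₀)) ↔ (c = 𝔇.stG ψ ∨ c = 𝔇.detG ψ)) →  -- hStJH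
          (∀ (η₁ η₂ : ↥(normOneUnits (conjLocal L (IsCMField.complexConj L) v)) →* ℂˣ), Continuous (fun x => ((η₁ x : ℂˣ) : ℂ)) → Continuous (fun x => ((η₂ x : ℂˣ) : ℂ)) → ∃ ξ' : ((UnitaryGroup.cmDatum L 2 (Matrix.of fun i j : Fin 2 => if i.val + j.val + 1 = 2 then (1 : L) else 0)).Local v × (UnitaryGroup.cmDatum L 1 (Matrix.of fun i j : Fin 1 => if i.val + j.val + 1 = 1 then (1 : L) else 0)).Local v) →* ℂˣ, Continuous ξ' ∧ KeysCaseTwoLabels L v (μ.semilocalComponent L v) η₁ η₂ (𝔇.pi2 ξ') (𝔇.piN ξ')) →  -- hKeysJH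
          (∀ ρ ∈ 𝔇.sqPacketsH, ∀ a : ((UnitaryGroup.cmDatum L 2 (Matrix.of fun i j : Fin 2 => if i.val + j.val + 1 = 2 then (1 : L) else 0)).Local v × (UnitaryGroup.cmDatum L 1 (Matrix.of fun i j : Fin 1 => if i.val + j.val + 1 = 1 then (1 : L) else 0)).Local v), IsLocalGRegular L v a → ∀ᶠ a' in 𝓝 a, 𝔇.packetCharH ρ a' = 𝔇.packetCharH ρ a) →  -- hM1lc
          (∀ γ : Gqs L v, IsRegularElt (γ.val : GL (Fin 3) (UnitaryGroup.LocalRing L v)) → ∃ T' ∈ 𝔇.cartanAll, ∃ x : Gqs L v, ∀ g : Gqs L v, g ∈ Subgroup.centralizer ({γ} : Set (Gqs L v)) ↔ x⁻¹ * g * x ∈ T') →  -- hcovA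
          (∀ T' ∈ 𝔇.cartanAll, ∀ T'' ∈ 𝔇.cartanAll, T' ≠ T'' → ∀ y : Gqs L v, ¬ ∀ h : Gqs L v, h ∈ T'' ↔ y⁻¹ * h * y ∈ T') →  -- hncA
          (∀ T' ∈ 𝔇.cartanAll, T' ≠ (cmBorelTriple L 3 v).M → IsCompact (T' : Set (Gqs L v))) →  -- hcptA
          (∀ T' ∈ 𝔇.cartanAll, (𝔇.μT T').IsInvInvariant) →  -- hinvT
          (∀ T' ∈ 𝔇.cartanAll, 𝔇.μT T' (compactCore ↥T') = 1) →  -- hcoreT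
          (∀ π ∈ 𝔇.irredPS, ∃ (χ₁ : (UnitaryGroup.LocalRing L v)ˣ →* ℂˣ) (χ₂ : ↥(normOneUnits (conjLocal L (IsCMField.complexConj L) v)) →* ℂˣ), Continuous (fun x => ((χ₁ x : ℂˣ) : ℂ)) ∧ Continuous (fun x => ((χ₂ x : ℂˣ) : ℂ)) ∧ (UnitaryGroup.cmPrincipalSeries L 3 v (UnitaryGroup.cmTorusCharPair L v χ₁ χ₂)).IsIrreducible ∧ π.IsConstituentOf (UnitaryGroup.cmPrincipalSeries L 3 v (UnitaryGroup.cmTorusCharPair L v χ₁ χ₂))) →  -- hIrr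
          (∀ ξ' : ((UnitaryGroup.cmDatum L 2 (Matrix.of fun i j : Fin 2 => if i.val + j.val + 1 = 2 then (1 : L) else 0)).Local v × (UnitaryGroup.cmDatum L 1 (Matrix.of fun i j : Fin 1 => if i.val + j.val + 1 = 1 then (1 : L) else 0)).Local v) →* ℂˣ, (𝔇.pi2 ξ').IsSquareIntegrable 𝔇.μGZ ∧ ¬ (𝔇.piN ξ').IsSquareIntegrable 𝔇.μGZ) →  -- hKeys
          𝔇.DetNotL2 →  -- hDet
          𝔇.PacketCharHRegularity →  -- hM1H
          (∀ ψ' : ↥(Subgroup.center (Gqs L v)) →* ℂˣ, Continuous ψ' → 𝔇.IsL2 (𝔇.stG ψ')) →  -- hStL2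
          𝔇.cartanG = Sell →  -- eCartanG
          (∀ T' : Subgroup (Gqs L v), 𝔇.μT T' = μTf T') →  -- eMuT
          𝔇.cartanH = SH →  -- eCartanH
          (∀ T' : Subgroup ((UnitaryGroup.cmDatum L 2 (Matrix.of fun i j : Fin 2 => if i.val + j.val + 1 = 2 then (1 : L) else 0)).Local v × (UnitaryGroup.cmDatum L 1 (Matrix.of fun i j : Fin 1 => if i.val + j.val + 1 = 1 then (1 : L) else 0)).Local v), 𝔇.μTH T' = μTHf T') →  -- eMuTH
          (∀ a : ((UnitaryGroup.cmDatum L 2 (Matrix.of fun i j : Fin 2 => if i.val + j.val + 1 = 2 then (1 : L) else 0)).Local v × (UnitaryGroup.cmDatum L 1 (Matrix.of fun i j : Fin 1 => if i.val + j.val + 1 = 1 then (1 : L) else 0)).Local v), a ∈ 𝔇.regH ↔ IsLocalGRegular L v a) →  -- eRegH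
          (∀ a : ((UnitaryGroup.cmDatum L 2 (Matrix.of fun i j : Fin 2 => if i.val + j.val + 1 = 2 then (1 : L) else 0)).Local v × (UnitaryGroup.cmDatum L 1 (Matrix.of fun i j : Fin 1 => if i.val + j.val + 1 = 1 then (1 : L) else 0)).Local v), a ∈ 𝔇.ellH ↔ IsLocalGRegular L v a ∧ IsCompact ((Subgroup.centralizer ({a} : Set ((UnitaryGroup.cmDatum L 2 (Matrix.of fun i j : Fin 2 => if i.val + j.val + 1 = 2 then (1 : L) else 0)).Local v × (UnitaryGroup.cmDatum L 1 (Matrix.of fun i j : Fin 1 => if i.val + j.val + 1 = 1 then (1 : L) else 0)).Local v)) : Subgroup ((UnitaryGroup.cmDatum L 2 (Matrix.of fun i j : Fin 2 => if i.val + j.val + 1 = 2 then (1 : L) else 0)).Local v × (UnitaryGroup.cmDatum L 1 (Matrix.of fun i j : Fin 1 => if i.val + j.val + 1 = 1 then (1 : L) else 0)).Local v)) : Set ((UnitaryGroup.cmDatum L 2 (Matrix.of fun i j : Fin 2 => if i.val + j.val + 1 = 2 then (1 : L) else 0)).Local v × (UnitaryGroup.cmDatum L 1 (Matrix.of fun i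 j : Fin 1 => if i.val + j.val + 1 = 1 then (1 : L) else 0)).Local v))) →  -- eEllH
          𝔇.sqPacketsH = {({πSt} : Finset (IrrClass ((UnitaryGroup.cmDatum L 2 (Matrix.of fun i j : Fin 2 => if i.val + j.val + 1 = 2 then (1 : L) else 0)).Local v × (UnitaryGroup.cmDatum L 1 (Matrix.of fun i j : Fin 1 => if i.val + j.val + 1 = 1 then (1 : L) else 0)).Local v)))} →  -- eSq
          (∀ π : IrrClass (Gqs L v), (∃ (χ₁ : (UnitaryGroup.LocalRing L v)ˣ →* ℂˣ) (χ₂ : ↥(normOneUnits (conjLocal L (IsCMField.complexConj L) v)) →* ℂˣ), Continuous (fun x => ((χ₁ x : ℂˣ) : ℂ)) ∧ Continuous (fun x => ((χ₂ x : ℂˣ) : ℂ)) ∧ (UnitaryGroup.cmPrincipalSeries L 3 v (UnitaryGroup.cmTorusCharPair L v χ₁ χ₂)).IsIrreducible ∧ π.IsConstituentOf (UnitaryGroup.cmPrincipalSeries L 3 v (UnitaryGroup.cmTorusCharPair L v χ₁ χ₂))) → π ∈ 𝔇.irredPS) →  -- eIrr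
          (∀ (η₁ η₂ : ↥(normOneUnits (conjLocal L (IsCMField.complexConj L) v)) →* ℂˣ), Continuous (fun x => ((η₁ x : ℂˣ) : ℂ)) → Continuous (fun x => ((η₂ x : ℂˣ) : ℂ)) → ∀ ξ' : ((UnitaryGroup.cmDatum L 2 (Matrix.of fun i j : Fin 2 => if i.val + j.val + 1 = 2 then (1 : L) else 0)).Local v × (UnitaryGroup.cmDatum L 1 (Matrix.of fun i j : Fin 1 => if i.val + j.val + 1 = 1 then (1 : L) else 0)).Local v) →* ℂˣ, (∀ hh : ((UnitaryGroup.cmDatum L 2 (Matrix.of fun i j : Fin 2 => if i.val + j.val + 1 = 2 then (1 : L) else 0)).Local v × (UnitaryGroup.cmDatum L 1 (Matrix.of fun i j : Fin 1 => if i.val + j.val + 1 = 1 then (1 : L) else 0)).Local v), ξ' hh = η₁ (localDet (IsCMField.complexConj L) v (isUnit_antidiagOne_det L 2) hh.1) * η₂ (localDet (IsCMField.complexConj L) v (isUnit_antidiagOne_det L 2) hh.1 * localDet (IsCMField.complexConj L) v (isUnit_antidiagOne_det L 1) hh.2)) → KeysCaseTwoLabels L v (μ.semilocalComponent L v) η₁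 η₂ (𝔇.pi2 ξ') (𝔇.piN ξ')) →  -- eLab
          (∀ ρ : IrrClass ((UnitaryGroup.cmDatum L 2 (Matrix.of fun i j : Fin 2 => if i.val + j.val + 1 = 2 then (1 : L) else 0)).Local v × (UnitaryGroup.cmDatum L 1 (Matrix.of fun i j : Fin 1 => if i.val + j.val + 1 = 1 then (1 : L) else 0)).Local v), 𝔇.charH ρ = 𝔇.charH πSt) →  -- eCharH
          (∃ (ιZ : ↥(normOneUnits (conjLocal L (IsCMField.complexConj L) v)) →* ↥(Subgroup.center (Gqs L v))) (detZ : (Gqs L v) →* ↥(Subgroup.center (Gqs L v))), Continuous ιZ ∧ Continuous detZ ∧ (∀ z : ↥(normOneUnits (conjLocal L (IsCMField.complexConj L) v)), ((ιZ z).val.val.val : Matrix (Fin 3) (Fin 3) (UnitaryGroup.LocalRing L v)) = (((z : (UnitaryGroup.LocalRing L v)ˣ) : UnitaryGroup.LocalRing L v)) • (1 : Matrix (Fin 3) (Fin 3) (UnitaryGroup.LocalRing L v))) ∧ (∀ g : (Gqs L v), ((detZ g).val.val.val : Matrix (Fin 3) (Fin 3) (UnitaryGroup.LocalRing L v)) =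 (g.val.val : Matrix (Fin 3) (Fin 3) (UnitaryGroup.LocalRing L v)).det • (1 : Matrix (Fin 3) (Fin 3) (UnitaryGroup.LocalRing L v))) ∧ ∀ ψ : ↥(Subgroup.center (Gqs L v)) →* ℂˣ, Continuous ψ → (∃ hopen : IsOpen (((ψ.comp detZ).ker : Subgroup (Gqs L v)) : Set (Gqs L v)), 𝔇.detG ψ = IrrClass.mk (SmoothIrrep.ofChar (ψ.comp detZ) hopen)) ∧ 𝔇.stG ψ ≠ 𝔇.detG ψ ∧ (∀ c : IrrClass (Gqs L v), c.IsConstituentOf (cmPrincipalSeries L 3 v (cmTorusCharPair L v (halfModulusChar (UnitaryGroup.LocalRing L v) * halfModulusChar (UnitaryGroup.LocalRing L v))⁻¹ (ψ.comp ιZ))) ↔ (c = 𝔇.stG ψ ∨ c = 𝔇.detG ψ)) ∧ (𝔇.stG ψ).IsSquareIntegrable μZ ∧ ¬ (𝔇.detG ψ).IsSquareIntegrable μZ) →  -- eSt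
          ((∀ π : IrrClass (Gqs L v), 𝔇.IsEllipticRep π → ¬ π.IsSupercuspidal → ¬ (Algebra.IsUnramifiedIn (𝓞 L) v.asIdeal ∨ Valued.v (2 : v.adicCompletion ↥(maximalRealSubfield L)) = 1) → ¬ ((Algebra.IsUnramifiedIn (𝓞 L) v.asIdeal ∨ Valued.v (2 : v.adicCompletion ↥(maximalRealSubfield L)) = 1) ∧ ∃ ψ : ↥(Subgroup.center (Gqs L v)) →* ℂˣ, Continuous ψ ∧ (π = 𝔇.stG ψ ∨ π = 𝔇.detG ψ)) → ∃ f : Gqs L v → ℂ, 𝔇.IsPseudoCoeff π f) ∧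
           (∀ σ : IrrClass (Gqs L v), 𝔇.IsL2 σ → ¬ σ.IsSupercuspidal → ¬ (Algebra.IsUnramifiedIn (𝓞 L) v.asIdeal ∨ Valued.v (2 : v.adicCompletion ↥(maximalRealSubfield L)) = 1) → ¬ ((Algebra.IsUnramifiedIn (𝓞 L) v.asIdeal ∨ Valued.v (2 : v.adicCompletion ↥(maximalRealSubfield L)) = 1) ∧ ∃ ψ : ↥(Subgroup.center (Gqs L v)) →* ℂˣ, Continuous ψ ∧ σ = 𝔇.stG ψ) → 𝔇.innerG (𝔇.char σ) (𝔇.char σ) = 1) ∧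
           (∀ π π' : IrrClass (Gqs L v), 𝔇.IsEllipticRep π → 𝔇.IsEllipticRep π' → ¬ π.IsSupercuspidal → ¬ π'.IsSupercuspidal → ¬ (Algebra.IsUnramifiedIn (𝓞 L) v.asIdeal ∨ Valued.v (2 : v.adicCompletion ↥(maximalRealSubfield L)) = 1) → ¬ ((Algebra.IsUnramifiedIn (𝓞 L) v.asIdeal ∨ Valued.v (2 : v.adicCompletion ↥(maximalRealSubfield L)) = 1) ∧ (∃ ψ : ↥(Subgroup.center (Gqs L v)) →* ℂˣ, Continuous ψ ∧ (π = 𝔇.stG ψ ∨ π = 𝔇.detG ψ)) ∧ (∃ ψ' : ↥(Subgroup.center (Gqs L v)) →* ℂˣ, Continuous ψ' ∧ (π' = 𝔇.stG ψ' ∨ π' = 𝔇.detG ψ'))) → 𝔇.innerG (𝔇.char π) (𝔇.char π') ≠ 0 → π ≠ π' → 𝔇.IsEllipticPair π π') ∧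
           (∀ P ∈ 𝔇.ldsPackets, ∀ π ∈ P, ¬ (Algebra.IsUnramifiedIn (𝓞 L) v.asIdeal ∨ Valued.v (2 : v.adicCompletion ↥(maximalRealSubfield L)) = 1) → 𝔇.innerG (𝔇.char π) (𝔇.char π) = 1) ∧
           𝔇.LdsPseudoCoeffTraceH ({πSt} : Finset (IrrClass (((UnitaryGroup.cmDatum L 2 (Matrix.of fun i j : Fin 2 => if i.val + j.val + 1 = 2 then (1 : L) else 0)).Local v × (UnitaryGroup.cmDatum L 1 (Matrix.of fun i j : Fin 1 => if i.val + j.val + 1 = 1 then (1 : L) else 0)).Local v)))) ∧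
           (∀ π : IrrClass (Gqs L v), 𝔇.IsL2 π → ¬ π.IsSupercuspidal → ¬ ((Algebra.IsUnramifiedIn (𝓞 L) v.asIdeal ∨ Valued.v (2 : v.adicCompletion ↥(maximalRealSubfield L)) = 1) ∧ ∃ ψ : ↥(Subgroup.center (Gqs L v)) →* ℂˣ, Continuous ψ ∧ π = 𝔇.stG ψ) → ∃ f : (Gqs L v) → ℂ, 𝔇.IsPseudoCoeff π f ∧ 0 < (f 1).re ∧ (f 1).im = 0)))
  := by
  sorry

set_option maxHeartbeats 8000000 in
set_option synthInstance.maxHeartbeats 400000 in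
open Filter Topology Pointwise Summit.HodgeConjecture.HodgeConjecture.Cruxes.H413.F0P3cStCharTSTorusDefs in
open scoped Classical in
/-- **(S-𝔇) — THE §12.5–12.6 LOCAL PACKAGE ON `U(Φ₃)(L⁺_v)` [Rogawski1990, §12.5 pp. 182–187; §12.6 pp. 187–189; used throughout the proof of L. 12.7.2
pp. 191–194] (ED. 2 «PACKAGE CUT», split — not growth; ED. 3: re-lettered by the residues of the (S-a) head ★ p849145).**  **STATEMENT FORM since ED. 18 «RE-LETTERED THROUGH THE JUNCTION» (text current at ED. 34):** `∃ 𝔇 d T par μv, ‹the 62 hypotheses of ★ junction `F0P3cStCharTSDatumJunction14.ellipticPackage_body_of_inputs₁₄`, verbatim and in order, names as comments, `ℝ≥0` spelled `NNReal`› ∧ eRegH` — a THEOREM in-leaf since ED. 22 «RUNG0 CONSUMED», proved from the organ (S-𝔑) `stub_EllipticInputs` by ★ RUNG0 `F0P3cStCharTSRung0Nineteen.ellipticPackage_hyps_of_namedBlock₁₉`; the conjunct body described in the rest of this docstring (ED. 17 wording: COMPAT ∕ CARPET ∕ SOCKETS ∕ PAR ∕ the (S-b2) residues) is DERIVED from it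 inside the (S-a)∕(S-b1)∕(S-b2) bodies by the ★ junction, so the three consumers stay theorems with byte-identical ★ calls; what (S-𝔇) ASSERTS is «a §12.5 datum exists whose fields ARE print's objects (equations, `rfl` at the constructor) and at which print's cited statements (the named inputs) hold» — the rung-0 form of the package.  EDITION HISTORY ED. 18 → ED. 33 (per edition: which junction∕RUNG0 module, which printed input or socket left the statement or the organ, which ★ road paid it) lives in the card `Cruxes/H413/Lines/F0_P3c_StCharTSPaydown.md` § History, one `ED. n «…»` line each — this docstring carried the same sentences verbatim through ED. 33 and folds them out at ED. 34 «TRIM» (docstring-only: statements, proofs, imports and every cite token of the file unchanged).  Under the common hypotheses of the organs (canonical families `(mHv, mQv)`, (T_v), the Steinberg  ED. 34: the hypothesis list is now that of ★ `F0P3cStCharTSDatumJunction14.ellipticPackage_body_of_inputs₁₄` (62 hypotheses: `hC01 hC02 hC03 hC04 hC05 hC06 hC07 hE hchar hAll hHaar hcart hHaarG hfinG hker eDG eDH hKH hFH hHBH hNL hPSpar hLdsF hW hμq hμc hStH hRegH hUp hHBHP hGerm hlabels hSt hStJH hKeysJH hM1lc hcovA hncA hcptA hinvT hcoreT hIrr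 hKeys hT3 hDet hKeysRed hLdsTwo hDGli h1252 hPCEnsNW hL2oneNsNW h61bNsEP hLdsOne hM1H hM5 hR0 hStL2 hPL hdpos hHCB eIrr eSt`, extra ∃-binders `μv`); PLUS 1 conjunct(s) EXPORTED by ★ RUNG0 `ellipticPackage_hyps_of_namedBlock₁₉` beyond the junction's hypotheses: `eRegH` = conjunct(s) 63 (definitional block EXTRAS, used by the consumers, not passed to the junction).  ED. 34 «2b′ NOT-WILD EP-PAIRS — J14 + R19»: this (S-𝔇)⁗ statement MOVES at ONE token inside conjunct #52 `h61bNsEP` (name kept): the EP-PAIRS guard's place conjunct `Algebra.IsUnramifiedIn (𝓞 L) v.asIdeal` is widened to the 2a′ «not wildly ramified» disjunction `(Algebra.IsUnramifiedIn (𝓞 L) v.asIdeal ∨ Valued.v (2 : v.adicCompletion ↥(maximalRealSubfield L)) = 1)` — Prop. 12.6.1 (b) for pairs BOTH in the EP family {St_G(ψ), ψ∘det_G} is now a THEOREM at every NOT-WILD non-split `v`, rebuilt inside ★ J14 by ★ P4 p853443 `F0P3cStCharTSEPPairsNotWild.isEllipticPair_of_epFamily_of_not_wild` (place-free hand F0P3a-p06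 (g25); LEAD T15-45); the other 62 conjuncts ≡ ED. 33; this edition ALSO folds the ED. 18 → ED. 33 history sentences of this docstring into the card § History («TRIM», LEAD T15-46 (C): docstring-only, cite tokens unchanged) and stays a THEOREM in-leaf — now proved from the organ (S-𝔑) `stub_EllipticInputs` re-lettered in place to the outer list of ★ RUNG0 `F0P3cStCharTSRung0Nineteen.ellipticPackage_hyps_of_namedBlock₁₉` (consequent 3 of `hBlock′` (Prop. 12.6.1 (b)ns,EP) gets the same ONE-token widening of the guard's place conjunct, in lockstep with ★ J14 (★ R19, rider pen LH6-p01 (g7)); outer letters 7, Cartan binders 12, pins 54, consequents 1∕2∕4∕5∕6 ≡ ED. 33; the ED. 23 → ED. 33 re-letter sentences of this docstring are folded into the card § History at this edition («TRIM»)); the leaf's literal sorries stay (S-β) and (S-𝔑).  ED. 35: the hypothesis list is now that of ★ `F0P3cStCharTSDatumJunction15.ellipticPackage_body_of_inputs₁₅` (62 hypotheses: `hC01 hC02 hC03 hC04 hC05 hC06 hC07 hE hchar hAll hHaar hcart hHaarG hfinG hker eDG eDH hKH hFH hHBH hNL hPSpar hLdsF hW hμq hμc hStH hRegH hUp hHBHP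 hGerm hlabels hSt hStJH hKeysJH hM1lc hcovA hncA hcptA hinvT hcoreT hIrr hKeys hT3 hDet hKeysRed hLdsTwo hDGli h1252 hPCEnsNWR hL2oneNsNW h61bNsEP hLdsOne hM1H hM5 hR0 hStL2 hPL hdpos hHCB eIrr eSt`, extra ∃-binders `μv`); PLUS 1 conjunct(s) EXPORTED by ★ RUNG0 `ellipticPackage_hyps_of_namedBlock₂₀` beyond the junction's hypotheses: `eRegH` = conjunct(s) 63 (definitional block EXTRAS, used by the consumers, not passed to the junction).  ED. 35 «K1-UNR — J15 + R20»: this (S-𝔇)⁗ statement MOVES at ONE antecedent in conjunct #50 (`hPCEnsNW ↦ hPCEnsNWR`): `¬ Algebra.IsUnramifiedIn (𝓞 L) v.asIdeal →` inserted after `¬ π.IsSupercuspidal →` — [K] pseudo-coefficients for EVERY elliptic non-supercuspidal class are THEOREMS at an UNRAMIFIED non-split `v`, rebuilt inside ★ J15 by ★ `F0P3cStCharTSK1UnrPseudoCoeff.exists_isPseudoCoeff_of_unramified` (PAYDOWN-UNR road, row 58; LEAD T15-39∕T15-44); the other 62 ≡ ED. 34 and stays a THEOREM in-leaf — now proved from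 the organ (S-𝔑) `stub_EllipticInputs` re-lettered in place to the outer list of ★ RUNG0 `F0P3cStCharTSRung0Twenty.ellipticPackage_hyps_of_namedBlock₂₀` (`hBlock′` consequent 1 (K1) gets the same inserted antecedent, lockstep with ★ J15 (★ R20, rider pen LH6-p01 (g7)); outer letters 7, Cartan binders 12, pins 54, consequents 2–6 ≡ ED. 34); the leaf's literal sorries stay (S-β) and (S-𝔑).  ED. 36: the hypothesis list is now that of ★ `F0P3cStCharTSDatumJunction17.ellipticPackage_body_of_inputs₁₇` (62 hypotheses: `hC01 hC02 hC03 hC04 hC05 hC06 hC07 hE hchar hAll hHaar hcart hHaarG hfinG hker eDG eDH hKH hFH hHBH hNL hPSpar hLdsF hW hμq hμc hStH hRegH hUp hHBHP hGerm hlabels hSt hStJH hKeysJH hM1lc hcovA hncA hcptA hinvT hcoreT hIrr hKeys hT3 hDet hKeysRed hLdsTwo hDGli h1252 hPCEnsNWR hL2oneNsNWR h61bNsEPR hLdsOneR hM1H hM5 hR0 hStL2 hPL hdpos hHCB eIrr eSt`, extra ∃-binders `μv`); PLUS 1 conjunct(s) EXPORTED by ★ RUNG0 `ellipticPackage_hyps_of_namedBlock₂₂`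 beyond the junction's hypotheses: `eRegH` = conjunct(s) 63 (definitional block EXTRAS, used by the consumers, not passed to the junction).  ED. 36 «L²-UNR + NOT-WILD + (b)-REST + K4′ NOT-WILD — J17 + R22»: this (S-𝔇)⁗ statement MOVES in FOUR conjuncts, each by the 2a′ «not wildly ramified» guard `¬ (Algebra.IsUnramifiedIn (𝓞 L) v.asIdeal ∨ Valued.v (2 : v.adicCompletion ↥(maximalRealSubfield L)) = 1) →`: #50 `hPCEnsNWR` ([K] via ★ row 69 p853708), #51 `hL2oneNsNW ↦ hL2oneNsNWR` (K2′ via ★ `…K2PrimeL2Tame` p853724∕p853740), #52 `h61bNsEP ↦ h61bNsEPR` (Prop. 12.6.1 (b)-REST via ★ p853805), #53 `hLdsOne ↦ hLdsOneR` (K4′ «l.d.s. norm one», guard after `∀ π ∈ P,`, via ★ 68-I-NW p853846 `…K4PrimeNotWild`) — all rebuilt inside ★ J17; heir LEAD T16-15∕T16-19 («36″»); the other 59 ≡ ED. 35 and stays a THEOREM in-leaf — now proved from the organ (S-𝔑) `stub_EllipticInputs` re-lettered in place to the outer list of ★ RUNG0 `F0P3cStCharTSRung0TwentyTwo.ellipticPackage_hyps_of_namedBlock₂₂`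 (`hBlock′` consequents 1–4 (K1, K2′, 12.6.1 (b), K4′) get the same guards in LOCKSTEP with ★ J17 (★ R22, rider pen LH6-p01 (g7)); outer letters 7, Cartan binders 12, pins 54, consequents 5–6 ((R0), POS-ONE) ≡ ED. 35); the leaf's literal sorries stay (S-β) and (S-𝔑).
label `πSt = St_H(ξ_v)`, the Haar measure `μZ` on `U(Φ₃)(L⁺_v) ⧸ Z`): THERE IS a §12.5 datum `𝔇 : EllipticData (U(Φ₃)(L⁺_v)) (H_v)` (★ TR carpet
`Ch12Sec5Defs`: Harish-Chandra characters AS FUNCTIONS, regular ∕ elliptic sets, Cartan subgroups and their Weyl data, the transfer maps `α ↦ α^G`,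
the square-integrable `H`-packets `Π²(H)` and the l.d.s. packets of `G`, the elliptic inner products), together with a formal-degree function `d`, a
type-(3) Cartan subgroup `T` and a parameter map `par` of the non-square-integrable classes into the tree's PAIR currency [§12.2 pp. 173–174], such that: (COMPAT) the datum's Haar measures, orbital-integral family, regular set, transfer relation and `Π²(H)` ARE the
organs' currency (`νQv`, `νHv`, `μZ`, `mQv`, ★ `IsRegularElt`, the Δ‴_{Φ₃}-matching ★ `IsLocalDeltaTransfer … mHv mQv`, `{St_H(ξ_v)} ∈ Π²(H)` [§12.1 p. 171]);
(CARPET) the relations ★ `EllipticData.WeylIntegrationFormula` [p. 182], ★ `EllipticData.UpSpec` [(12.5.1) p. 183], ★ `EllipticData.Prop1252` [Prop. 12.5.2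
p. 185], ★ `Ch12Sec6.PseudoCoeffExists` [§12.6 p. 187, [K]] (ED. 17: `PseudoCoeffTrace` «By the Weyl integration formula, `Tr(π′(f_π)) = ⟨χ_{π′}, χ_π⟩_e`» is DERIVED — ★ `F0P3cStCharTSPctOut` (LH6-p01 (g4)) from WIF + (M1∀) + (C1)(C2)(C3) + (L2D∀)), ★ `Ch12Sec6.Prop1261a∕b∕c` [Prop. 12.6.1 p. 188], ★ `Ch12Sec6.LdsCharactersOpposite`
[Prop. 12.6.2 p. 189], ★ `Ch12Sec6.EllipticOfNotPrincipalSeries`∕`EllipticClassification` [§12.1–12.2] hold at `𝔇`; (SOCKETS) the printed inputs no carpet states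
hold at `𝔇` — ★ `Ch12Sec5Inputs` (M1∀) = the four clauses of (M1) `CharRegularity` («`χ_π` measurable, locally integrable, locally constant on `G^r`, computing `Tr π`», Harish-Chandra [§1.6 p. 5]) READ FOR EVERY CLASS since ED. 17 (print's own scope; paid at the concrete datum by ★ «CHAR-FIELD★» `F0P3cStCharTSCharField` modulo ★ `Ch1.characterLocallyIntegrable`), (M1H) `PacketCharHRegularity`, (UPR) `UpRegularity`, (L2D-ell) «`D_G·χ_π ∈ L²(T, dγ)` on every elliptic Cartan representative, for every ELLIPTIC class» (ED. 17: the former (L2D∀) `L2CharOnTorusAll` ⟸ (L2D-ell) + (C2), ★ `F0P3cStCharTSL2dEll` (LH6-p02 (g4))),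
(U2) `L2UpOnTorus`, (DET) `DetNotL2`, (PIN) `PiNNotL2`, (M5) `PacketCharHNorm`, (DEF-H) the `H`-half `InnerHDefined χ_ρ χ_ρ` of `PacketInnerDefined`, (LDS) `LdsNotL2`, (C1) `EllCartanSubset`,
(C2) `EllCartanAE`, (C3) `NonEllCartanAE`, (LDS2) `LdsCardTwo`, (R0) `LdsPseudoCoeffTraceH {St_H(ξ_v)}`, and the definition-level coherence (E⊆R) «`G^e ⊆ G^r`» (`𝔇.ellG ⊆ 𝔇.regG`, p. 184) — ED. «SOCKETS OUT» (LH6-p02 (g4), ★ `F0P3cStCharTSSocketsOut`): the former sockets (DENS) `WeylDensity` [⟸ (C2)+(E⊆R)], (LDSE) `LdsElliptic` [⟸ Prop. 12.6.1 (c)+(LDS2)+(C2)] and the `G`-half of (DEF) [⟸ (U2)] are now THEOREMS; ED. «SOCKETS OUT II» (LH6-p05 (g4)): so are the former sockets (ELL) `EllipticOfL2` [⟸ the (PL) pair, ★ `F0P3cStCharTSEllOut` (LH6-p03 (g4))], (LDSU) `LdsEllipticPartner` [⟸ Prop. 12.6.1 (b)(c) + «`χ_{π¹} = −χ_{π²}`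 on `G^e`» + (LDS2) + (C2), ★ `F0P3cStCharTSLdsuOut` (LH6-p04 (g5))] and (MATE-UNIQ) [⟸ (PS2) + (NONL2-PAR) + ★ «PSE★» + Prop. 12.6.1 (b)(c) + [K] + (C2) + (SPLIT-NOT-ELL), ★ `F0P3cStCharTSMateUniqOut` (LH6-p02 (g4))] [§1.6 p. 6;
§12.1–12.2 pp. 171–174; §12.5 pp. 182–187; §12.6 pp. 187–189; (12.7.1) p. 192], and verbatim (ST-L2) (PI2-L2) [§12.1–12.2]; (PAR) the principal series
of the non-square-integrable classes in the PAIR currency ★ `cmPrincipalSeries`∕`cmTorusCharPair`: (PS1) traces of the irreducible `i_G(χ)`, (PS2) `χ_π + χ_σ =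
χ_{i_G(χ)}` for an elliptic pair, (PS3)=(JHL) the two members of an l.d.s. packet, (NONL2-PAR) constituent-of with continuous parameters, (UNIQ-PAR) the
parameter determines the class up to `W` and l.d.s. mates [§12.2 pp. 173–174]; (SPLIT-NOT-ELL) «a regular element of the split torus is not elliptic» [§12.5 p. 184] and (TOR) «the split-torus package: for every Haar measure on `M = E_vˣ × E¹_v` a torus transform `F_f`, a hyperbolic set `Ω` and pinned product characters with (WM∕L2M)(HM)(PSM)(SHF′)» [L. 12.7.1 (proof) p. 191; pp. 193–194; vanDijk1972] (ED. 5: these two replace ED. 3's transitional (F) «the principal-series disjunct of print's regrouping (12.7.1) is void», whose content is now the ★ theorem «PSE★» p849428 + ★ «TOR-DATA★» p849333 ∕ p849400 + the (TOR) sockets): no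
expansion `Σ b(π)χ_π + Σ d(χ)χ_{i_G(χ)}` of `χ_{St_H(ξ)}^G` with a non-zero continuous `W`-reduced `d` exists [L. 12.7.1 p. 191 + pp. 192–193: Fourier analysis on
the split torus `M ≅ E^* × E¹` against unitarity] — the binder `hF` of ★ p849145, which LH6-p05's ★ `F0P3cStCharTSSaTorus.false_of_saRegroup_disjunct` (p849030)
already derives from split-torus sockets (to replace (F) in a later edition once the torus data are constructed); and the three residues of the (S-b2) paragraph [L. 12.7.2 (proof) p. 194]: (PL) `f_π(1) = d(π)` for pseudo-coefficients of
square-integrable `π`, `d(π) > 0`; (T3) the regular elements of `T` are elliptic and their characteristic polynomials have no eigenvalue from `U(Φ₁)(L⁺_v)`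
(«Cartan subgroups of type (3) do not occur in `H`», §3.6); (GERM-3) the germ expansion of `Φ(γ, f)` on `Tʳ` near `1` has constant term `c·f(1)`, `c ≠ 0`
[§8.1].  EXACTLY the union of the hypotheses that LH6-p01 (g2)'s ★ `F0P3cStCharTSSaHead.stSupportFiniteSqInt_of_carpet_of_F` (p849145), LH6-p01's ★
`F0P3cStCharTSEllCompose.stEllipticNormTwo_of_carpet_of_lds_not_L2` (p848567) and LH6-p04's ★ `F0P3cStCharTSSgnCompose.stSignBalance_of_carpet` (p848889) consume
between their datum binder and `aX` ((L2D) `L2CharOnTorus` of p848567 is read off (L2D∀)) — so (S-a), (S-b1) and (S-b2) below are THEOREMS of this file modulo (S-𝔇).  SIZE: XL (a typer∕prover programme: the concrete datum — LH6-p01's census `CENSUS-DAT-HALF.v1` 69da5db868efcdb6: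
11∕44 fields fillable from ★ today, the rest wait for Harish-Chandra characters as functions and the Cartan∕Weyl bookkeeping of §12.5 — then Kazhdan's
orthogonality relations [K], Prop. 12.5.2, Prop. 12.6.1 and the sockets AT that datum).  Why it might fail AS TYPED: all eggs in one basket — a single
conjunct mistyped against print (a normalisation in (12.5.1) ∕ Prop. 12.5.2, the Weyl-density shape (DENS), the germ residue (GERM-3)) makes the package
unprovable although (S-b1)∕(S-b2) stay print-true; the COMPAT clauses pin `𝔇` to the organs' frame (`𝔇.orb = mQv`, `regG ↔ IsRegularElt`), so the datum
cannot be chosen freely to dodge a mistyped socket.  Repair path if a conjunct dies: re-letter that conjunct alone (ED. n+1, same package minus the dead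
clause plus its repaired text, the three ★ compose∕head theorems re-run), never the organs (S-a)∕(S-b1)∕(S-b2).
[cite: Rogawski1990, §12.1–12.2 pp. 171–174; (12.7.1) p. 192 (proof of Lemma 12.7.2); Lemma 12.7.1 p. 189]
[cite: Rogawski1990, §12.5 pp. 182–187; §12.6 pp. 187–189; Lemma 12.7.2 (proof) pp. 191–194] -/
theorem stub_EllipticPackage :
  ∀ (L : Type) [Field L] [NumberField L] [IsCMField L] (μ : HeckeCharacter L) (ξ : OneDimAutRepH L) (v : Pl L),
    (∀ w : PlacesOver L v, IsCMField.complexConj L • w.1 = w.1) → μ.IsUnitary →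
    (∀ x : Literature.NumberTheory.GaloisRepresentations.ideleGroup ↥(maximalRealSubfield L),
      μ (AdeleRing.ideleBaseChange (↥(maximalRealSubfield L)) L x) = quadraticHeckeCharCM L x) →
    ∀ [MeasurableSpace (HLoc L v)] [BorelSpace (HLoc L v)] [MeasurableSpace (Gqs L v)] [BorelSpace (Gqs L v)]
      (νHv : Measure (HLoc L v)) (νQv : Measure (Gqs L v))
      [νHv.IsHaarMeasure] [νHv.IsMulRightInvariant] [νQv.IsHaarMeasure] [νQv.IsMulRightInvariant],
    letI : ∀ a : HLoc L v, MeasurableSpace (HLoc L v ⧸ Subgroup.centralizer ({a} : Set (HLoc L v))) := fun _ => borel _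
    haveI : ∀ a : HLoc L v, BorelSpace (HLoc L v ⧸ Subgroup.centralizer ({a} : Set (HLoc L v))) := fun _ => ⟨rfl⟩
    letI : ∀ γ : Gqs L v, MeasurableSpace (Gqs L v ⧸ Subgroup.centralizer ({γ} : Set (Gqs L v))) := fun _ => borel _
    haveI : ∀ γ : Gqs L v, BorelSpace (Gqs L v ⧸ Subgroup.centralizer ({γ} : Set (Gqs L v))) := fun _ => ⟨rfl⟩
    ∀ (mHv : OrbitalMeasureFamily (HLoc L v)) (mQv : OrbitalMeasureFamily (Gqs L v)),
      mHv.IsCanonical (IsLocalGRegular L v) νHv →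
      mQv.IsCanonical (fun γ => IsRegularElt (γ.val : GL (Fin 3) (UnitaryGroup.LocalRing L v))) νQv →
      IsLocalDeltaTransferExists L (qsForm L) v ((finExplicitCollection L (qsForm L) μ (finExplicitDelta_conj_left_all L (qsForm L) μ) (finExplicitDelta_conj_right_all L (qsForm L) μ)) v) mHv mQv IsLocSmooth IsLocSmooth →
      ∀ (π₁ πSt : IrrClass (HLoc L v)),
        HLengthTwoLabels L v
          (torusCharPair (conjLocal L (IsCMField.complexConj L) v) (cmLocalForm L 2 v) (cmLocalForm_eq_over L 2 v) 0
            ((torusLocalComponent L (IsCMField.complexConj L) v ξ.η).comp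
                (quotConj (conjLocal L (IsCMField.complexConj L) v) (conjLocal_conjLocal_cm L v)) *
              halfModulusChar (UnitaryGroup.LocalRing L v))
            (torusLocalComponent L (IsCMField.complexConj L) v ξ.ψ))
          ((torusLocalComponent L (IsCMField.complexConj L) v ξ.ψ).comp (localDet (IsCMField.complexConj L) v (isUnit_antidiagOne_det L 1))) π₁ πSt →
        (∀ fH : HLoc L v → ℂ, IsLocSmooth fH → π₁.smoothTrace νHv fH = charDist (ξ.xiLocalChar v) νHv fH) →
      ∀ [MeasurableSpace (Gqs L v ⧸ Subgroup.center (Gqs L v))] [BorelSpace (Gqs L v ⧸ Subgroup.center (Gqs L v))]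
        (μZ : Measure (Gqs L v ⧸ Subgroup.center (Gqs L v))) [μZ.IsHaarMeasure],
      ∃ (𝔇 : Ch12Sec5.EllipticData (Gqs L v) (HLoc L v)) (d : IrrClass (Gqs L v) → ℝ) (T : Subgroup (Gqs L v))
        (par : IrrClass (Gqs L v) → (((UnitaryGroup.LocalRing L v)ˣ →* ℂˣ) × (↥(normOneUnits (conjLocal L (IsCMField.complexConj L) v)) →* ℂˣ))) (μv : (UnitaryGroup.LocalRing L v)ˣ →* ℂˣ),
        -- hC01
        𝔇.μG = νQv ∧
        -- hC02
        𝔇.μH = νHv ∧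
        -- hC03
        𝔇.μGZ = μZ ∧
        -- hC04
        𝔇.orb = mQv ∧
        -- hC05
        (∀ γ : Gqs L v, γ ∈ 𝔇.regG ↔ IsRegularElt (γ.val : GL (Fin 3) (UnitaryGroup.LocalRing L v))) ∧
        -- hC06
        (∀ (φ : Gqs L v → ℂ) (fH : ((UnitaryGroup.cmDatum L 2 (Matrix.of fun i j : Fin 2 => if i.val + j.val + 1 = 2 then (1 : L) else 0)).Local v × (UnitaryGroup.cmDatum L 1 (Matrix.of fun i j : Fin 1 => if i.val + j.val + 1 = 1 then (1 : L) else 0)).Local v) → ℂ), 𝔇.IsTransfer φ fH ↔ IsLocalDeltaTransfer L (qsForm L) v ((finExplicitCollection L (qsForm L) μ (finExplicitDelta_conj_left_all L (qsForm L) μ) (finExplicitDelta_conj_right_all L (qsForm L) μ)) v) mHv mQv fH φ) ∧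
        -- hC07
        ({πSt} : Finset (IrrClass (((UnitaryGroup.cmDatum L 2 (Matrix.of fun i j : Fin 2 => if i.val + j.val + 1 = 2 then (1 : L) else 0)).Local v × (UnitaryGroup.cmDatum L 1 (Matrix.of fun i j : Fin 1 => if i.val + j.val + 1 = 1 then (1 : L) else 0)).Local v)))) ∈ 𝔇.sqPacketsH ∧
        -- hE
        (∀ γ : Gqs L v, γ ∈ 𝔇.ellG ↔ IsRegularElt (γ.val : GL (Fin 3) (UnitaryGroup.LocalRing L v)) ∧ γ ∉ hyperbolicSet L v) ∧
        -- hchar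
        (∀ π : IrrClass (Gqs L v), Measurable (𝔇.char π) ∧ LocallyIntegrable (𝔇.char π) 𝔇.μG ∧
            (∀ x ∈ 𝔇.regG, ∀ᶠ y in 𝓝 x, 𝔇.char π y = 𝔇.char π x) ∧
            ∀ φ : Gqs L v → ℂ, IsLocSmooth φ → π.smoothTrace 𝔇.μG φ = ∫ x, φ x * 𝔇.char π x ∂𝔇.μG) ∧
        -- hAll
        (∀ T : Subgroup (Gqs L v), T ∈ 𝔇.cartanAll ↔ T = (cmBorelTriple L 3 v).M ∨ T ∈ 𝔇.cartanG) ∧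
        -- hHaar
        (𝔇.μT (cmBorelTriple L 3 v).M).IsHaarMeasure ∧
        -- hcart
        (∀ T ∈ 𝔇.cartanG, IsCompact (T : Set (Gqs L v)) ∧ ∃ γ₀ : Gqs L v, IsRegularElt (γ₀.val : GL (Fin 3) (UnitaryGroup.LocalRing L v)) ∧ T = Subgroup.centralizer ({γ₀} : Set (Gqs L v))) ∧
        -- hHaarG
        (∀ T ∈ 𝔇.cartanG, (𝔇.μT T).IsHaarMeasure) ∧
        -- hfinG
        (∀ T ∈ 𝔇.cartanG, IsFiniteMeasure (𝔇.μT T)) ∧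
        -- hker
        (∀ T ∈ 𝔇.cartanG, ∃ s : Finset (Subgroup ↥T), (∀ K ∈ s, IsClosed (K : Set ↥T) ∧ ¬ IsOpen (K : Set ↥T)) ∧ ∀ t : ↥T, ¬ IsRegularElt ((t : Gqs L v).val : GL (Fin 3) (UnitaryGroup.LocalRing L v)) → ∃ K ∈ s, t ∈ K) ∧
        -- eDG
        (∀ g : Gqs L v, 𝔇.DG g = ((NNReal.sqrt (NNReal.sqrt ((∏ w : PlacesOver L v, IsNonarchimedeanLocalField.normAbs (w.1.adicCompletion L) (((g.val : GL (Fin 3) (UnitaryGroup.LocalRing L v)).val.charpoly.discr) w)) * ((∏ w : PlacesOver L v, IsNonarchimedeanLocalField.normAbs (w.1.adicCompletion L) (((g.val : GL (Fin 3) (UnitaryGroup.LocalRing L v)).val.det) w)) ^ 2)⁻¹)) : NNReal) : ℝ)) ∧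
        -- eDH
        (∀ s : ((UnitaryGroup.cmDatum L 2 (Matrix.of fun i j : Fin 2 => if i.val + j.val + 1 = 2 then (1 : L) else 0)).Local v × (UnitaryGroup.cmDatum L 1 (Matrix.of fun i j : Fin 1 => if i.val + j.val + 1 = 1 then (1 : L) else 0)).Local v), 𝔇.DH s = ((NNReal.sqrt (NNReal.sqrt ((∏ w : PlacesOver L v, IsNonarchimedeanLocalField.normAbs (w.1.adicCompletion L) (((s.1.val : GL (Fin 2) (UnitaryGroup.LocalRing L v)).val.charpoly.discr) w)) * (∏ w : PlacesOver L v, IsNonarchimedeanLocalField.normAbs (w.1.adicCompletion L) (((s.1.val : GL (Fin 2) (UnitaryGroup.LocalRing L v)).val.det) w))⁻¹)) : NNReal) : ℝ)) ∧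
        -- hKH
        (∀ T ∈ 𝔇.cartanH, IsCompact (T : Set ((UnitaryGroup.cmDatum L 2 (Matrix.of fun i j : Fin 2 => if i.val + j.val + 1 = 2 then (1 : L) else 0)).Local v × (UnitaryGroup.cmDatum L 1 (Matrix.of fun i j : Fin 1 => if i.val + j.val + 1 = 1 then (1 : L) else 0)).Local v))) ∧
        -- hFH
        (∀ T ∈ 𝔇.cartanH, IsFiniteMeasure (𝔇.μTH T)) ∧
        -- hHBH
        (∀ ρ ∈ 𝔇.sqPacketsH, ∀ T ∈ 𝔇.cartanH, ∀ C : Set ((UnitaryGroup.cmDatum L 2 (Matrix.of fun i j : Fin 2 => if i.val + j.val + 1 = 2 then (1 : L) else 0)).Local v × (UnitaryGroup.cmDatum L 1 (Matrix.of fun i j : Fin 1 => if i.val + j.val + 1 = 1 then (1 : L) else 0)).Local v), IsCompact C → C ⊆ (T : Set ((UnitaryGroup.cmDatum L 2 (Matrix.of fun i j : Fin 2 => if i.val + j.val + 1 = 2 then (1 : L) else 0)).Local v × (UnitaryGroup.cmDatum L 1 (Matrix.of fun i j : Fin 1 => if i.val + j.val + 1 = 1 then (1 : L) else 0)).Local v))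 → ∃ B : ℝ, ∀ γ ∈ C, ‖(𝔇.DH γ : ℂ) * 𝔇.packetCharH ρ γ‖ ≤ B) ∧
        -- hNL
        (∀ π : IrrClass (Gqs L v), ¬ π.IsSquareIntegrable μZ → π.IsConstituentOf (UnitaryGroup.cmPrincipalSeries L 3 v (UnitaryGroup.cmTorusCharPair L v (par π).1 (par π).2)) ∧ Continuous (par π).1 ∧ Continuous (par π).2) ∧
        -- hPSpar
        (∀ π : IrrClass (Gqs L v), (∃ (χ₁ : (UnitaryGroup.LocalRing L v)ˣ →* ℂˣ) (χ₂ : ↥(normOneUnits (conjLocal L (IsCMField.complexConj L) v)) →* ℂˣ), Continuous (fun x => ((χ₁ x : ℂˣ) : ℂ)) ∧ Continuous (fun x => ((χ₂ x : ℂˣ) : ℂ)) ∧ (UnitaryGroup.cmPrincipalSeries L 3 v (UnitaryGroup.cmTorusCharPair L v χ₁ χ₂)).IsIrreducible ∧ π.IsConstituentOf (UnitaryGroup.cmPrincipalSeries L 3 v (UnitaryGroup.cmTorusCharPair L v χ₁ χ₂))) → (UnitaryGroup.cmPrincipalSeries L 3 v (UnitaryGroup.cmTorusCharPair L v (par π).1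 (par π).2)).IsIrreducible ∧ π.IsConstituentOf (UnitaryGroup.cmPrincipalSeries L 3 v (UnitaryGroup.cmTorusCharPair L v (par π).1 (par π).2)) ∧ Continuous (par π).1 ∧ Continuous (par π).2 ∧ Continuous (fun x => (((par π).1 x : ℂˣ) : ℂ)) ∧ Continuous (fun x => (((par π).2 x : ℂˣ) : ℂ)) ∧ ∀ (ν : Measure (Gqs L v)) (f : Gqs L v → ℂ), π.smoothTrace ν f = Representation.smoothTrace (G := Gqs L v) (UnitaryGroup.cmPrincipalSeries L 3 v (UnitaryGroup.cmTorusCharPair L v (par π).1 (par π).2)) ν f) ∧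
        -- hLdsF
        (∀ P : Finset (IrrClass (Gqs L v)), P ∈ 𝔇.ldsPackets ↔ (P.card = 2 ∧ ∃ (χ₁ : (UnitaryGroup.LocalRing L v)ˣ →* ℂˣ) (χ₂ : ↥(normOneUnits (conjLocal L (IsCMField.complexConj L) v)) →* ℂˣ), Continuous (fun x => ((χ₁ x : ℂˣ) : ℂ)) ∧ Continuous (fun x => ((χ₂ x : ℂˣ) : ℂ)) ∧ (∀ a : (UnitaryGroup.LocalRing L v)ˣ, (conjLocal L (IsCMField.complexConj L) v) (a : UnitaryGroup.LocalRing L v) = a → χ₁ a = 1) ∧ χ₁ ≠ 1 ∧ ∀ c : IrrClass (Gqs L v), c ∈ P ↔ c.IsConstituentOf (UnitaryGroup.cmPrincipalSeries L 3 v (UnitaryGroup.cmTorusCharPair L v χ₁ χ₂)))) ∧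
        -- hW
        (∀ (χ₁ : (UnitaryGroup.LocalRing L v)ˣ →* ℂˣ) (χ₂ : ↥(normOneUnits (conjLocal L (IsCMField.complexConj L) v)) →* ℂˣ), Continuous (fun x => ((χ₁ x : ℂˣ) : ℂ)) → Continuous (fun x => ((χ₂ x : ℂˣ) : ℂ)) → ∀ π π' : IrrClass (Gqs L v), ¬ π.IsSquareIntegrable μZ → ¬ π'.IsSquareIntegrable μZ → π.IsConstituentOf (UnitaryGroup.cmPrincipalSeries L 3 v (UnitaryGroup.cmTorusCharPair L v χ₁ χ₂)) → π'.IsConstituentOf (UnitaryGroup.cmPrincipalSeries L 3 v (UnitaryGroup.cmTorusCharPair L v χ₁ χ₂)) → par π = par π') ∧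
        -- hμq
        UnitaryGroup.IsQuadraticCharExtension (conjLocal L (IsCMField.complexConj L) v) μv ∧
        -- hμc
        (Continuous (fun x => ((μv x : ℂˣ) : ℂ))) ∧
        -- hStH
        (∀ a b : ((UnitaryGroup.cmDatum L 2 (Matrix.of fun i j : Fin 2 => if i.val + j.val + 1 = 2 then (1 : L) else 0)).Local v × (UnitaryGroup.cmDatum L 1 (Matrix.of fun i j : Fin 1 => if i.val + j.val + 1 = 1 then (1 : L) else 0)).Local v), 𝔇.stConjH a b ↔ IsLocalStablyConjH L v a b) ∧
        -- hRegH
        (∀ a : ((UnitaryGroup.cmDatum L 2 (Matrix.of fun i j : Fin 2 => if i.val + j.val + 1 = 2 then (1 : L) else 0)).Local v × (UnitaryGroup.cmDatum L 1 (Matrix.of fun i j : Fin 1 => if i.val + j.val + 1 = 1 then (1 : L) else 0)).Local v), IsLocalGRegular L v a → a ∈ 𝔇.regH) ∧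
        -- hUp
        (∀ (α : ((UnitaryGroup.cmDatum L 2 (Matrix.of fun i j : Fin 2 => if i.val + j.val + 1 = 2 then (1 : L) else 0)).Local v × (UnitaryGroup.cmDatum L 1 (Matrix.of fun i j : Fin 1 => if i.val + j.val + 1 = 1 then (1 : L) else 0)).Local v) → ℂ) (x : Gqs L v), 𝔇.up α x = if IsRegularElt (x.val : GL (Fin 3) (UnitaryGroup.LocalRing L v)) then ((𝔇.DG x : ℂ))⁻¹ * ∑ᶠ q : Quot (IsLocalStablyConjH L v), (if IsLocalGRegular L v q.out ∧ IsLocalNormPair L (qsForm L) v q.out x then finTau L v q.out μ * (𝔇.DH q.out : ℂ) * ((finKappaAt L v (qsForm L) q.out x : ℤ) : ℂ) * α q.out else 0) else 0) ∧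
        -- hHBHP
        (∀ ρ ∈ 𝔇.sqPacketsH, ∀ C : Set ((UnitaryGroup.cmDatum L 2 (Matrix.of fun i j : Fin 2 => if i.val + j.val + 1 = 2 then (1 : L) else 0)).Local v × (UnitaryGroup.cmDatum L 1 (Matrix.of fun i j : Fin 1 => if i.val + j.val + 1 = 1 then (1 : L) else 0)).Local v), IsCompact C → ∃ B : ℝ, ∀ s ∈ C, IsLocalGRegular L v s → ‖(𝔇.DH s : ℂ) * 𝔇.packetCharH ρ s‖ ≤ B) ∧
        -- hGerm
        (∃ (c : ℝ) (_ : c ≠ 0) (ι : Type) (S : Finset ι) (Λ : ι → ((Gqs L v) → ℂ) → ℂ) (Γ : ι → (Gqs L v) → ℂ) (γseq : ℕ → Gqs L v) (q : ℂ) (a : ι → ℕ) (g : ι → ℂ), (∀ f : (Gqs L v) → ℂ, IsLocSmooth f → ∀ᶠ γ in 𝓝[((T : Set (Gqs L v)) ∩ {γ | IsRegularElt (γ.val : GL (Fin 3) (UnitaryGroup.LocalRing L v))})] (1 : Gqs L v), classOrbitalIntegral mQv f (ConjClasses.mk γ) = (c : ℂ) * f 1 + ∑ u ∈ S, Λ u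 f * Γ u γ) ∧ (∀ n, γseq n ∈ (T : Set (Gqs L v)) ∧ IsRegularElt ((γseq n).val : GL (Fin 3) (UnitaryGroup.LocalRing L v))) ∧ Tendsto γseq atTop (𝓝 (1 : Gqs L v)) ∧ 1 < ‖q‖ ∧ (∀ u ∈ S, 1 ≤ a u) ∧ ∀ u ∈ S, ∀ n, Γ u (γseq n) = q ^ (n * a u) * g u) ∧
        -- hlabels
        (∀ ξ' : ((UnitaryGroup.cmDatum L 2 (Matrix.of fun i j : Fin 2 => if i.val + j.val + 1 = 2 then (1 : L) else 0)).Local v × (UnitaryGroup.cmDatum L 1 (Matrix.of fun i j : Fin 1 => if i.val + j.val + 1 = 1 then (1 : L) else 0)).Local v) →* ℂˣ, Continuous ξ' → ∃ (η₁ η₂ : ↥(normOneUnits (conjLocal L (IsCMField.complexConj L) v)) →* ℂˣ), Continuous (fun x => ((η₁ x : ℂˣ) : ℂ)) ∧ Continuous (fun x => ((η₂ x : ℂˣ) : ℂ)) ∧ KeysCaseTwoLabels L v μv η₁ η₂ (𝔇.pi2 ξ') (𝔇.piN ξ')) ∧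
        -- hSt
        (∀ ψ' : ↥(Subgroup.center (Gqs L v)) →* ℂˣ, Continuous ψ' → ∃ ψ : ↥(normOneUnits (conjLocal L (IsCMField.complexConj L) v)) →* ℂˣ, Continuous ψ ∧ 𝔇.stG ψ' ≠ 𝔇.detG ψ' ∧ ∀ c : IrrClass (Gqs L v), c.IsConstituentOf (UnitaryGroup.cmPrincipalSeries L 3 v (UnitaryGroup.cmTorusCharPair L v (halfModulusChar (UnitaryGroup.LocalRing L v) * halfModulusChar (UnitaryGroup.LocalRing L v))⁻¹ ψ)) ↔ (c = 𝔇.stG ψ' ∨ c = 𝔇.detG ψ')) ∧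
        -- hStJH
        (∀ ψ₀ : ↥(normOneUnits (conjLocal L (IsCMField.complexConj L) v)) →* ℂˣ, Continuous (fun x => ((ψ₀ x : ℂˣ) : ℂ)) → ∃ ψ : ↥(Subgroup.center (Gqs L v)) →* ℂˣ, Continuous ψ ∧ ∀ c : IrrClass (Gqs L v), c.IsConstituentOf (UnitaryGroup.cmPrincipalSeries L 3 v (UnitaryGroup.cmTorusCharPair L v (halfModulusChar (UnitaryGroup.LocalRing L v) * halfModulusChar (UnitaryGroup.LocalRing L v))⁻¹ ψ₀)) ↔ (c = 𝔇.stG ψ ∨ c = 𝔇.detG ψ)) ∧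
        -- hKeysJH
        (∀ (η₁ η₂ : ↥(normOneUnits (conjLocal L (IsCMField.complexConj L) v)) →* ℂˣ), Continuous (fun x => ((η₁ x : ℂˣ) : ℂ)) → Continuous (fun x => ((η₂ x : ℂˣ) : ℂ)) → ∃ ξ' : ((UnitaryGroup.cmDatum L 2 (Matrix.of fun i j : Fin 2 => if i.val + j.val + 1 = 2 then (1 : L) else 0)).Local v × (UnitaryGroup.cmDatum L 1 (Matrix.of fun i j : Fin 1 => if i.val + j.val + 1 = 1 then (1 : L) else 0)).Local v) →* ℂˣ, Continuous ξ' ∧ KeysCaseTwoLabels L v μv η₁ η₂ (𝔇.pi2 ξ') (𝔇.piN ξ')) ∧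
        -- hM1lc
        (∀ ρ ∈ 𝔇.sqPacketsH, ∀ a : ((UnitaryGroup.cmDatum L 2 (Matrix.of fun i j : Fin 2 => if i.val + j.val + 1 = 2 then (1 : L) else 0)).Local v × (UnitaryGroup.cmDatum L 1 (Matrix.of fun i j : Fin 1 => if i.val + j.val + 1 = 1 then (1 : L) else 0)).Local v), IsLocalGRegular L v a → ∀ᶠ a' in 𝓝 a, 𝔇.packetCharH ρ a' = 𝔇.packetCharH ρ a) ∧
        -- hcovA
        (∀ γ : Gqs L v, IsRegularElt (γ.val : GL (Fin 3) (UnitaryGroup.LocalRing L v)) → ∃ T' ∈ 𝔇.cartanAll, ∃ x : Gqs L v, ∀ g : Gqs L v, g ∈ Subgroup.centralizer ({γ} : Set (Gqs L v)) ↔ x⁻¹ * g * x ∈ T') ∧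
        -- hncA
        (∀ T' ∈ 𝔇.cartanAll, ∀ T'' ∈ 𝔇.cartanAll, T' ≠ T'' → ∀ y : Gqs L v, ¬ ∀ h : Gqs L v, h ∈ T'' ↔ y⁻¹ * h * y ∈ T') ∧
        -- hcptA
        (∀ T' ∈ 𝔇.cartanAll, T' ≠ (cmBorelTriple L 3 v).M → IsCompact (T' : Set (Gqs L v))) ∧
        -- hinvT
        (∀ T' ∈ 𝔇.cartanAll, (𝔇.μT T').IsInvInvariant) ∧
        -- hcoreT
        (∀ T' ∈ 𝔇.cartanAll, 𝔇.μT T' (compactCore ↥T') = 1) ∧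
        -- hIrr
        (∀ π ∈ 𝔇.irredPS, ∃ (χ₁ : (UnitaryGroup.LocalRing L v)ˣ →* ℂˣ) (χ₂ : ↥(normOneUnits (conjLocal L (IsCMField.complexConj L) v)) →* ℂˣ), Continuous (fun x => ((χ₁ x : ℂˣ) : ℂ)) ∧ Continuous (fun x => ((χ₂ x : ℂˣ) : ℂ)) ∧ (UnitaryGroup.cmPrincipalSeries L 3 v (UnitaryGroup.cmTorusCharPair L v χ₁ χ₂)).IsIrreducible ∧ π.IsConstituentOf (UnitaryGroup.cmPrincipalSeries L 3 v (UnitaryGroup.cmTorusCharPair L v χ₁ χ₂))) ∧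
        -- hKeys
        (∀ ξ' : ((UnitaryGroup.cmDatum L 2 (Matrix.of fun i j : Fin 2 => if i.val + j.val + 1 = 2 then (1 : L) else 0)).Local v × (UnitaryGroup.cmDatum L 1 (Matrix.of fun i j : Fin 1 => if i.val + j.val + 1 = 1 then (1 : L) else 0)).Local v) →* ℂˣ, (𝔇.pi2 ξ').IsSquareIntegrable 𝔇.μGZ ∧ ¬ (𝔇.piN ξ').IsSquareIntegrable 𝔇.μGZ) ∧
        -- hT3
        (∀ γ ∈ T, IsRegularElt (γ.val : GL (Fin 3) (UnitaryGroup.LocalRing L v)) → ∀ c : UnitaryGroup.LocalRing L v, ¬ ((γ.val.val : Matrix (Fin 3) (Fin 3) (UnitaryGroup.LocalRing L v)).charpoly).IsRoot c) ∧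
        -- hDet
        𝔇.DetNotL2 ∧
        -- hKeysRed
        (∀ (χ₁ : (UnitaryGroup.LocalRing L v)ˣ →* ℂˣ) (χ₂ : ↥(normOneUnits (conjLocal L (IsCMField.complexConj L) v)) →* ℂˣ), Continuous (fun x => ((χ₁ x : ℂˣ) : ℂ)) → Continuous (fun x => ((χ₂ x : ℂˣ) : ℂ)) → (∃ N : Subrepresentation (UnitaryGroup.cmPrincipalSeries L 3 v (UnitaryGroup.cmTorusCharPair L v χ₁ χ₂)), N ≠ ⊥ ∧ N ≠ ⊤) → (χ₁ = halfModulusChar (UnitaryGroup.LocalRing L v) * halfModulusChar (UnitaryGroup.LocalRing L v) ∨ χ₁ = (halfModulusChar (UnitaryGroup.LocalRing L v) * halfModulusChar (UnitaryGroup.LocalRing L v))⁻¹) ∨ (∃ η : (UnitaryGroup.LocalRing L v)ˣ →* ℂˣ, IsQuadraticCharExtension (conjLocal L (IsCMField.complexConj L) v) η ∧ Continuous (fun x => ((η x : ℂˣ) : ℂ)) ∧ (χ₁ = η * halfModulusChar (UnitaryGroup.LocalRing L v) ∨ χ₁ = η * (halfModulusChar (UnitaryGroup.LocalRing L v))⁻¹))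 ∨ (χ₁ ≠ 1 ∧ ∀ a : (UnitaryGroup.LocalRing L v)ˣ, (conjLocal L (IsCMField.complexConj L) v) (a : UnitaryGroup.LocalRing L v) = a → χ₁ a = 1)) ∧
        -- hLdsTwo
        (∀ (χ₁ : (UnitaryGroup.LocalRing L v)ˣ →* ℂˣ) (χ₂ : ↥(normOneUnits (conjLocal L (IsCMField.complexConj L) v)) →* ℂˣ), Continuous (fun x => ((χ₁ x : ℂˣ) : ℂ)) → Continuous (fun x => ((χ₂ x : ℂˣ) : ℂ)) → (∀ a : (UnitaryGroup.LocalRing L v)ˣ, (conjLocal L (IsCMField.complexConj L) v) (a : UnitaryGroup.LocalRing L v) = a → χ₁ a = 1) → χ₁ ≠ 1 → ∃ P : Finset (IrrClass (Gqs L v)), P.card = 2 ∧ ∀ c : IrrClass (Gqs L v), c ∈ P ↔ c.IsConstituentOf (UnitaryGroup.cmPrincipalSeries L 3 v (UnitaryGroup.cmTorusCharPair L v χ₁ χ₂))) ∧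
        -- hDGli
        LocallyIntegrable (fun x : Gqs L v => (𝔇.DG x)⁻¹) 𝔇.μG ∧
        -- h1252
        𝔇.Prop1252 ∧
        -- hPCEnsNWR
        (∀ π : IrrClass (Gqs L v), 𝔇.IsEllipticRep π → ¬ π.IsSupercuspidal → ¬ (Algebra.IsUnramifiedIn (𝓞 L) v.asIdeal ∨ Valued.v (2 : v.adicCompletion ↥(maximalRealSubfield L)) = 1) → ¬ ((Algebra.IsUnramifiedIn (𝓞 L) v.asIdeal ∨ Valued.v (2 : v.adicCompletion ↥(maximalRealSubfield L)) = 1) ∧ ∃ ψ : ↥(Subgroup.center (Gqs L v)) →* ℂˣ, Continuous ψ ∧ (π = 𝔇.stG ψ ∨ π = 𝔇.detG ψ)) → ∃ f : Gqs L v → ℂ, 𝔇.IsPseudoCoeff π f) ∧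
        -- hL2oneNsNWR
        (∀ σ : IrrClass (Gqs L v), 𝔇.IsL2 σ → ¬ σ.IsSupercuspidal → ¬ (Algebra.IsUnramifiedIn (𝓞 L) v.asIdeal ∨ Valued.v (2 : v.adicCompletion ↥(maximalRealSubfield L)) = 1) → ¬ ((Algebra.IsUnramifiedIn (𝓞 L) v.asIdeal ∨ Valued.v (2 : v.adicCompletion ↥(maximalRealSubfield L)) = 1) ∧ ∃ ψ : ↥(Subgroup.center (Gqs L v)) →* ℂˣ, Continuous ψ ∧ σ = 𝔇.stG ψ) → 𝔇.innerG (𝔇.char σ) (𝔇.char σ) = 1) ∧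
        -- h61bNsEPR
        (∀ π π' : IrrClass (Gqs L v), 𝔇.IsEllipticRep π → 𝔇.IsEllipticRep π' → ¬ π.IsSupercuspidal → ¬ π'.IsSupercuspidal → ¬ (Algebra.IsUnramifiedIn (𝓞 L) v.asIdeal ∨ Valued.v (2 : v.adicCompletion ↥(maximalRealSubfield L)) = 1) → ¬ ((Algebra.IsUnramifiedIn (𝓞 L) v.asIdeal ∨ Valued.v (2 : v.adicCompletion ↥(maximalRealSubfield L)) = 1) ∧ (∃ ψ : ↥(Subgroup.center (Gqs L v)) →* ℂˣ, Continuous ψ ∧ (π = 𝔇.stG ψ ∨ π = 𝔇.detG ψ)) ∧ (∃ ψ' : ↥(Subgroup.center (Gqs L v)) →* ℂˣ, Continuous ψ' ∧ (π' = 𝔇.stG ψ' ∨ π' = 𝔇.detG ψ'))) → 𝔇.innerG (𝔇.char π) (𝔇.char π') ≠ 0 → π ≠ π' → 𝔇.IsEllipticPair π π') ∧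
        -- hLdsOneR
        (∀ P ∈ 𝔇.ldsPackets, ∀ π ∈ P, ¬ (Algebra.IsUnramifiedIn (𝓞 L) v.asIdeal ∨ Valued.v (2 : v.adicCompletion ↥(maximalRealSubfield L)) = 1) → 𝔇.innerG (𝔇.char π) (𝔇.char π) = 1) ∧
        -- hM1H
        𝔇.PacketCharHRegularity ∧
        -- hM5
        𝔇.PacketCharHNorm ∧
        -- hR0
        𝔇.LdsPseudoCoeffTraceH ({πSt} : Finset (IrrClass (((UnitaryGroup.cmDatum L 2 (Matrix.of fun i j : Fin 2 => if i.val + j.val + 1 = 2 then (1 : L) else 0)).Local v × (UnitaryGroup.cmDatum L 1 (Matrix.of fun i j : Fin 1 => if i.val + j.val + 1 = 1 then (1 : L) else 0)).Local v)))) ∧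
        -- hStL2
        (∀ ψ' : ↥(Subgroup.center (Gqs L v)) →* ℂˣ, Continuous ψ' → 𝔇.IsL2 (𝔇.stG ψ')) ∧
        -- hPL
        (∀ (π : IrrClass (Gqs L v)) (f : Gqs L v → ℂ), 𝔇.IsL2 π → 𝔇.IsPseudoCoeff π f → f 1 = (d π : ℂ)) ∧
        -- hdpos
        (∀ π : IrrClass (Gqs L v), 𝔇.IsL2 π → 0 < d π) ∧
        -- hHCB
        Summit.HodgeConjecture.HodgeConjecture.Cruxes.H413.K2E3CharLettersLeThreeDefs.normalizedCharacter_locallyBoundedLeThree ∧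
        -- eIrr
        (∀ π : IrrClass (Gqs L v), (∃ (χ₁ : (UnitaryGroup.LocalRing L v)ˣ →* ℂˣ) (χ₂ : ↥(normOneUnits (conjLocal L (IsCMField.complexConj L) v)) →* ℂˣ), Continuous (fun x => ((χ₁ x : ℂˣ) : ℂ)) ∧ Continuous (fun x => ((χ₂ x : ℂˣ) : ℂ)) ∧ (UnitaryGroup.cmPrincipalSeries L 3 v (UnitaryGroup.cmTorusCharPair L v χ₁ χ₂)).IsIrreducible ∧ π.IsConstituentOf (UnitaryGroup.cmPrincipalSeries L 3 v (UnitaryGroup.cmTorusCharPair L v χ₁ χ₂))) → π ∈ 𝔇.irredPS) ∧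
        -- eSt
        (∃ (ιZ : ↥(normOneUnits (conjLocal L (IsCMField.complexConj L) v)) →* ↥(Subgroup.center (Gqs L v))) (detZ : (Gqs L v) →* ↥(Subgroup.center (Gqs L v))), Continuous ιZ ∧ Continuous detZ ∧ (∀ z : ↥(normOneUnits (conjLocal L (IsCMField.complexConj L) v)), ((ιZ z).val.val.val : Matrix (Fin 3) (Fin 3) (UnitaryGroup.LocalRing L v)) = (((z : (UnitaryGroup.LocalRing L v)ˣ) : UnitaryGroup.LocalRing L v)) • (1 : Matrix (Fin 3) (Fin 3) (UnitaryGroup.LocalRing L v))) ∧ (∀ g : (Gqs L v), ((detZ g).val.val.val : Matrix (Fin 3) (Fin 3) (UnitaryGroup.LocalRing L v)) = (g.val.val : Matrix (Fin 3) (Fin 3) (UnitaryGroup.LocalRing L v)).det • (1 : Matrix (Fin 3) (Fin 3) (UnitaryGroup.LocalRing L v))) ∧ ∀ ψ : ↥(Subgroup.center (Gqs L v)) →* ℂˣ, Continuous ψ → (∃ hopen : IsOpen (((ψ.comp detZ).ker : Subgroup (Gqs L v)) : Set (Gqs L v)), 𝔇.detG ψ = IrrClass.mk (SmoothIrrep.ofChar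 (ψ.comp detZ) hopen)) ∧ 𝔇.stG ψ ≠ 𝔇.detG ψ ∧ (∀ c : IrrClass (Gqs L v), c.IsConstituentOf (cmPrincipalSeries L 3 v (cmTorusCharPair L v (halfModulusChar (UnitaryGroup.LocalRing L v) * halfModulusChar (UnitaryGroup.LocalRing L v))⁻¹ (ψ.comp ιZ))) ↔ (c = 𝔇.stG ψ ∨ c = 𝔇.detG ψ)) ∧ (𝔇.stG ψ).IsSquareIntegrable μZ ∧ ¬ (𝔇.detG ψ).IsSquareIntegrable μZ) ∧
        -- eRegH
        (∀ a : ((UnitaryGroup.cmDatum L 2 (Matrix.of fun i j : Fin 2 => if i.val + j.val + 1 = 2 then (1 : L) else 0)).Local v × (UnitaryGroup.cmDatum L 1 (Matrix.of fun i j : Fin 1 => if i.val + j.val + 1 = 1 then (1 : L) else 0)).Local v), a ∈ 𝔇.regH ↔ IsLocalGRegular L v a) := by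
  -- ED. 36 «L²-UNR + NOT-WILD + (b)-REST + K4′ NOT-WILD — J17 + R22» («RUNG0 CONSUMED» since ED. 22): (S-𝔇)⁗ is a THEOREM in-leaf modulo the organ (S-𝔑) `stub_EllipticInputs`, by ★ RUNG0 `F0P3cStCharTSRung0TwentyTwo.ellipticPackage_hyps_of_namedBlock₂₂` (rider pen LH6-p01 (g7))
  intro L _ _ _ μ ξ v hns hμu hμω _ _ _ _ νHv νQv _ _ _ _ mHv mQv hcanH hcanQ hTv π₁ πSt hHL hπ₁ _ _ μZ _
  letI : ∀ a : HLoc L v, MeasurableSpace (HLoc L v ⧸ Subgroup.centralizer ({a} : Set (HLoc L v))) := fun _ => borel _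
  haveI : ∀ a : HLoc L v, BorelSpace (HLoc L v ⧸ Subgroup.centralizer ({a} : Set (HLoc L v))) := fun _ => ⟨rfl⟩
  letI : ∀ γ : Gqs L v, MeasurableSpace (Gqs L v ⧸ Subgroup.centralizer ({γ} : Set (Gqs L v))) := fun _ => borel _
  haveI : ∀ γ : Gqs L v, BorelSpace (Gqs L v ⧸ Subgroup.centralizer ({γ} : Set (Gqs L v))) := fun _ => ⟨rfl⟩
  obtain ⟨hHC, hHCB, T, hT3, hGerm, hKeysRed, hBlock⟩ :=
    stub_EllipticInputs L μ ξ v hns hμu hμω νHv νQv mHv mQv hcanH hcanQ hTv π₁ πSt hHL hπ₁ μZ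
  exact K2E3Rung0LeThree.ellipticPackage_hyps_of_namedBlock₂₂ L μ ξ v hns hμu hμω νHv νQv mHv mQv hcanH hcanQ hTv π₁ πSt hHL hπ₁ μZ
    hHC hHCB T hT3 hGerm hKeysRed hBlock

/-- **(S-a) — [Rogawski1990, Lemma 12.7.2, first half of the proof pp. 191–193] FOR `ρ = St_H(ξ_v)` ON `U(Φ₃)(L⁺_v)`: THE SUPPORT IS FINITE AND
SQUARE-INTEGRABLE.**  Given a (β)-datum `aX` (countable support, unitarizable members, the absolutely convergent identity on Δ‴_{Φ₃}-matched smooth pairs), the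
support of `aX` is finite and every member is square-integrable modulo the centre (★ `IrrClass.IsSquareIntegrable μZ`, `μZ` the head's Haar measure on
`U(Φ₃)(L⁺_v) ⧸ Z`).  Print: `X = X′ ⊔ X″ ⊔ X‴`; `X″` finite by pseudo-coefficients [p. 191 (1)–(2)]; on `φ` supported in the regular set of the split torus `M`
the identity restricts to `M ≅ E^*`, and Fourier analysis of `χ(π^{nt})`, `χ(i_{G,M}(θ))` against UNITARITY of the `π` (`|χ^π(η)|^{±1} ≥ c > 1` off `Y′`) forces
`X‴ = ∅` and `a(π^{nt}) = 0` [pp. 192–193].  Why it might fail AS TYPED: needs the tree's `IsLocSmooth`∕Δ‴-matching to contain the print test functions supported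
near `M`-regular elements (it does: locally constant compactly supported); `IsSquareIntegrable` is asked of every representative of the class (★ definition).
Hypothesis (T_v) «a smooth Δ‴_{Φ₃}-transfer `f^H` EXISTS for every smooth `φ` on `U(Φ₃)(L⁺_v)`, for the families `(mHv, mQv)`» (★ `IsLocalDeltaTransferExists … mHv mQv
IsLocSmooth IsLocSmooth`) is [§4.9 Prop. 4.9.1 (a)]; print uses it for the pseudo-coefficients' transfers (p. 191) and for `f = Σ a(π) f_π` (p. 194); it is
discharged (not here) by LH6-p01's ★ «QS» from the closer's row `stub_N6ns` read at the inner form's canonical families and transported along the frame.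
[cite: Rogawski1990, Lemma 12.7.2 (proof) pp. 191–193; §12.2 pp. 173–174; §4.9 Prop. 4.9.1 (a) p. 55] -/
theorem stub_StSupportFiniteSqInt :
  ∀ (L : Type) [Field L] [NumberField L] [IsCMField L] (μ : HeckeCharacter L) (ξ : OneDimAutRepH L) (v : Pl L),
    (∀ w : PlacesOver L v, IsCMField.complexConj L • w.1 = w.1) → μ.IsUnitary →
    (∀ x : Literature.NumberTheory.GaloisRepresentations.ideleGroup ↥(maximalRealSubfield L),
      μ (AdeleRing.ideleBaseChange (↥(maximalRealSubfield L)) L x) = quadraticHeckeCharCM L x) →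
    ∀ [MeasurableSpace (HLoc L v)] [BorelSpace (HLoc L v)] [MeasurableSpace (Gqs L v)] [BorelSpace (Gqs L v)]
      (νHv : Measure (HLoc L v)) (νQv : Measure (Gqs L v))
      [νHv.IsHaarMeasure] [νHv.IsMulRightInvariant] [νQv.IsHaarMeasure] [νQv.IsMulRightInvariant],
    letI : ∀ a : HLoc L v, MeasurableSpace (HLoc L v ⧸ Subgroup.centralizer ({a} : Set (HLoc L v))) := fun _ => borel _
    haveI : ∀ a : HLoc L v, BorelSpace (HLoc L v ⧸ Subgroup.centralizer ({a} : Set (HLoc L v))) := fun _ => ⟨rfl⟩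
    letI : ∀ γ : Gqs L v, MeasurableSpace (Gqs L v ⧸ Subgroup.centralizer ({γ} : Set (Gqs L v))) := fun _ => borel _
    haveI : ∀ γ : Gqs L v, BorelSpace (Gqs L v ⧸ Subgroup.centralizer ({γ} : Set (Gqs L v))) := fun _ => ⟨rfl⟩
    ∀ (mHv : OrbitalMeasureFamily (HLoc L v)) (mQv : OrbitalMeasureFamily (Gqs L v)),
      mHv.IsCanonical (IsLocalGRegular L v) νHv →
      mQv.IsCanonical (fun γ => IsRegularElt (γ.val : GL (Fin 3) (UnitaryGroup.LocalRing L v))) νQv →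
      IsLocalDeltaTransferExists L (qsForm L) v ((finExplicitCollection L (qsForm L) μ (finExplicitDelta_conj_left_all L (qsForm L) μ) (finExplicitDelta_conj_right_all L (qsForm L) μ)) v) mHv mQv IsLocSmooth IsLocSmooth →
      ∀ (π₁ πSt : IrrClass (HLoc L v)),
        HLengthTwoLabels L v
          (torusCharPair (conjLocal L (IsCMField.complexConj L) v) (cmLocalForm L 2 v) (cmLocalForm_eq_over L 2 v) 0
            ((torusLocalComponent L (IsCMField.complexConj L) v ξ.η).comp
                (quotConj (conjLocal L (IsCMField.complexConj L) v) (conjLocal_conjLocal_cm L v)) *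
              halfModulusChar (UnitaryGroup.LocalRing L v))
            (torusLocalComponent L (IsCMField.complexConj L) v ξ.ψ))
          ((torusLocalComponent L (IsCMField.complexConj L) v ξ.ψ).comp (localDet (IsCMField.complexConj L) v (isUnit_antidiagOne_det L 1))) π₁ πSt →
        (∀ fH : HLoc L v → ℂ, IsLocSmooth fH → π₁.smoothTrace νHv fH = charDist (ξ.xiLocalChar v) νHv fH) →
      ∀ [MeasurableSpace (Gqs L v ⧸ Subgroup.center (Gqs L v))] [BorelSpace (Gqs L v ⧸ Subgroup.center (Gqs L v))]
        (μZ : Measure (Gqs L v ⧸ Subgroup.center (Gqs L v))) [μZ.IsHaarMeasure],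
      ∀ aX : IrrClass (Gqs L v) → ℤ, (Function.support aX).Countable →
        (∀ π : IrrClass (Gqs L v), aX π ≠ 0 → π.IsUnitarizable) →
        (∀ (fH : HLoc L v → ℂ) (φ : Gqs L v → ℂ), IsLocSmooth fH → IsLocSmooth φ →
            IsLocalDeltaTransfer L (qsForm L) v ((finExplicitCollection L (qsForm L) μ (finExplicitDelta_conj_left_all L (qsForm L) μ) (finExplicitDelta_conj_right_all L (qsForm L) μ)) v) mHv mQv fH φ →
            Summable (fun π : IrrClass (Gqs L v) => (aX π : ℂ) * π.smoothTrace νQv φ) ∧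
              ∑' π : IrrClass (Gqs L v), (aX π : ℂ) * π.smoothTrace νQv φ = πSt.smoothTrace νHv fH) →
        (Function.support aX).Finite ∧ ∀ π : IrrClass (Gqs L v), aX π ≠ 0 → π.IsSquareIntegrable μZ := by
  -- ED. 3 «PACKAGE CUT»: (S-a) ⟸ (S-𝔇) by ★ «Sa-HEAD» `F0P3cStCharTSSaHead.stSupportFiniteSqInt_of_carpet_of_F` (LH6-p01 (g2), over ★ (R) p848976 of LH6-p01 (g0) and LH6-p05's ★ «Sa-COMPOSE»∕K1b∕«L2-FIN»∕«FIN-OF-L2») — kernel-checked, no `sorry` here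
  intro L _ _ _ μ ξ v hns hμu hμω _ _ _ _ νHv νQv _ _ _ _ mHv mQv hcanH hcanQ hTv π₁ πSt hHL hπ₁ _ _ μZ _ aX hcnt hunit hid
  letI : ∀ a : HLoc L v, MeasurableSpace (HLoc L v ⧸ Subgroup.centralizer ({a} : Set (HLoc L v))) := fun _ => borel _
  haveI : ∀ a : HLoc L v, BorelSpace (HLoc L v ⧸ Subgroup.centralizer ({a} : Set (HLoc L v))) := fun _ => ⟨rfl⟩
  letI : ∀ γ : Gqs L v, MeasurableSpace (Gqs L v ⧸ Subgroup.centralizer ({γ} : Set (Gqs L v))) := fun _ => borel _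
  haveI : ∀ γ : Gqs L v, BorelSpace (Gqs L v ⧸ Subgroup.centralizer ({γ} : Set (Gqs L v))) := fun _ => ⟨rfl⟩
  obtain ⟨𝔇, d, T, par, μv, hC01, hC02, hC03, hC04, hC05, hC06, hC07, hE, hchar, hAll, hHaar, hcart, hHaarG, hfinG, hker, eDG, eDH, hKH, hFH, hHBH, hNL, hPSpar, hLdsF, hW, hμq, hμc, hStH, hRegH, hUp, hHBHP, hGerm, hlabels, hSt, hStJH, hKeysJH, hM1lc, hcovA, hncA, hcptA, hinvT, hcoreT, hIrr, hKeys, hT3, hDet, hKeysRed, hLdsTwo, hDGli, h1252, hPCEnsNWR, hL2oneNsNWR, h61bNsEPR, hLdsOneR, hM1H, hM5, hR0, hStL2, hPL, hdpos, hHCB, eIrr, eSt, eRegH⟩ :=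
    stub_EllipticPackage L μ ξ v hns hμu hμω νHv νQv mHv mQv hcanH hcanQ hTv π₁ πSt hHL hπ₁ μZ
  -- ED. 36: the 47-conjunct body of ED. 17 is RE-DERIVED from the field equations + named inputs by the ★ junction `F0P3cStCharTSDatumJunction17.ellipticPackage_body_of_inputs₁₇`
  obtain ⟨hμG, hμH, hμGZ, h𝔬, hreg, hTr, hρ, hW, hUp, h52, hPCE, h61a, h61b, h61c, hLO, hEONPS, hEC, hM1, hHCH, hUpReg, hER, hL2ell, hUdom, hDet, hPiN, hM5, hDefH, hLds, hsub, hTell, hTnon, hLds2, hR0, hStL2, hPi2L2, hPS1, hPS2, hPS3, hNP, hUP, hPl, hdpos, hT3, hgerm, hsplit, hHCB, hTOR⟩ :=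
    K2E3DatumJunction17LeThree.ellipticPackage_body_of_inputs₁₇ L μ ξ v hns hμu hμω νHv νQv mHv mQv hcanH hcanQ hTv π₁ πSt hHL hπ₁ μZ 𝔇 d T par μv
      hC01 hC02 hC03 hC04 hC05 hC06 hC07 hE hchar hAll hHaar hcart hHaarG hfinG hker eDG eDH hKH hFH hHBH hNL hPSpar hLdsF hW hμq hμc hStH hRegH hUp hHBHP hGerm hlabels hSt hStJH hKeysJH hM1lc hcovA hncA hcptA hinvT hcoreT hIrr hKeys hT3 hDet hKeysRed hLdsTwo hDGli h1252 hPCEnsNWR hL2oneNsNWR h61bNsEPR hLdsOneR hM1H hM5 hR0 hStL2 hPL hdpos hHCB eIrr eSt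
  -- ED. 17: (M1) is read for every class in the package; the ★ heads consume its square-integrable reading
  have hHC : 𝔇.CharRegularity := fun π _ => hM1 π
  -- ED. 17: (L2D∀) from its elliptic instances (★ «L2D-ELL★», LH6-p02 (g4))
  have hL2all : 𝔇.L2CharOnTorusAll := F0P3cStCharTSL2dEll.l2CharOnTorusAll_of_elliptic 𝔇 hTell hL2ell
  -- ED. 17: the carpet `PseudoCoeffTrace` «by the Weyl integration formula» (★ «PCT-OUT★», LH6-p01 (g4))
  have hPCT : Ch12Sec6.PseudoCoeffTrace 𝔇 := F0P3cStCharTSPctOut.pseudoCoeffTrace_Gqs L v hns νQv 𝔇 hμG hreg hM1 hW hsub hTell hTnon hL2all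
  -- ED. 26 «UP-TR (j1) LB RE-LETTER»: the head is the ★ `_LB` twin (body conjunct #9 is now `𝔇.UpSpecLB`; the local-boundedness antecedent is fed from the package's own `hHBHP` along the `regH` pin).
  -- ED. «TORUS BLOCK ↦ HC-BOUNDED + (TOR⁶)»: (S-a) ⟸ (S-𝔇) by ★ `F0P3cStCharTSSaHeadTorus10.stSupportFiniteSqInt_of_carpet_torus₁₀` (LH6-p01 (g3)) [ED. 26: its `_LB` twin]: the torus input is the NAMED FACT `hHCB : normalizedCharacter_locallyBounded` [HarishChandra1999 Thm. 16.3] (pays (HCB σ) via ★ HbOnMc) + the residual (TOR⁶) `hTOR`; (DEC σ) is ★ DecSigma and (DEC-up) is ★ DecUp inside the head; (L1M) by ★ L1MSplit (ED. 12); Harish-Chandra input (M1) `hHC` + ★ CLASS-FN★ (ED. 11);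
  -- binding ★ «TOR-DATA★» HAND 1 p849333 (LH6-p01) + HAND 2 p849400 (LH6-p05 (g2)) + ★ «PSE★» p849428: no torus datum is a binder, (PSE) is no socket.
  exact K2E3SaHeadTorus10LBLeThree.stSupportFiniteSqInt_of_carpet_torus₁₀_LB L μ ξ v hns hμu hμω νHv νQv mHv mQv hcanH hcanQ hTv π₁ πSt hHL hπ₁ μZ
    𝔇 hμG hμH hμGZ h𝔬 hreg hTr hρ hW hUp
    (fun ρ hρ C hC => (hHBHP ρ hρ C hC).imp fun B hB s hs hsH => hB s hs ((eRegH s).1 hsH))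
    hPCE hPCT h61a h61b h61c hLO hEONPS hEC
    hHCH hUpReg (F0P3cStCharTSEllOut.ellipticOfL2_of_PL 𝔇 d hPl hdpos) hDet hPiN hLds hL2all hUdom hsub hTell hTnon
    (F0P3cStCharTSSocketsOut.ldsElliptic_of_prop1261c 𝔇 h61c hLds2 hTell) (F0P3cStCharTSLdsuOut.ldsEllipticPartner_of_prop1261bc 𝔇 h61b h61c hLO hLds2 hTell) hLds2 hR0
    (F0P3cStCharTSMateUniqOut.mateUniq_of_carpet L v hns νQv mQv hcanQ 𝔇 hμG h𝔬 hreg hPCE hPCT h61b h61c hTell hsplit par hPS2 hNP) hStL2 hPi2L2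
    par hPS1 hPS2 hPS3 hNP hUP hsplit hHC
      (F0P3cStCharTSClassFn.isClassFunOn_char_of_charRegularity_of_isRegularElt L v hns νQv 𝔇 hHC hμG hreg) hHCB hTOR aX hcnt hunit hid

/-- **(S-b1) — [Rogawski1990, Lemma 12.7.2 (proof) p. 194, first display] FOR `ρ = St_H(ξ_v)` ON `U(Φ₃)(L⁺_v)`: THE ELLIPTIC NORM IS `2`.**
Given the (β)-identity for `aX` with finite, square-integrable support: `Σᶠ_π aX(π)² = 2` — the orthogonality relations for square-integrable characters on the
elliptic set and [Prop. 12.5.2] give `Σ a(π)² = ⟨χ^G_ρ, χ^G_ρ⟩_e = 2⟨χ_ρ, χ_ρ⟩_{H,e} = 2·Card(ρ)`, and `Card(St_H(ξ)) = 1`.  Why it might fail AS TYPED: the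
elliptic inner products are computed with the CANONICAL measures of the hypothesis (★ `OrbitalMeasureFamily.IsCanonical`), which must be the normalisation of
[§12.5]; a normalisation slip would change the constant `2` (but not the shape «a pair with coefficients ±1», which is all the composition uses together with (S-b2)).
Hypothesis (T_v) «a smooth Δ‴_{Φ₃}-transfer `f^H` EXISTS for every smooth `φ` on `U(Φ₃)(L⁺_v)`, for the families `(mHv, mQv)`» (★ `IsLocalDeltaTransferExists … mHv mQv
IsLocSmooth IsLocSmooth`) is [§4.9 Prop. 4.9.1 (a)]; print uses it for the pseudo-coefficients' transfers (p. 191) and for `f = Σ a(π) f_π` (p. 194); it is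
discharged (not here) by LH6-p01's ★ «QS» from the closer's row `stub_N6ns` read at the inner form's canonical families and transported along the frame.
[cite: Rogawski1990, Lemma 12.7.2 (proof) p. 194; Prop. 12.5.2 p. 185] -/
theorem stub_StEllipticNormTwo :
  ∀ (L : Type) [Field L] [NumberField L] [IsCMField L] (μ : HeckeCharacter L) (ξ : OneDimAutRepH L) (v : Pl L),
    (∀ w : PlacesOver L v, IsCMField.complexConj L • w.1 = w.1) → μ.IsUnitary →
    (∀ x : Literature.NumberTheory.GaloisRepresentations.ideleGroup ↥(maximalRealSubfield L),
      μ (AdeleRing.ideleBaseChange (↥(maximalRealSubfield L)) L x) = quadraticHeckeCharCM L x) →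
    ∀ [MeasurableSpace (HLoc L v)] [BorelSpace (HLoc L v)] [MeasurableSpace (Gqs L v)] [BorelSpace (Gqs L v)]
      (νHv : Measure (HLoc L v)) (νQv : Measure (Gqs L v))
      [νHv.IsHaarMeasure] [νHv.IsMulRightInvariant] [νQv.IsHaarMeasure] [νQv.IsMulRightInvariant],
    letI : ∀ a : HLoc L v, MeasurableSpace (HLoc L v ⧸ Subgroup.centralizer ({a} : Set (HLoc L v))) := fun _ => borel _
    haveI : ∀ a : HLoc L v, BorelSpace (HLoc L v ⧸ Subgroup.centralizer ({a} : Set (HLoc L v))) := fun _ => ⟨rfl⟩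
    letI : ∀ γ : Gqs L v, MeasurableSpace (Gqs L v ⧸ Subgroup.centralizer ({γ} : Set (Gqs L v))) := fun _ => borel _
    haveI : ∀ γ : Gqs L v, BorelSpace (Gqs L v ⧸ Subgroup.centralizer ({γ} : Set (Gqs L v))) := fun _ => ⟨rfl⟩
    ∀ (mHv : OrbitalMeasureFamily (HLoc L v)) (mQv : OrbitalMeasureFamily (Gqs L v)),
      mHv.IsCanonical (IsLocalGRegular L v) νHv →
      mQv.IsCanonical (fun γ => IsRegularElt (γ.val : GL (Fin 3) (UnitaryGroup.LocalRing L v))) νQv →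
      IsLocalDeltaTransferExists L (qsForm L) v ((finExplicitCollection L (qsForm L) μ (finExplicitDelta_conj_left_all L (qsForm L) μ) (finExplicitDelta_conj_right_all L (qsForm L) μ)) v) mHv mQv IsLocSmooth IsLocSmooth →
      ∀ (π₁ πSt : IrrClass (HLoc L v)),
        HLengthTwoLabels L v
          (torusCharPair (conjLocal L (IsCMField.complexConj L) v) (cmLocalForm L 2 v) (cmLocalForm_eq_over L 2 v) 0
            ((torusLocalComponent L (IsCMField.complexConj L) v ξ.η).comp
                (quotConj (conjLocal L (IsCMField.complexConj L) v) (conjLocal_conjLocal_cm L v)) *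
              halfModulusChar (UnitaryGroup.LocalRing L v))
            (torusLocalComponent L (IsCMField.complexConj L) v ξ.ψ))
          ((torusLocalComponent L (IsCMField.complexConj L) v ξ.ψ).comp (localDet (IsCMField.complexConj L) v (isUnit_antidiagOne_det L 1))) π₁ πSt →
        (∀ fH : HLoc L v → ℂ, IsLocSmooth fH → π₁.smoothTrace νHv fH = charDist (ξ.xiLocalChar v) νHv fH) →
      ∀ [MeasurableSpace (Gqs L v ⧸ Subgroup.center (Gqs L v))] [BorelSpace (Gqs L v ⧸ Subgroup.center (Gqs L v))]
        (μZ : Measure (Gqs L v ⧸ Subgroup.center (Gqs L v))) [μZ.IsHaarMeasure],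
      ∀ aX : IrrClass (Gqs L v) → ℤ,
        (∀ (fH : HLoc L v → ℂ) (φ : Gqs L v → ℂ), IsLocSmooth fH → IsLocSmooth φ →
            IsLocalDeltaTransfer L (qsForm L) v ((finExplicitCollection L (qsForm L) μ (finExplicitDelta_conj_left_all L (qsForm L) μ) (finExplicitDelta_conj_right_all L (qsForm L) μ)) v) mHv mQv fH φ →
            Summable (fun π : IrrClass (Gqs L v) => (aX π : ℂ) * π.smoothTrace νQv φ) ∧
              ∑' π : IrrClass (Gqs L v), (aX π : ℂ) * π.smoothTrace νQv φ = πSt.smoothTrace νHv fH) →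
        (Function.support aX).Finite →
        (∀ π : IrrClass (Gqs L v), aX π ≠ 0 → π.IsSquareIntegrable μZ) →
        ∑ᶠ π : IrrClass (Gqs L v), aX π ^ 2 = 2 := by
  -- ED. 2∕3 «PACKAGE CUT»: (S-b1) ⟸ (S-𝔇) by LH6-p01's ★ «ELL-COMPOSE» (p848567) — kernel-checked, no `sorry` here
  intro L _ _ _ μ ξ v hns hμu hμω _ _ _ _ νHv νQv _ _ _ _ mHv mQv hcanH hcanQ hTv π₁ πSt hHL hπ₁ _ _ μZ _ aX hid hfin hL2
  letI : ∀ a : HLoc L v, MeasurableSpace (HLoc L v ⧸ Subgroup.centralizer ({a} : Set (HLoc L v))) := fun _ => borel _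
  haveI : ∀ a : HLoc L v, BorelSpace (HLoc L v ⧸ Subgroup.centralizer ({a} : Set (HLoc L v))) := fun _ => ⟨rfl⟩
  letI : ∀ γ : Gqs L v, MeasurableSpace (Gqs L v ⧸ Subgroup.centralizer ({γ} : Set (Gqs L v))) := fun _ => borel _
  haveI : ∀ γ : Gqs L v, BorelSpace (Gqs L v ⧸ Subgroup.centralizer ({γ} : Set (Gqs L v))) := fun _ => ⟨rfl⟩
  obtain ⟨𝔇, d, T, par, μv, hC01, hC02, hC03, hC04, hC05, hC06, hC07, hE, hchar, hAll, hHaar, hcart, hHaarG, hfinG, hker, eDG, eDH, hKH, hFH, hHBH, hNL, hPSpar, hLdsF, hW, hμq, hμc, hStH, hRegH, hUp, hHBHP, hGerm, hlabels, hSt, hStJH, hKeysJH, hM1lc, hcovA, hncA, hcptA, hinvT, hcoreT, hIrr, hKeys, hT3, hDet, hKeysRed, hLdsTwo, hDGli, h1252, hPCEnsNWR, hL2oneNsNWR, h61bNsEPR, hLdsOneR, hM1H, hM5, hR0, hStL2, hPL, hdpos, hHCB, eIrr, eSt, eRegH⟩ :=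
    stub_EllipticPackage L μ ξ v hns hμu hμω νHv νQv mHv mQv hcanH hcanQ hTv π₁ πSt hHL hπ₁ μZ
  -- ED. 36: the 47-conjunct body of ED. 17 is RE-DERIVED from the field equations + named inputs by the ★ junction `F0P3cStCharTSDatumJunction17.ellipticPackage_body_of_inputs₁₇`
  obtain ⟨hμG, hμH, hμGZ, h𝔬, hreg, hTr, hρ, hW, hUp, h52, hPCE, h61a, h61b, h61c, hLO, hEONPS, hEC, hM1, hHCH, hUpReg, hER, hL2ell, hUdom, hDet, hPiN, hM5, hDefH, hLds, hsub, hTell, hTnon, hLds2, hR0, hStL2, hPi2L2, hPS1, hPS2, hPS3, hNP, hUP, hPl, hdpos, hT3, hgerm, hsplit, -, hTOR⟩ :=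
    K2E3DatumJunction17LeThree.ellipticPackage_body_of_inputs₁₇ L μ ξ v hns hμu hμω νHv νQv mHv mQv hcanH hcanQ hTv π₁ πSt hHL hπ₁ μZ 𝔇 d T par μv
      hC01 hC02 hC03 hC04 hC05 hC06 hC07 hE hchar hAll hHaar hcart hHaarG hfinG hker eDG eDH hKH hFH hHBH hNL hPSpar hLdsF hW hμq hμc hStH hRegH hUp hHBHP hGerm hlabels hSt hStJH hKeysJH hM1lc hcovA hncA hcptA hinvT hcoreT hIrr hKeys hT3 hDet hKeysRed hLdsTwo hDGli h1252 hPCEnsNWR hL2oneNsNWR h61bNsEPR hLdsOneR hM1H hM5 hR0 hStL2 hPL hdpos hHCB eIrr eSt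
  -- ED. 17: (M1) is read for every class in the package; the ★ heads consume its square-integrable reading
  have hHC : 𝔇.CharRegularity := fun π _ => hM1 π
  -- ED. 17: (L2D∀) from its elliptic instances (★ «L2D-ELL★», LH6-p02 (g4))
  have hL2all : 𝔇.L2CharOnTorusAll := F0P3cStCharTSL2dEll.l2CharOnTorusAll_of_elliptic 𝔇 hTell hL2ell
  exact F0P3cStCharTSEllComposeLB.stEllipticNormTwo_of_carpet_of_lds_not_L2_LB L μ ξ v hns hμu hμω νHv νQv mHv mQv hcanH hcanQ hTv π₁ πSt hHL hπ₁ μZ 𝔇 hμG hμH hμGZ hTr hρ hUp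
      (fun ρ hρ C hC => (hHBHP ρ hρ C hC).imp fun B hB s hs hsH => hB s hs ((eRegH s).1 hsH))
      h52 h61a h61b
      hHC hHCH hUpReg (F0P3cStCharTSSocketsOut.weylDensity_gqs_of_ellCartanAE L v νQv 𝔇 hμG hTell hER) (fun π _ => hL2all π) (F0P3cStCharTSEllOut.ellipticOfL2_of_PL 𝔇 d hPl hdpos) hDet hPiN hM5
      (F0P3cStCharTSSocketsOut.packetInnerDefined_of_l2UpOnTorus_of_innerHDefined 𝔇 hUdom hDefH) hLds aX hid hfin hL2

/-- **(S-b2) — [Rogawski1990, Lemma 12.7.2 (proof) p. 194, second display] FOR `ρ = St_H(ξ_v)` ON `U(Φ₃)(L⁺_v)`: THE COEFFICIENTS ARE NOT ALL OF ONE SIGN.**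
Given the (β)-identity for `aX` with finite, square-integrable support: some `aX(π) > 0` and some `aX(π′) < 0` — by the germ expansions [§8.1, (12.6.1)]
`f^H(1) = 0` for `f = Σ a(π) f_π` (pseudo-coefficients), the Plancherel formula and `f_π(1) = d(π)` give `Σ a(π) d(π) = 0`, and formal degrees are positive.
Why it might fail AS TYPED: none known beyond (S-a)'s (the statement is sign-symmetric); the tree has no formal degree yet — the prover types `d(π)` locally
(§12.5 census).
Hypothesis (T_v) «a smooth Δ‴_{Φ₃}-transfer `f^H` EXISTS for every smooth `φ` on `U(Φ₃)(L⁺_v)`, for the families `(mHv, mQv)`» (★ `IsLocalDeltaTransferExists … mHv mQv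
IsLocSmooth IsLocSmooth`) is [§4.9 Prop. 4.9.1 (a)]; print uses it for the pseudo-coefficients' transfers (p. 191) and for `f = Σ a(π) f_π` (p. 194); it is
discharged (not here) by LH6-p01's ★ «QS» from the closer's row `stub_N6ns` read at the inner form's canonical families and transported along the frame.
[cite: Rogawski1990, Lemma 12.7.2 (proof) p. 194; §8.1; (12.6.1)] -/
theorem stub_StSignBalance :
  ∀ (L : Type) [Field L] [NumberField L] [IsCMField L] (μ : HeckeCharacter L) (ξ : OneDimAutRepH L) (v : Pl L),
    (∀ w : PlacesOver L v, IsCMField.complexConj L • w.1 = w.1) → μ.IsUnitary →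
    (∀ x : Literature.NumberTheory.GaloisRepresentations.ideleGroup ↥(maximalRealSubfield L),
      μ (AdeleRing.ideleBaseChange (↥(maximalRealSubfield L)) L x) = quadraticHeckeCharCM L x) →
    ∀ [MeasurableSpace (HLoc L v)] [BorelSpace (HLoc L v)] [MeasurableSpace (Gqs L v)] [BorelSpace (Gqs L v)]
      (νHv : Measure (HLoc L v)) (νQv : Measure (Gqs L v))
      [νHv.IsHaarMeasure] [νHv.IsMulRightInvariant] [νQv.IsHaarMeasure] [νQv.IsMulRightInvariant],
    letI : ∀ a : HLoc L v, MeasurableSpace (HLoc L v ⧸ Subgroup.centralizer ({a} : Set (HLoc L v))) := fun _ => borel _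
    haveI : ∀ a : HLoc L v, BorelSpace (HLoc L v ⧸ Subgroup.centralizer ({a} : Set (HLoc L v))) := fun _ => ⟨rfl⟩
    letI : ∀ γ : Gqs L v, MeasurableSpace (Gqs L v ⧸ Subgroup.centralizer ({γ} : Set (Gqs L v))) := fun _ => borel _
    haveI : ∀ γ : Gqs L v, BorelSpace (Gqs L v ⧸ Subgroup.centralizer ({γ} : Set (Gqs L v))) := fun _ => ⟨rfl⟩
    ∀ (mHv : OrbitalMeasureFamily (HLoc L v)) (mQv : OrbitalMeasureFamily (Gqs L v)),
      mHv.IsCanonical (IsLocalGRegular L v) νHv →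
      mQv.IsCanonical (fun γ => IsRegularElt (γ.val : GL (Fin 3) (UnitaryGroup.LocalRing L v))) νQv →
      IsLocalDeltaTransferExists L (qsForm L) v ((finExplicitCollection L (qsForm L) μ (finExplicitDelta_conj_left_all L (qsForm L) μ) (finExplicitDelta_conj_right_all L (qsForm L) μ)) v) mHv mQv IsLocSmooth IsLocSmooth →
      ∀ (π₁ πSt : IrrClass (HLoc L v)),
        HLengthTwoLabels L v
          (torusCharPair (conjLocal L (IsCMField.complexConj L) v) (cmLocalForm L 2 v) (cmLocalForm_eq_over L 2 v) 0
            ((torusLocalComponent L (IsCMField.complexConj L) v ξ.η).comp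
                (quotConj (conjLocal L (IsCMField.complexConj L) v) (conjLocal_conjLocal_cm L v)) *
              halfModulusChar (UnitaryGroup.LocalRing L v))
            (torusLocalComponent L (IsCMField.complexConj L) v ξ.ψ))
          ((torusLocalComponent L (IsCMField.complexConj L) v ξ.ψ).comp (localDet (IsCMField.complexConj L) v (isUnit_antidiagOne_det L 1))) π₁ πSt →
        (∀ fH : HLoc L v → ℂ, IsLocSmooth fH → π₁.smoothTrace νHv fH = charDist (ξ.xiLocalChar v) νHv fH) →
      ∀ [MeasurableSpace (Gqs L v ⧸ Subgroup.center (Gqs L v))] [BorelSpace (Gqs L v ⧸ Subgroup.center (Gqs L v))]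
        (μZ : Measure (Gqs L v ⧸ Subgroup.center (Gqs L v))) [μZ.IsHaarMeasure],
      ∀ aX : IrrClass (Gqs L v) → ℤ,
        (∀ (fH : HLoc L v → ℂ) (φ : Gqs L v → ℂ), IsLocSmooth fH → IsLocSmooth φ →
            IsLocalDeltaTransfer L (qsForm L) v ((finExplicitCollection L (qsForm L) μ (finExplicitDelta_conj_left_all L (qsForm L) μ) (finExplicitDelta_conj_right_all L (qsForm L) μ)) v) mHv mQv fH φ →
            Summable (fun π : IrrClass (Gqs L v) => (aX π : ℂ) * π.smoothTrace νQv φ) ∧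
              ∑' π : IrrClass (Gqs L v), (aX π : ℂ) * π.smoothTrace νQv φ = πSt.smoothTrace νHv fH) →
        (Function.support aX).Finite →
        (∀ π : IrrClass (Gqs L v), aX π ≠ 0 → π.IsSquareIntegrable μZ) →
        ∃ π π' : IrrClass (Gqs L v), 0 < aX π ∧ aX π' < 0 := by
  -- ED. 2∕3 «PACKAGE CUT»: (S-b2) ⟸ (S-𝔇) by LH6-p04's ★ «SGN-COMPOSE» (p848889); its one organ-internal input `aX ≠ 0` comes from (S-b1) (`Σᶠ aX² = 2`)
  intro L _ _ _ μ ξ v hns hμu hμω _ _ _ _ νHv νQv _ _ _ _ mHv mQv hcanH hcanQ hTv π₁ πSt hHL hπ₁ _ _ μZ _ aX hid hfin hL2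
  letI : ∀ a : HLoc L v, MeasurableSpace (HLoc L v ⧸ Subgroup.centralizer ({a} : Set (HLoc L v))) := fun _ => borel _
  haveI : ∀ a : HLoc L v, BorelSpace (HLoc L v ⧸ Subgroup.centralizer ({a} : Set (HLoc L v))) := fun _ => ⟨rfl⟩
  letI : ∀ γ : Gqs L v, MeasurableSpace (Gqs L v ⧸ Subgroup.centralizer ({γ} : Set (Gqs L v))) := fun _ => borel _
  haveI : ∀ γ : Gqs L v, BorelSpace (Gqs L v ⧸ Subgroup.centralizer ({γ} : Set (Gqs L v))) := fun _ => ⟨rfl⟩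
  obtain ⟨𝔇, d, T, par, μv, hC01, hC02, hC03, hC04, hC05, hC06, hC07, hE, hchar, hAll, hHaar, hcart, hHaarG, hfinG, hker, eDG, eDH, hKH, hFH, hHBH, hNL, hPSpar, hLdsF, hW, hμq, hμc, hStH, hRegH, hUp, hHBHP, hGerm, hlabels, hSt, hStJH, hKeysJH, hM1lc, hcovA, hncA, hcptA, hinvT, hcoreT, hIrr, hKeys, hT3, hDet, hKeysRed, hLdsTwo, hDGli, h1252, hPCEnsNWR, hL2oneNsNWR, h61bNsEPR, hLdsOneR, hM1H, hM5, hR0, hStL2, hPL, hdpos, hHCB, eIrr, eSt, eRegH⟩ :=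
    stub_EllipticPackage L μ ξ v hns hμu hμω νHv νQv mHv mQv hcanH hcanQ hTv π₁ πSt hHL hπ₁ μZ
  -- ED. 36: the 47-conjunct body of ED. 17 is RE-DERIVED from the field equations + named inputs by the ★ junction `F0P3cStCharTSDatumJunction17.ellipticPackage_body_of_inputs₁₇`
  obtain ⟨hμG, hμH, hμGZ, h𝔬, hreg, hTr, hρ, hW, hUp, h52, hPCE, h61a, h61b, h61c, hLO, hEONPS, hEC, hM1, hHCH, hUpReg, hER, hL2ell, hUdom, hDet, hPiN, hM5, hDefH, hLds, hsub, hTell, hTnon, hLds2, hR0, hStL2, hPi2L2, hPS1, hPS2, hPS3, hNP, hUP, hPl, hdpos, hT3, hgerm, hsplit, -, hTOR⟩ :=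
    K2E3DatumJunction17LeThree.ellipticPackage_body_of_inputs₁₇ L μ ξ v hns hμu hμω νHv νQv mHv mQv hcanH hcanQ hTv π₁ πSt hHL hπ₁ μZ 𝔇 d T par μv
      hC01 hC02 hC03 hC04 hC05 hC06 hC07 hE hchar hAll hHaar hcart hHaarG hfinG hker eDG eDH hKH hFH hHBH hNL hPSpar hLdsF hW hμq hμc hStH hRegH hUp hHBHP hGerm hlabels hSt hStJH hKeysJH hM1lc hcovA hncA hcptA hinvT hcoreT hIrr hKeys hT3 hDet hKeysRed hLdsTwo hDGli h1252 hPCEnsNWR hL2oneNsNWR h61bNsEPR hLdsOneR hM1H hM5 hR0 hStL2 hPL hdpos hHCB eIrr eSt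
  -- ED. 17: (M1) is read for every class in the package; the ★ heads consume its square-integrable reading
  have hHC : 𝔇.CharRegularity := fun π _ => hM1 π
  -- ED. 17: (L2D∀) from its elliptic instances (★ «L2D-ELL★», LH6-p02 (g4))
  have hL2all : 𝔇.L2CharOnTorusAll := F0P3cStCharTSL2dEll.l2CharOnTorusAll_of_elliptic 𝔇 hTell hL2ell
  have hb1 : ∑ᶠ π : IrrClass (Gqs L v), aX π ^ 2 = 2 :=
    F0P3cStCharTSEllComposeLB.stEllipticNormTwo_of_carpet_of_lds_not_L2_LB L μ ξ v hns hμu hμω νHv νQv mHv mQv hcanH hcanQ hTv π₁ πSt hHL hπ₁ μZ 𝔇 hμG hμH hμGZ hTr hρ hUp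
      (fun ρ hρ C hC => (hHBHP ρ hρ C hC).imp fun B hB s hs hsH => hB s hs ((eRegH s).1 hsH))
      h52 h61a h61b
      hHC hHCH hUpReg (F0P3cStCharTSSocketsOut.weylDensity_gqs_of_ellCartanAE L v νQv 𝔇 hμG hTell hER) (fun π _ => hL2all π) (F0P3cStCharTSEllOut.ellipticOfL2_of_PL 𝔇 d hPl hdpos) hDet hPiN hM5
      (F0P3cStCharTSSocketsOut.packetInnerDefined_of_l2UpOnTorus_of_innerHDefined 𝔇 hUdom hDefH) hLds aX hid hfin hL2
  have hne : ∃ π : IrrClass (Gqs L v), aX π ≠ 0 := by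
    by_contra h
    have h0 : (fun π : IrrClass (Gqs L v) => aX π ^ 2) = fun _ => 0 := funext fun π => by
      have : aX π = 0 := Classical.not_not.mp (fun hπ => h ⟨π, hπ⟩)
      simp [this]
    rw [h0, finsum_zero] at hb1
    exact absurd hb1 (by norm_num)
  exact F0P3cStCharTSSgnCompose.stSignBalance_of_carpet L μ ξ v hns hμu hμω νHv νQv mHv mQv hcanH hcanQ hTv π₁ πSt hHL hπ₁ μZ
    𝔇 hμG hμGZ h𝔬 hreg hPCE (F0P3cStCharTSEllOut.ellipticOfL2_of_PL 𝔇 d hPl hdpos) hHC d hPl hdpos T hT3 hgerm aX hid hfin hL2 hne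

set_option maxHeartbeats 1600000 in
set_option synthInstance.maxHeartbeats 400000 in
open Filter Topology Pointwise Literature.NumberTheory in
/-- **ED. 8 «(S-X) RE-LETTERED» (desk D68, road (D) owner LH6-p04 (g3) finding 2026-09-02T06:37Z, QA LH-ref1 «=»): the organ now quantifies over Iwahori data WITH THE PACKAGE CLAUSES of ★ `F0P3CMBorelIwahoriDatum.exists_cmIwahoriDatum` (a normalising compact open `K₀`, dominance of `𝓘.a` at every level, unique factorisation, shell disjointness, `K₀ = E₃⁻¹(GL₃(𝒪_w))`) — inserted VERBATIM as hypotheses after `ha` (text `F0/P3b/LH6-p04/g3/XIG-St.v3.p04.txt` 8370ced9a3c5de43); the only consumer (★ `VirtualJacquetOfXIGPkg`, `MembersOfXIGPkg`) instantiates at that package, so (S-i)∕(S-ii) below are unchanged; WITHOUT these clauses the socket is not derivable (F1-G needs the dominance triple of `z·𝓘.aᵐ` w.r.t. `𝓘.K n`, which an abstract `IwahoriDatum` does not carry).**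
**(S-X) — «XIG-St», the SHELL-TRACE SOCKET of [Rogawski1990, Lemma 12.7.3 (proof) p. 195] ON `U(Φ₃)(L⁺_v)`, ∃-FORM OF RECORD (LH6-p03 (g0) cut
`F0/P3b/LH6-p03/g0/XIG-St.v2.p03.txt` 71d5763f68fce56e = the `hXIG` binder of ★ `F0P3cStCharTSNoncuspidalOfXIGEx.stNoncuspidalMember_of_XIGEx` (p849285) and of ★
`F0P3cStCharTSCuspidalOfXIG.stCuspidalMember_of_XIG` (p849298), byte for byte) (ED. 4 «XIG SOCKET», split — not growth).**  Under the organs' common hypotheses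
(non-split `v`, unitary `μ_v` extending `ω_{L/L⁺}`, canonical families `(mHv, mQv)`, (T_v), the labels `π¹ = ξ_v`, `πSt = St_H(ξ_v)` of ★ `HLengthTwoLabels` with
`tr π¹ = ξ_v`): for every Iwahori datum `𝓘` of the Borel triple of `U(Φ₃)(L⁺_v)`, every central `z`, every uniformiser-direction `α` (`0 < |α|_w < 1`) with
`𝓘.a = diag(α, 1, σ(α)⁻¹)` at the place `w | v`, there is a neighbourhood `U` of `1` such that for all levels `n` with `K_n ⊆ U`, all `m ≥ 1` and every left
transversal `R` of `K_n ∕ (K_n ∩ ᶻᵃK_n)`, SOME smooth Δ‴_{Φ₃}-transfer `f^H` of the shell function `𝟙_{K_n (z·a^m) K_n}` EXISTS with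
`Tr St_H(ξ_v)(f^H) = ν(K_n) · #R · δ_P^{1/2}(z·a^m) · χ_{ξ,μ}(z·a^m)` — print: «the orbital integrals of `𝟙_{K bK}` match those of the corresponding shell on `H`
(fundamental lemma for the maximal compact and its Hecke translates, [§4.9 Prop. 4.9.1 (a)] + the germ-free range), and `Tr St_H(f^H)` is computed by
Casselman's theorem on `H` [Casselman1977 Thm. 5.2] and van Dijk's formula» [Lemma 12.7.3 (proof) p. 195; Prop. 12.5.1 p. 183].  ROAD (D) «DEEP-FL» (LH6-p04 (g2),
interface `F0/P3b/LH6-p04/g2/ROAD-D.interface.v2.txt` e7201338631be5de, status `ROAD-D.status.v3.txt` 3b2344d0ef34a5f7: ★ D1 p849069, ★ D2 p849101, ★ D3-i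
p849162, ★ HYP p849196, ★ F3a p849214, D3-iii-val p849250; (D-b) «CASS-H-TRACE» LH5-p05 (g2) kit p849282 + slice; F3 LH10-p02 (g2) p849255; F1-G dealt
LH10-p02).  Why it might fail AS TYPED: the VALUE is stated with the tree's `rootDeltaChar`∕`cmXiTorusChar` normalisations and `νQv.real (K_n)` — a
normalisation slip between `δ_P^{1/2}` conventions (★ `UnitaryGroupBorelInduction`) and print's `δ(b)^{1/2}` would make the socket false by a root of
`q`; the ∃-form (not ∀ f^H) is deliberate (desk ruling (2), LH6-p04 (R1)): a ∀-form would assert the identity for EVERY matched `f^H`, which needs (β)-type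
uniqueness the local theory does not give.  SIZE: L (road (D), multi-session — honest).
[cite: Rogawski1990, Lemma 12.7.3 (proof) p. 195; Prop. 12.5.1 p. 183; §4.9 Prop. 4.9.1 (a) p. 55] [cite: Casselman1977, Thm. 5.2] -/
theorem stub_StXIGSt :
  ∀ (L : Type) [Field L] [NumberField L] [IsCMField L] (μ : HeckeCharacter L) (ξ : OneDimAutRepH L) (v : HeightOneSpectrum (𝓞 ↥(maximalRealSubfield L))),
    (∀ w : PlacesOver L v, IsCMField.complexConj L • w.1 = w.1) → μ.IsUnitary →
    (∀ x : Literature.NumberTheory.GaloisRepresentations.ideleGroup ↥(maximalRealSubfield L),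
      μ (AdeleRing.ideleBaseChange (↥(maximalRealSubfield L)) L x) = quadraticHeckeCharCM L x) →
    ∀ [MeasurableSpace (((UnitaryGroup.cmDatum L 2 (Matrix.of fun i j : Fin 2 => if i.val + j.val + 1 = 2 then (1 : L) else 0)).Local v × (UnitaryGroup.cmDatum L 1 (Matrix.of fun i j : Fin 1 => if i.val + j.val + 1 = 1 then (1 : L) else 0)).Local v))] [BorelSpace (((UnitaryGroup.cmDatum L 2 (Matrix.of fun i j : Fin 2 => if i.val + j.val + 1 = 2 then (1 : L) else 0)).Local v × (UnitaryGroup.cmDatum L 1 (Matrix.of fun i j : Fin 1 => if i.val + j.val + 1 = 1 then (1 : L) else 0)).Local v))] [MeasurableSpace (Gqs L v)] [BorelSpace (Gqs L v)]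
      (νHv : Measure (((UnitaryGroup.cmDatum L 2 (Matrix.of fun i j : Fin 2 => if i.val + j.val + 1 = 2 then (1 : L) else 0)).Local v × (UnitaryGroup.cmDatum L 1 (Matrix.of fun i j : Fin 1 => if i.val + j.val + 1 = 1 then (1 : L) else 0)).Local v))) (νQv : Measure (Gqs L v))
      [νHv.IsHaarMeasure] [νHv.IsMulRightInvariant] [νQv.IsHaarMeasure] [νQv.IsMulRightInvariant],
    letI : ∀ a : ((UnitaryGroup.cmDatum L 2 (Matrix.of fun i j : Fin 2 => if i.val + j.val + 1 = 2 then (1 : L) else 0)).Local v × (UnitaryGroup.cmDatum L 1 (Matrix.of fun i j : Fin 1 => if i.val + j.val + 1 = 1 then (1 : L) else 0)).Local v), MeasurableSpace (((UnitaryGroup.cmDatum L 2 (Matrix.of fun i j : Fin 2 => if i.val + j.val + 1 = 2 then (1 : L) else 0)).Local v × (UnitaryGroup.cmDatum L 1 (Matrix.of fun i j : Fin 1 => if i.val + j.val + 1 = 1 then (1 : L) else 0)).Local v) ⧸ Subgroup.centralizer ({a} : Set (((UnitaryGroup.cmDatum L 2 (Matrix.of fun i j : Fin 2 => if i.val + j.val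 + 1 = 2 then (1 : L) else 0)).Local v × (UnitaryGroup.cmDatum L 1 (Matrix.of fun i j : Fin 1 => if i.val + j.val + 1 = 1 then (1 : L) else 0)).Local v)))) := fun _ => borel _
    haveI : ∀ a : ((UnitaryGroup.cmDatum L 2 (Matrix.of fun i j : Fin 2 => if i.val + j.val + 1 = 2 then (1 : L) else 0)).Local v × (UnitaryGroup.cmDatum L 1 (Matrix.of fun i j : Fin 1 => if i.val + j.val + 1 = 1 then (1 : L) else 0)).Local v), BorelSpace (((UnitaryGroup.cmDatum L 2 (Matrix.of fun i j : Fin 2 => if i.val + j.val + 1 = 2 then (1 : L) else 0)).Local v × (UnitaryGroup.cmDatum L 1 (Matrix.of fun i j : Fin 1 => if i.val + j.val + 1 = 1 then (1 : L) else 0)).Local v) ⧸ Subgroup.centralizer ({a} : Set (((UnitaryGroup.cmDatum L 2 (Matrix.of fun i j : Fin 2 => if i.val + j.val + 1 = 2 then (1 : L) else 0)).Local v × (UnitaryGroup.cmDatum L 1 (Matrix.of fun i j : Fin 1 => if i.val + j.val + 1 = 1 then (1 : L) else 0)).Local v)))) := fun _ => ⟨rfl⟩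
    letI : ∀ γ : Gqs L v, MeasurableSpace (Gqs L v ⧸ Subgroup.centralizer ({γ} : Set (Gqs L v))) := fun _ => borel _
    haveI : ∀ γ : Gqs L v, BorelSpace (Gqs L v ⧸ Subgroup.centralizer ({γ} : Set (Gqs L v))) := fun _ => ⟨rfl⟩
    ∀ (mHv : OrbitalMeasureFamily (((UnitaryGroup.cmDatum L 2 (Matrix.of fun i j : Fin 2 => if i.val + j.val + 1 = 2 then (1 : L) else 0)).Local v × (UnitaryGroup.cmDatum L 1 (Matrix.of fun i j : Fin 1 => if i.val + j.val + 1 = 1 then (1 : L) else 0)).Local v))) (mQv : OrbitalMeasureFamily (Gqs L v)),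
      mHv.IsCanonical (IsLocalGRegular L v) νHv →
      mQv.IsCanonical (fun γ => IsRegularElt (γ.val : GL (Fin 3) (UnitaryGroup.LocalRing L v))) νQv →
      IsLocalDeltaTransferExists L (qsForm L) v ((finExplicitCollection L (qsForm L) μ (finExplicitDelta_conj_left_all L (qsForm L) μ) (finExplicitDelta_conj_right_all L (qsForm L) μ)) v) mHv mQv IsLocSmooth IsLocSmooth →
      ∀ (π₁ πSt : IrrClass (((UnitaryGroup.cmDatum L 2 (Matrix.of fun i j : Fin 2 => if i.val + j.val + 1 = 2 then (1 : L) else 0)).Local v × (UnitaryGroup.cmDatum L 1 (Matrix.of fun i j : Fin 1 => if i.val + j.val + 1 = 1 then (1 : L) else 0)).Local v))),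
        HLengthTwoLabels L v
          (torusCharPair (conjLocal L (IsCMField.complexConj L) v) (cmLocalForm L 2 v) (cmLocalForm_eq_over L 2 v) 0
            ((torusLocalComponent L (IsCMField.complexConj L) v ξ.η).comp
                (quotConj (conjLocal L (IsCMField.complexConj L) v) (conjLocal_conjLocal_cm L v)) *
              halfModulusChar (UnitaryGroup.LocalRing L v))
            (torusLocalComponent L (IsCMField.complexConj L) v ξ.ψ))
          ((torusLocalComponent L (IsCMField.complexConj L) v ξ.ψ).comp (localDet (IsCMField.complexConj L) v (isUnit_antidiagOne_det L 1))) π₁ πSt →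
        (∀ fH : ((UnitaryGroup.cmDatum L 2 (Matrix.of fun i j : Fin 2 => if i.val + j.val + 1 = 2 then (1 : L) else 0)).Local v × (UnitaryGroup.cmDatum L 1 (Matrix.of fun i j : Fin 1 => if i.val + j.val + 1 = 1 then (1 : L) else 0)).Local v) → ℂ, IsLocSmooth fH → π₁.smoothTrace νHv fH = charDist (ξ.xiLocalChar v) νHv fH) →
      haveI := locallyCompactSpace_cmBorelU L 3 v
      ∀ (𝓘 : (cmBorelTriple L 3 v).IwahoriDatum) (z : ↥(unitaryGroupOfForm (conjLocal L (IsCMField.complexConj L) v) (cmLocalForm L 3 v))),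
        z ∈ Subgroup.center ↥(unitaryGroupOfForm (conjLocal L (IsCMField.complexConj L) v) (cmLocalForm L 3 v)) →
      ∀ (w : PlacesOver L v) (hw : IsCMField.complexConj L • w.1 = w.1) (α : w.1.adicCompletion L), α ≠ 0 → Valued.v α < 1 →
        ((((localNonsplitEquiv (IsCMField.complexConj L) (Rogawski1990.qsForm L) (IsCMField.complexConj_ne_one L) w hw) 𝓘.a : ↥(unitaryGroupOfForm (galAdicCompletionMap (L := L) (IsCMField.complexConj L) hw) (placeForm (Rogawski1990.qsForm L) w.1))) :
            GL (Fin 3) (w.1.adicCompletion L)) : Matrix (Fin 3) (Fin 3) (w.1.adicCompletion L)) = Matrix.diagonal ![α, 1, ((galAdicCompletionMap (L := L) (IsCMField.complexConj L) hw) α)⁻¹] →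
        ∀ (K₀ : Subgroup ↥(unitaryGroupOfForm (conjLocal L (IsCMField.complexConj L) v) (cmLocalForm L 3 v))),
        IsCompact (K₀ : Set ↥(unitaryGroupOfForm (conjLocal L (IsCMField.complexConj L) v) (cmLocalForm L 3 v))) → IsOpen (K₀ : Set ↥(unitaryGroupOfForm (conjLocal L (IsCMField.complexConj L) v) (cmLocalForm L 3 v))) →
        Subgroup.center ↥(unitaryGroupOfForm (conjLocal L (IsCMField.complexConj L) v) (cmLocalForm L 3 v)) ≤ K₀ → (∀ n, 𝓘.K n ≤ K₀) →
        (∀ n, ∀ k ∈ K₀, ∀ κ ∈ 𝓘.K n, k⁻¹ * κ * k ∈ 𝓘.K n) →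
        (∀ n, ∀ x ∈ 𝓘.K n ⊓ (cmBorelTriple L 3 v).N, 𝓘.a * x * 𝓘.a⁻¹ ∈ 𝓘.K n) →
        (∀ n, ∀ x ∈ 𝓘.K n ⊓ 𝓘.Nbar, 𝓘.a⁻¹ * x * 𝓘.a ∈ 𝓘.K n ⊓ 𝓘.Nbar) →
        (∀ n, ∀ x ∈ (cmBorelTriple L 3 v).N, ∃ m : ℕ, ∀ m', m ≤ m' → 𝓘.a ^ m' * x * (𝓘.a ^ m')⁻¹ ∈ 𝓘.K n) →
        (∀ nb ∈ 𝓘.Nbar, ∀ m ∈ (cmBorelTriple L 3 v).M, ∀ n ∈ (cmBorelTriple L 3 v).N, ∀ nb' ∈ 𝓘.Nbar, ∀ m' ∈ (cmBorelTriple L 3 v).M,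
            ∀ n' ∈ (cmBorelTriple L 3 v).N, nb * m * n = nb' * m' * n' → n = n') →
        (∀ n, Pairwise (Function.onFun Disjoint fun m : ℕ =>
            (QuotientGroup.mk : ↥(unitaryGroupOfForm (conjLocal L (IsCMField.complexConj L) v) (cmLocalForm L 3 v)) → ↥(unitaryGroupOfForm (conjLocal L (IsCMField.complexConj L) v) (cmLocalForm L 3 v)) ⧸ Subgroup.center ↥(unitaryGroupOfForm (conjLocal L (IsCMField.complexConj L) v) (cmLocalForm L 3 v))) '' DoubleCoset.doubleCoset (𝓘.a ^ m) (𝓘.K n : Set ↥(unitaryGroupOfForm (conjLocal L (IsCMField.complexConj L) v) (cmLocalForm L 3 v))) (𝓘.K n))) →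
        (∀ k : ↥(unitaryGroupOfForm (conjLocal L (IsCMField.complexConj L) v) (cmLocalForm L 3 v)), k ∈ K₀ ↔ ((((localNonsplitEquiv (IsCMField.complexConj L) (Rogawski1990.qsForm L) (IsCMField.complexConj_ne_one L) w hw) k : ↥(unitaryGroupOfForm (galAdicCompletionMap (L := L) (IsCMField.complexConj L) hw) (placeForm (Rogawski1990.qsForm L) w.1))) : GL (Fin 3) (w.1.adicCompletion L)) ∈ glInt 3 (w.1.adicCompletion L))) →
        ∃ U ∈ 𝓝 (1 : ↥(unitaryGroupOfForm (conjLocal L (IsCMField.complexConj L) v) (cmLocalForm L 3 v))), ∀ n : ℕ, ((𝓘.K n : Set ↥(unitaryGroupOfForm (conjLocal L (IsCMField.complexConj L) v) (cmLocalForm L 3 v))) ⊆ U) → ∀ m : ℕ, 1 ≤ m →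
          ∀ (hbM : z * 𝓘.a ^ m ∈ (cmBorelTriple L 3 v).M) (R : Finset ↥(unitaryGroupOfForm (conjLocal L (IsCMField.complexConj L) v) (cmLocalForm L 3 v))),
            IsLeftTransversal (𝓘.K n) (𝓘.K n ⊓ ConjAct.toConjAct (z * 𝓘.a ^ m) • 𝓘.K n) R →
            ∃ fH : ((UnitaryGroup.cmDatum L 2 (Matrix.of fun i j : Fin 2 => if i.val + j.val + 1 = 2 then (1 : L) else 0)).Local v × (UnitaryGroup.cmDatum L 1 (Matrix.of fun i j : Fin 1 => if i.val + j.val + 1 = 1 then (1 : L) else 0)).Local v) → ℂ, IsLocSmooth fH ∧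
              IsLocalDeltaTransfer L (qsForm L) v ((finExplicitCollection L (qsForm L) μ (finExplicitDelta_conj_left_all L (qsForm L) μ) (finExplicitDelta_conj_right_all L (qsForm L) μ)) v) mHv mQv fH
                ((DoubleCoset.doubleCoset (z * 𝓘.a ^ m) (𝓘.K n : Set ↥(unitaryGroupOfForm (conjLocal L (IsCMField.complexConj L) v) (cmLocalForm L 3 v))) (𝓘.K n)).indicator fun _ => (1 : ℂ)) ∧
              πSt.smoothTrace νHv fH =
                (νQv.real (𝓘.K n : Set ↥(unitaryGroupOfForm (conjLocal L (IsCMField.complexConj L) v) (cmLocalForm L 3 v))) : ℂ) * (R.card : ℂ) *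
                  ((rootDeltaChar (cmBorelTriple L 3 v).P (Subgroup.inclusion (cmBorelTriple L 3 v).M_le ⟨z * 𝓘.a ^ m, hbM⟩) : ℂˣ) : ℂ) *
                  (((cmXiTorusChar L v (μ.semilocalComponent L v) (torusLocalComponent L (IsCMField.complexConj L) v ξ.η) (torusLocalComponent L (IsCMField.complexConj L) v ξ.ψ)) ⟨z * 𝓘.a ^ m, hbM⟩ : ℂˣ) : ℂ) := by
  -- ED. 10 «(S-X) IN» (road (D) «DEEP-FL» CLOSED, 2026-09-02): (S-X)′ ⟸ ★ `F0P3cStCharTSXIGAssembly.stXIGSt'` (p850653) — the XIG′ text of ED. 8 IS the type of the ★ head (by-import TIE), so the organ is a THEOREM in-leaf;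
  -- kernel-checked, no `sorry` here (sorries 3 → 2: (S-β) `stub_StSpectralHyp`, (S-𝔇) `stub_EllipticPackage` remain)
  exact F0P3cStCharTSXIGAssembly.stXIGSt'

/-- **(S-i) — [Rogawski1990, Lemma 12.7.3, first part of the proof p. 195] ON `U(Φ₃)(L⁺_v)`: `π²(ξ_v)` IS A MEMBER, WITH COEFFICIENT `+1`.**
Given the (β)-identity for `aX` with support a pair `{πp, πm}`, `aX(πp) = 1`, `aX(πm) = −1`, both square-integrable, and Keys' labels (★ `KeysCaseTwoLabels`:
`{π², πⁿ}` = the two constituents of `i_G(χ_{ξ,v})` on `U(Φ₃)(L⁺_v)`, `πⁿ` NOT square-integrable): `aX(π²) = 1`.  Print: by Casselman's theorem the characters of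
the members on `M⁻` (far from the walls) are sums of characters of `M` in their Jacquet modules; by [Prop. 12.5.1] + [§4.9] (`D_G τ Δ_{G/H} = D_H` on `M`,
`τ(γ) = μ(α)`) `D_G χ^G_ρ = ξμ|α|^{1/2}` there, which occurs with coefficient one and is the exponent of `π²(ξ)` by [BZ 2.9]; linear independence of characters
of `M`.  Why it might fail AS TYPED: the identification of print's `π²(ξ)` with Keys' label `π²` (★ `KeysCaseTwoLabels` names the square-integrable constituent
of `i_G(χ_ξ)` through `¬ πⁿ.IsSquareIntegrable μZ` — brick «PI2-L2»); on the quasi-split form the tree's Δ‴ carries no sign (`κ ≡ 1`), so `+1` is print's `+1`.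
Hypothesis (T_v) «a smooth Δ‴_{Φ₃}-transfer `f^H` EXISTS for every smooth `φ` on `U(Φ₃)(L⁺_v)`, for the families `(mHv, mQv)`» (★ `IsLocalDeltaTransferExists … mHv mQv
IsLocSmooth IsLocSmooth`) is [§4.9 Prop. 4.9.1 (a)]; print uses it for the pseudo-coefficients' transfers (p. 191) and for `f = Σ a(π) f_π` (p. 194); it is
discharged (not here) by LH6-p01's ★ «QS» from the closer's row `stub_N6ns` read at the inner form's canonical families and transported along the frame.
[cite: Rogawski1990, Lemma 12.7.3 p. 195; Prop. 12.5.1 p. 183; §4.9 p. 54] [cite: BernsteinZelevinsky1977, 2.9] -/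
theorem stub_StNoncuspidalMember :
  ∀ (L : Type) [Field L] [NumberField L] [IsCMField L] (μ : HeckeCharacter L) (ξ : OneDimAutRepH L) (v : Pl L),
    (∀ w : PlacesOver L v, IsCMField.complexConj L • w.1 = w.1) → μ.IsUnitary →
    (∀ x : Literature.NumberTheory.GaloisRepresentations.ideleGroup ↥(maximalRealSubfield L),
      μ (AdeleRing.ideleBaseChange (↥(maximalRealSubfield L)) L x) = quadraticHeckeCharCM L x) →
    ∀ [MeasurableSpace (HLoc L v)] [BorelSpace (HLoc L v)] [MeasurableSpace (Gqs L v)] [BorelSpace (Gqs L v)]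
      (νHv : Measure (HLoc L v)) (νQv : Measure (Gqs L v))
      [νHv.IsHaarMeasure] [νHv.IsMulRightInvariant] [νQv.IsHaarMeasure] [νQv.IsMulRightInvariant],
    letI : ∀ a : HLoc L v, MeasurableSpace (HLoc L v ⧸ Subgroup.centralizer ({a} : Set (HLoc L v))) := fun _ => borel _
    haveI : ∀ a : HLoc L v, BorelSpace (HLoc L v ⧸ Subgroup.centralizer ({a} : Set (HLoc L v))) := fun _ => ⟨rfl⟩
    letI : ∀ γ : Gqs L v, MeasurableSpace (Gqs L v ⧸ Subgroup.centralizer ({γ} : Set (Gqs L v))) := fun _ => borel _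
    haveI : ∀ γ : Gqs L v, BorelSpace (Gqs L v ⧸ Subgroup.centralizer ({γ} : Set (Gqs L v))) := fun _ => ⟨rfl⟩
    ∀ (mHv : OrbitalMeasureFamily (HLoc L v)) (mQv : OrbitalMeasureFamily (Gqs L v)),
      mHv.IsCanonical (IsLocalGRegular L v) νHv →
      mQv.IsCanonical (fun γ => IsRegularElt (γ.val : GL (Fin 3) (UnitaryGroup.LocalRing L v))) νQv →
      IsLocalDeltaTransferExists L (qsForm L) v ((finExplicitCollection L (qsForm L) μ (finExplicitDelta_conj_left_all L (qsForm L) μ) (finExplicitDelta_conj_right_all L (qsForm L) μ)) v) mHv mQv IsLocSmooth IsLocSmooth →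
      ∀ (π₁ πSt : IrrClass (HLoc L v)),
        HLengthTwoLabels L v
          (torusCharPair (conjLocal L (IsCMField.complexConj L) v) (cmLocalForm L 2 v) (cmLocalForm_eq_over L 2 v) 0
            ((torusLocalComponent L (IsCMField.complexConj L) v ξ.η).comp
                (quotConj (conjLocal L (IsCMField.complexConj L) v) (conjLocal_conjLocal_cm L v)) *
              halfModulusChar (UnitaryGroup.LocalRing L v))
            (torusLocalComponent L (IsCMField.complexConj L) v ξ.ψ))
          ((torusLocalComponent L (IsCMField.complexConj L) v ξ.ψ).comp (localDet (IsCMField.complexConj L) v (isUnit_antidiagOne_det L 1))) π₁ πSt →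
        (∀ fH : HLoc L v → ℂ, IsLocSmooth fH → π₁.smoothTrace νHv fH = charDist (ξ.xiLocalChar v) νHv fH) →
      ∀ [MeasurableSpace (Gqs L v ⧸ Subgroup.center (Gqs L v))] [BorelSpace (Gqs L v ⧸ Subgroup.center (Gqs L v))]
        (μZ : Measure (Gqs L v ⧸ Subgroup.center (Gqs L v))) [μZ.IsHaarMeasure],
      ∀ aX : IrrClass (Gqs L v) → ℤ,
        (∀ (fH : HLoc L v → ℂ) (φ : Gqs L v → ℂ), IsLocSmooth fH → IsLocSmooth φ →
            IsLocalDeltaTransfer L (qsForm L) v ((finExplicitCollection L (qsForm L) μ (finExplicitDelta_conj_left_all L (qsForm L) μ) (finExplicitDelta_conj_right_all L (qsForm L) μ)) v) mHv mQv fH φ →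
            Summable (fun π : IrrClass (Gqs L v) => (aX π : ℂ) * π.smoothTrace νQv φ) ∧
              ∑' π : IrrClass (Gqs L v), (aX π : ℂ) * π.smoothTrace νQv φ = πSt.smoothTrace νHv fH) →
        ∀ (πp πm : IrrClass (Gqs L v)), πp ≠ πm → Function.support aX = {πp, πm} → aX πp = 1 → aX πm = -1 →
        (∀ π : IrrClass (Gqs L v), aX π ≠ 0 → π.IsSquareIntegrable μZ) →
      ∀ (π2 πn : IrrClass (Gqs L v)),
        KeysCaseTwoLabels L v (μ.semilocalComponent L v) (torusLocalComponent L (IsCMField.complexConj L) v ξ.η)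
          (torusLocalComponent L (IsCMField.complexConj L) v ξ.ψ) π2 πn →
        ¬ πn.IsSquareIntegrable μZ →
        aX π2 = 1 := by
  -- ED. 8 «(S-X) RE-LETTERED»: (S-i) ⟸ (S-X)′ by LH6-p03 (g2)'s ★ `MembersOfXIGPkg.stNoncuspidalMember_of_XIGPkg` (ED. 4–7: ★ «B6-EX» p849285; proof = LH6-p02's ★ B6 with the matched `f^H` taken from «XIG-St») — kernel-checked, no `sorry` here
  exact F0P3cStCharTSMembersOfXIGPkg.stNoncuspidalMember_of_XIGPkg stub_StXIGSt

/-- **(S-ii) — [Rogawski1990, Lemma 12.7.3, end of the proof p. 195] ON `U(Φ₃)(L⁺_v)`: THE OTHER MEMBER IS SUPERCUSPIDAL.**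
Given the data of (S-i) and its conclusion `aX(π²) = 1`: every member `π ≠ π²` of the support is supercuspidal — print: «this forces `D_G χ_{π²}` to vanish on
`M⁻`, hence `π²` [print's second member] is supercuspidal»: a square-integrable class whose character vanishes on the split torus far from the walls has
vanishing Jacquet module, i.e. is compactly supported modulo the centre [Casselman §6.3; classification §12.1–12.2].  Why it might fail AS TYPED: ★
`IrrClass.IsSupercuspidal` is «all matrix coefficients compactly supported mod centre» for every representative — the prover needs the Jacquet-module criterion
in that currency (tree: `U3JacquetVanishingSupercuspidal*` road; brick «JSUB»).
Hypothesis (T_v) «a smooth Δ‴_{Φ₃}-transfer `f^H` EXISTS for every smooth `φ` on `U(Φ₃)(L⁺_v)`, for the families `(mHv, mQv)`» (★ `IsLocalDeltaTransferExists … mHv mQv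
IsLocSmooth IsLocSmooth`) is [§4.9 Prop. 4.9.1 (a)]; print uses it for the pseudo-coefficients' transfers (p. 191) and for `f = Σ a(π) f_π` (p. 194); it is
discharged (not here) by LH6-p01's ★ «QS» from the closer's row `stub_N6ns` read at the inner form's canonical families and transported along the frame.
[cite: Rogawski1990, Lemma 12.7.3 p. 195; §12.1 pp. 171–172] [cite: HarishChandra1970, Part I §3] -/
theorem stub_StCuspidalMember :
  ∀ (L : Type) [Field L] [NumberField L] [IsCMField L] (μ : HeckeCharacter L) (ξ : OneDimAutRepH L) (v : Pl L),
    (∀ w : PlacesOver L v, IsCMField.complexConj L • w.1 = w.1) → μ.IsUnitary →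
    (∀ x : Literature.NumberTheory.GaloisRepresentations.ideleGroup ↥(maximalRealSubfield L),
      μ (AdeleRing.ideleBaseChange (↥(maximalRealSubfield L)) L x) = quadraticHeckeCharCM L x) →
    ∀ [MeasurableSpace (HLoc L v)] [BorelSpace (HLoc L v)] [MeasurableSpace (Gqs L v)] [BorelSpace (Gqs L v)]
      (νHv : Measure (HLoc L v)) (νQv : Measure (Gqs L v))
      [νHv.IsHaarMeasure] [νHv.IsMulRightInvariant] [νQv.IsHaarMeasure] [νQv.IsMulRightInvariant],
    letI : ∀ a : HLoc L v, MeasurableSpace (HLoc L v ⧸ Subgroup.centralizer ({a} : Set (HLoc L v))) := fun _ => borel _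
    haveI : ∀ a : HLoc L v, BorelSpace (HLoc L v ⧸ Subgroup.centralizer ({a} : Set (HLoc L v))) := fun _ => ⟨rfl⟩
    letI : ∀ γ : Gqs L v, MeasurableSpace (Gqs L v ⧸ Subgroup.centralizer ({γ} : Set (Gqs L v))) := fun _ => borel _
    haveI : ∀ γ : Gqs L v, BorelSpace (Gqs L v ⧸ Subgroup.centralizer ({γ} : Set (Gqs L v))) := fun _ => ⟨rfl⟩
    ∀ (mHv : OrbitalMeasureFamily (HLoc L v)) (mQv : OrbitalMeasureFamily (Gqs L v)),
      mHv.IsCanonical (IsLocalGRegular L v) νHv →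
      mQv.IsCanonical (fun γ => IsRegularElt (γ.val : GL (Fin 3) (UnitaryGroup.LocalRing L v))) νQv →
      IsLocalDeltaTransferExists L (qsForm L) v ((finExplicitCollection L (qsForm L) μ (finExplicitDelta_conj_left_all L (qsForm L) μ) (finExplicitDelta_conj_right_all L (qsForm L) μ)) v) mHv mQv IsLocSmooth IsLocSmooth →
      ∀ (π₁ πSt : IrrClass (HLoc L v)),
        HLengthTwoLabels L v
          (torusCharPair (conjLocal L (IsCMField.complexConj L) v) (cmLocalForm L 2 v) (cmLocalForm_eq_over L 2 v) 0
            ((torusLocalComponent L (IsCMField.complexConj L) v ξ.η).comp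
                (quotConj (conjLocal L (IsCMField.complexConj L) v) (conjLocal_conjLocal_cm L v)) *
              halfModulusChar (UnitaryGroup.LocalRing L v))
            (torusLocalComponent L (IsCMField.complexConj L) v ξ.ψ))
          ((torusLocalComponent L (IsCMField.complexConj L) v ξ.ψ).comp (localDet (IsCMField.complexConj L) v (isUnit_antidiagOne_det L 1))) π₁ πSt →
        (∀ fH : HLoc L v → ℂ, IsLocSmooth fH → π₁.smoothTrace νHv fH = charDist (ξ.xiLocalChar v) νHv fH) →
      ∀ [MeasurableSpace (Gqs L v ⧸ Subgroup.center (Gqs L v))] [BorelSpace (Gqs L v ⧸ Subgroup.center (Gqs L v))]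
        (μZ : Measure (Gqs L v ⧸ Subgroup.center (Gqs L v))) [μZ.IsHaarMeasure],
      ∀ aX : IrrClass (Gqs L v) → ℤ,
        (∀ (fH : HLoc L v → ℂ) (φ : Gqs L v → ℂ), IsLocSmooth fH → IsLocSmooth φ →
            IsLocalDeltaTransfer L (qsForm L) v ((finExplicitCollection L (qsForm L) μ (finExplicitDelta_conj_left_all L (qsForm L) μ) (finExplicitDelta_conj_right_all L (qsForm L) μ)) v) mHv mQv fH φ →
            Summable (fun π : IrrClass (Gqs L v) => (aX π : ℂ) * π.smoothTrace νQv φ) ∧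
              ∑' π : IrrClass (Gqs L v), (aX π : ℂ) * π.smoothTrace νQv φ = πSt.smoothTrace νHv fH) →
        ∀ (πp πm : IrrClass (Gqs L v)), πp ≠ πm → Function.support aX = {πp, πm} → aX πp = 1 → aX πm = -1 →
        (∀ π : IrrClass (Gqs L v), aX π ≠ 0 → π.IsSquareIntegrable μZ) →
      ∀ (π2 πn : IrrClass (Gqs L v)),
        KeysCaseTwoLabels L v (μ.semilocalComponent L v) (torusLocalComponent L (IsCMField.complexConj L) v ξ.η)
          (torusLocalComponent L (IsCMField.complexConj L) v ξ.ψ) π2 πn →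
        ¬ πn.IsSquareIntegrable μZ →
        aX π2 = 1 → ∀ π : IrrClass (Gqs L v), aX π ≠ 0 → π ≠ π2 → π.IsSupercuspidal := by
  -- ED. 8 «(S-X) RE-LETTERED»: (S-ii) ⟸ (S-X)′ by LH6-p03 (g2)'s ★ `MembersOfXIGPkg.stCuspidalMember_of_XIGPkg` (ED. 4–7: ★ p849298; Casselman + [BZ 2.9] + Artin-with-multiplicities + ★ JAC∕KEYS-JQ∕JDIM2) — kernel-checked, no `sorry` here
  exact F0P3cStCharTSMembersOfXIGPkg.stCuspidalMember_of_XIGPkg stub_StXIGSt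

/-! ## §2 Glue proved here (no `sorry`): integer arithmetic of the coefficients and the two-point sum -/

/-- From `Σᶠ aX² = 2` over a finite support containing a positive and a negative value: the support is a pair `{ip, im}` with `aX(ip) = 1`,
`aX(im) = −1` ([Rogawski1990, L.12.7.2 p. 194]: «it follows that `n = 2` and `a(πʲ) = ±1`»). [folklore] -/
theorem pair_of_finsum_sq_eq_two {ι : Type*} (aX : ι → ℤ) (hfin : (Function.support aX).Finite)
    (h2 : ∑ᶠ i, aX i ^ 2 = 2) (hsgn : ∃ i j, 0 < aX i ∧ aX j < 0) :
    ∃ ip im, ip ≠ im ∧ Function.support aX = {ip, im} ∧ aX ip = 1 ∧ aX im = -1 := by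
  classical
  obtain ⟨i, j, hi, hj⟩ := hsgn
  have hij : i ≠ j := by
    rintro rfl
    exact lt_asymm hi hj
  have hmem : ∀ k, k ∈ hfin.toFinset ↔ aX k ≠ 0 := fun k => by
    rw [Set.Finite.mem_toFinset, Function.mem_support]
  have his : i ∈ hfin.toFinset := (hmem i).2 hi.ne'
  have hjs : j ∈ hfin.toFinset.erase i := Finset.mem_erase.2 ⟨hij.symm, (hmem j).2 hj.ne⟩
  have hsum : ∑ᶠ k, aX k ^ 2 = ∑ k ∈ hfin.toFinset, aX k ^ 2 := by
    refine finsum_eq_sum_of_support_subset _ fun k hk => ?_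
    have hk' : aX k ≠ 0 := fun h0 => hk (by simp [h0])
    exact Finset.mem_coe.2 ((hmem k).2 hk')
  rw [hsum, ← Finset.add_sum_erase _ _ his, ← Finset.add_sum_erase _ _ hjs] at h2
  have hrest : 0 ≤ ∑ k ∈ (hfin.toFinset.erase i).erase j, aX k ^ 2 := Finset.sum_nonneg fun k _ => sq_nonneg (aX k)
  have hi' : 1 ≤ aX i := by omega
  have hj' : aX j ≤ -1 := by omega
  have hi1 : 1 ≤ aX i ^ 2 := by nlinarith
  have hj1 : 1 ≤ aX j ^ 2 := by nlinarith
  have hi2 : aX i ^ 2 = 1 := by linarith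
  have hj2 : aX j ^ 2 = 1 := by linarith
  have hr0 : ∑ k ∈ (hfin.toFinset.erase i).erase j, aX k ^ 2 = 0 := by linarith
  have hiv : aX i = 1 := by nlinarith
  have hjv : aX j = -1 := by nlinarith
  have hnone : ∀ k ∈ (hfin.toFinset.erase i).erase j, False := fun k hk => by
    have hk0 : aX k ^ 2 = 0 := (Finset.sum_eq_zero_iff_of_nonneg fun k _ => sq_nonneg (aX k)).1 hr0 k hk
    have hks : k ∈ hfin.toFinset := Finset.mem_of_mem_erase (Finset.mem_of_mem_erase hk)
    exact (hmem k).1 hks (pow_eq_zero_iff two_ne_zero |>.1 hk0)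
  refine ⟨i, j, hij, Set.ext fun k => ?_, hiv, hjv⟩
  rw [Function.mem_support, Set.mem_insert_iff, Set.mem_singleton_iff]
  constructor
  · intro hk
    by_contra hk'
    rw [not_or] at hk'
    exact hnone k (Finset.mem_erase.2 ⟨hk'.2, Finset.mem_erase.2 ⟨hk'.1, (hmem k).2 hk⟩⟩)
  · rintro (rfl | rfl)
    · rw [hiv]; exact one_ne_zero
    · rw [hjv]; omega

/-- The absolutely convergent sum over a two-point support is the two-term sum. [folklore] -/
theorem tsum_pair {ι : Type*} (aX : ι → ℤ) (F : ι → ℂ) {ip im : ι} (hne : ip ≠ im)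
    (hsupp : Function.support aX = {ip, im}) :
    ∑' i, (aX i : ℂ) * F i = (aX ip : ℂ) * F ip + (aX im : ℂ) * F im := by
  classical
  rw [tsum_eq_sum (s := {ip, im}) fun k hk => ?_, Finset.sum_pair hne]
  have hk0 : aX k = 0 := by
    by_contra h0
    have hks : k ∈ Function.support aX := Function.mem_support.2 h0
    rw [hsupp, Set.mem_insert_iff, Set.mem_singleton_iff] at hks
    rw [Finset.mem_insert, Finset.mem_singleton] at hk
    exact hk hks
  rw [hk0, Int.cast_zero, zero_mul]


/-! ## §3 QS_T by composition: (N-1273S) on the quasi-split model, per place, sign-free, given smooth transfer — the hypothesis of LH6-p01's ★ «QS» -/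

/-- **QS_T ⟸ the six organs** — [Rogawski1990, L. 12.7.3 ∕ Cor. 12.7.4 p. 195] for `U(Φ₃)(L⁺_v)` in the tree's currency (= the hypothesis `hQS` of ★
`F0P3cStCharTSOfQuasiSplit.stCharTS_of_quasiSplit` with the single extra hypothesis (T_v) «smooth Δ‴_{Φ₃}-transfer exists for `(mHv, mQv)`» [Prop. 4.9.1 (a)]),
from (S-β) [§13.8], (S-a)+(S-b1)+(S-b2) [L.12.7.2], (S-i)+(S-ii) [Lemma 12.7.3]: take the (β)-datum `aX`; by (S-a) its support is finite and square-integrable;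
by (S-b1)+(S-b2) and integer arithmetic it is a pair with coefficients `(1, −1)`; by (S-i) the `+1` member is Keys' `π²`, by (S-ii) the `−1` member `πs` is
supercuspidal; `πs ≠ πⁿ` since `πs` is square-integrable and `πⁿ` is not; the identity is the two-point sum.  Kernel-checked; the ONLY `sorry`s of the file are
the six `stub_*`. [cite: Rogawski1990, Lemma 12.7.2 (proof) pp. 191–194; Lemma 12.7.3 & Cor. 12.7.4 p. 195; §13.8 pp. 212–217] -/
theorem QST_of_organs (hβ : type_of% stub_StSpectralHyp) (hfin : type_of% stub_StSupportFiniteSqInt)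
    (hnorm : type_of% stub_StEllipticNormTwo) (hsgn : type_of% stub_StSignBalance)
    (hnc : type_of% stub_StNoncuspidalMember) (hcu : type_of% stub_StCuspidalMember) :
  ∀ (L : Type) [Field L] [NumberField L] [IsCMField L] (μ : HeckeCharacter L) (ξ : OneDimAutRepH L) (v : HeightOneSpectrum (𝓞 ↥(maximalRealSubfield L))),
      (∀ w : PlacesOver L v, IsCMField.complexConj L • w.1 = w.1) → μ.IsUnitary →
      (∀ x : Literature.NumberTheory.GaloisRepresentations.ideleGroup ↥(maximalRealSubfield L),
        μ (AdeleRing.ideleBaseChange (↥(maximalRealSubfield L)) L x) = quadraticHeckeCharCM L x) →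
      ∀ [MeasurableSpace ((UnitaryGroup.cmDatum L 2 (Matrix.of fun i j : Fin 2 => if i.val + j.val + 1 = 2 then (1 : L) else 0)).Local v × (UnitaryGroup.cmDatum L 1 (Matrix.of fun i j : Fin 1 => if i.val + j.val + 1 = 1 then (1 : L) else 0)).Local v)] [BorelSpace ((UnitaryGroup.cmDatum L 2 (Matrix.of fun i j : Fin 2 => if i.val + j.val + 1 = 2 then (1 : L) else 0)).Local v × (UnitaryGroup.cmDatum L 1 (Matrix.of fun i j : Fin 1 => if i.val + j.val + 1 = 1 then (1 : L) else 0)).Local v)] [MeasurableSpace ((UnitaryGroup.cmDatum L 3 (Matrix.of fun i j : Fin 3 => if i.val + j.val + 1 = 3 then (1 : L) else 0)).Local v)] [BorelSpace ((UnitaryGroup.cmDatum L 3 (Matrix.of fun i j : Fin 3 => if i.val + j.val + 1 = 3 then (1 : L) else 0)).Local v)]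
        (νHv : Measure ((UnitaryGroup.cmDatum L 2 (Matrix.of fun i j : Fin 2 => if i.val + j.val + 1 = 2 then (1 : L) else 0)).Local v × (UnitaryGroup.cmDatum L 1 (Matrix.of fun i j : Fin 1 => if i.val + j.val + 1 = 1 then (1 : L) else 0)).Local v)) (νQv : Measure ((UnitaryGroup.cmDatum L 3 (Matrix.of fun i j : Fin 3 => if i.val + j.val + 1 = 3 then (1 : L) else 0)).Local v))
        [νHv.IsHaarMeasure] [νHv.IsMulRightInvariant] [νQv.IsHaarMeasure] [νQv.IsMulRightInvariant],
      letI : ∀ a : (UnitaryGroup.cmDatum L 2 (Matrix.of fun i j : Fin 2 => if i.val + j.val + 1 = 2 then (1 : L) else 0)).Local v × (UnitaryGroup.cmDatum L 1 (Matrix.of fun i j : Fin 1 => if i.val + j.val + 1 = 1 then (1 : L) else 0)).Local v, MeasurableSpace (((UnitaryGroup.cmDatum L 2 (Matrix.of fun i j : Fin 2 => if i.val + j.val + 1 = 2 then (1 : L) else 0)).Local v × (UnitaryGroup.cmDatum L 1 (Matrix.of fun i j : Fin 1 => if i.val + j.val + 1 = 1 then (1 : L) else 0)).Local v) ⧸ Subgroup.centralizer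 ({a} : Set ((UnitaryGroup.cmDatum L 2 (Matrix.of fun i j : Fin 2 => if i.val + j.val + 1 = 2 then (1 : L) else 0)).Local v × (UnitaryGroup.cmDatum L 1 (Matrix.of fun i j : Fin 1 => if i.val + j.val + 1 = 1 then (1 : L) else 0)).Local v))) := fun _ => borel _
      haveI : ∀ a : (UnitaryGroup.cmDatum L 2 (Matrix.of fun i j : Fin 2 => if i.val + j.val + 1 = 2 then (1 : L) else 0)).Local v × (UnitaryGroup.cmDatum L 1 (Matrix.of fun i j : Fin 1 => if i.val + j.val + 1 = 1 then (1 : L) else 0)).Local v, BorelSpace (((UnitaryGroup.cmDatum L 2 (Matrix.of fun i j : Fin 2 => if i.val + j.val + 1 = 2 then (1 : L) else 0)).Local v × (UnitaryGroup.cmDatum L 1 (Matrix.of fun i j : Fin 1 => if i.val + j.val + 1 = 1 then (1 : L) else 0)).Local v) ⧸ Subgroup.centralizer ({a} : Set ((UnitaryGroup.cmDatum L 2 (Matrix.of fun i j : Fin 2 => if i.val + j.val + 1 = 2 then (1 : L) else 0)).Local v × (UnitaryGroup.cmDatum L 1 (Matrix.of fun i j : Fin 1 => if i.val + j.val + 1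 = 1 then (1 : L) else 0)).Local v))) := fun _ => ⟨rfl⟩
      letI : ∀ γ : (UnitaryGroup.cmDatum L 3 (Matrix.of fun i j : Fin 3 => if i.val + j.val + 1 = 3 then (1 : L) else 0)).Local v, MeasurableSpace (((UnitaryGroup.cmDatum L 3 (Matrix.of fun i j : Fin 3 => if i.val + j.val + 1 = 3 then (1 : L) else 0)).Local v) ⧸ Subgroup.centralizer ({γ} : Set ((UnitaryGroup.cmDatum L 3 (Matrix.of fun i j : Fin 3 => if i.val + j.val + 1 = 3 then (1 : L) else 0)).Local v))) := fun _ => borel _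
      haveI : ∀ γ : (UnitaryGroup.cmDatum L 3 (Matrix.of fun i j : Fin 3 => if i.val + j.val + 1 = 3 then (1 : L) else 0)).Local v, BorelSpace (((UnitaryGroup.cmDatum L 3 (Matrix.of fun i j : Fin 3 => if i.val + j.val + 1 = 3 then (1 : L) else 0)).Local v) ⧸ Subgroup.centralizer ({γ} : Set ((UnitaryGroup.cmDatum L 3 (Matrix.of fun i j : Fin 3 => if i.val + j.val + 1 = 3 then (1 : L) else 0)).Local v))) := fun _ => ⟨rfl⟩
      ∀ (mHv : OrbitalMeasureFamily ((UnitaryGroup.cmDatum L 2 (Matrix.of fun i j : Fin 2 => if i.val + j.val + 1 = 2 then (1 : L) else 0)).Local v × (UnitaryGroup.cmDatum L 1 (Matrix.of fun i j : Fin 1 => if i.val + j.val + 1 = 1 then (1 : L) else 0)).Local v)) (mQv : OrbitalMeasureFamily ((UnitaryGroup.cmDatum L 3 (Matrix.of fun i j : Fin 3 => if i.val + j.val + 1 = 3 then (1 : L) else 0)).Local v)),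
        mHv.IsCanonical (IsLocalGRegular L v) νHv →
        mQv.IsCanonical (fun γ => IsRegularElt (γ.val : GL (Fin 3) (UnitaryGroup.LocalRing L v))) νQv →
      IsLocalDeltaTransferExists L (Matrix.of fun i j : Fin 3 => if i.val + j.val + 1 = 3 then (1 : L) else 0) v ((finExplicitCollection L (Matrix.of fun i j : Fin 3 => if i.val + j.val + 1 = 3 then (1 : L) else 0) μ (finExplicitDelta_conj_left_all L (Matrix.of fun i j : Fin 3 => if i.val + j.val + 1 = 3 then (1 : L) else 0) μ) (finExplicitDelta_conj_right_all L (Matrix.of fun i j : Fin 3 => if i.val + j.val + 1 = 3 then (1 : L) else 0) μ)) v) mHv mQv IsLocSmooth IsLocSmooth →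
      ∀ [MeasurableSpace (Gqs L v ⧸ Subgroup.center (Gqs L v))] [BorelSpace (Gqs L v ⧸ Subgroup.center (Gqs L v))]
        (μZ : Measure (Gqs L v ⧸ Subgroup.center (Gqs L v))) [μZ.IsHaarMeasure],
      ∀ (π₁ πSt : IrrClass ((UnitaryGroup.cmDatum L 2 (Matrix.of fun i j : Fin 2 => if i.val + j.val + 1 = 2 then (1 : L) else 0)).Local v × (UnitaryGroup.cmDatum L 1 (Matrix.of fun i j : Fin 1 => if i.val + j.val + 1 = 1 then (1 : L) else 0)).Local v)),
        HLengthTwoLabels L v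
          (torusCharPair (conjLocal L (IsCMField.complexConj L) v) (cmLocalForm L 2 v) (cmLocalForm_eq_over L 2 v) 0
            ((torusLocalComponent L (IsCMField.complexConj L) v ξ.η).comp
                (quotConj (conjLocal L (IsCMField.complexConj L) v) (conjLocal_conjLocal_cm L v)) *
              halfModulusChar (UnitaryGroup.LocalRing L v))
            (torusLocalComponent L (IsCMField.complexConj L) v ξ.ψ))
          ((torusLocalComponent L (IsCMField.complexConj L) v ξ.ψ).comp (localDet (IsCMField.complexConj L) v (isUnit_antidiagOne_det L 1))) π₁ πSt →
        (∀ fH : (UnitaryGroup.cmDatum L 2 (Matrix.of fun i j : Fin 2 => if i.val + j.val + 1 = 2 then (1 : L) else 0)).Local v × (UnitaryGroup.cmDatum L 1 (Matrix.of fun i j : Fin 1 => if i.val + j.val + 1 = 1 then (1 : L) else 0)).Local v → ℂ, IsLocSmooth fH → π₁.smoothTrace νHv fH = charDist (ξ.xiLocalChar v) νHv fH) →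
      ∀ (π2 πn : IrrClass (Gqs L v)),
        KeysCaseTwoLabels L v (μ.semilocalComponent L v) (torusLocalComponent L (IsCMField.complexConj L) v ξ.η)
          (torusLocalComponent L (IsCMField.complexConj L) v ξ.ψ) π2 πn →
        ¬ πn.IsSquareIntegrable μZ →
        ∃ πs : IrrClass (Gqs L v), πs.IsSupercuspidal ∧ πs ≠ πn ∧
          ∀ (fH : (UnitaryGroup.cmDatum L 2 (Matrix.of fun i j : Fin 2 => if i.val + j.val + 1 = 2 then (1 : L) else 0)).Local v × (UnitaryGroup.cmDatum L 1 (Matrix.of fun i j : Fin 1 => if i.val + j.val + 1 = 1 then (1 : L) else 0)).Local v → ℂ) (φ : (UnitaryGroup.cmDatum L 3 (Matrix.of fun i j : Fin 3 => if i.val + j.val + 1 = 3 then (1 : L) else 0)).Local v → ℂ), IsLocSmooth fH → IsLocSmooth φ →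
            IsLocalDeltaTransfer L (Matrix.of fun i j : Fin 3 => if i.val + j.val + 1 = 3 then (1 : L) else 0) v ((finExplicitCollection L (Matrix.of fun i j : Fin 3 => if i.val + j.val + 1 = 3 then (1 : L) else 0) μ (finExplicitDelta_conj_left_all L (Matrix.of fun i j : Fin 3 => if i.val + j.val + 1 = 3 then (1 : L) else 0) μ) (finExplicitDelta_conj_right_all L (Matrix.of fun i j : Fin 3 => if i.val + j.val + 1 = 3 then (1 : L) else 0) μ)) v) mHv mQv fH φ →
            πSt.smoothTrace νHv fH = π2.smoothTrace νQv φ - πs.smoothTrace νQv φ := by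
  intro L _ _ _ μ ξ v hns hμu hμω _ _ _ _ νHv νQv _ _ _ _ mHv mQv hcH hcQ hTv _ _ μZ _ π₁ πSt hlab hπ₁ π2 πn hK hL2
  -- the statement's Borel structures on the centraliser quotients, re-declared for instance search
  letI : ∀ a' : HLoc L v, MeasurableSpace (HLoc L v ⧸ Subgroup.centralizer ({a'} : Set (HLoc L v))) := fun _ => borel _
  haveI : ∀ a' : HLoc L v, BorelSpace (HLoc L v ⧸ Subgroup.centralizer ({a'} : Set (HLoc L v))) := fun _ => ⟨rfl⟩
  letI : ∀ γ : Gqs L v, MeasurableSpace (Gqs L v ⧸ Subgroup.centralizer ({γ} : Set (Gqs L v))) := fun _ => borel _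
  haveI : ∀ γ : Gqs L v, BorelSpace (Gqs L v ⧸ Subgroup.centralizer ({γ} : Set (Gqs L v))) := fun _ => ⟨rfl⟩
  -- (S-β): the spectral datum of [L.12.7.2] for `ρ = St_H(ξ_v)` (GLOBAL in print, §13.8)
  obtain ⟨aX, hcnt, hunit, hid⟩ := hβ L μ ξ v hns hμu hμω νHv νQv mHv mQv hcH hcQ π₁ πSt hlab hπ₁
  -- (S-a): finite, square-integrable support [L.12.7.2 pp. 191–193]
  obtain ⟨hfs, hsq⟩ := hfin L μ ξ v hns hμu hμω νHv νQv mHv mQv hcH hcQ hTv π₁ πSt hlab hπ₁ μZ aX hcnt hunit hid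
  -- (S-b1) + (S-b2): `Σ aX² = 2`, mixed signs [L.12.7.2 p. 194] ⇒ a pair with coefficients `(1, −1)`
  have h2 := hnorm L μ ξ v hns hμu hμω νHv νQv mHv mQv hcH hcQ hTv π₁ πSt hlab hπ₁ μZ aX hid hfs hsq
  have hpm := hsgn L μ ξ v hns hμu hμω νHv νQv mHv mQv hcH hcQ hTv π₁ πSt hlab hπ₁ μZ aX hid hfs hsq
  obtain ⟨πp, πm, hne, hsupp, hp1, hm1⟩ := pair_of_finsum_sq_eq_two aX hfs h2 hpm
  -- (S-i): `aX(π²) = 1`; (S-ii): the other member is supercuspidal [Lemma 12.7.3 p. 195]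
  have hπ2 := hnc L μ ξ v hns hμu hμω νHv νQv mHv mQv hcH hcQ hTv π₁ πSt hlab hπ₁ μZ aX hid πp πm hne hsupp hp1 hm1 hsq π2 πn hK hL2
  have hsc := hcu L μ ξ v hns hμu hμω νHv νQv mHv mQv hcH hcQ hTv π₁ πSt hlab hπ₁ μZ aX hid πp πm hne hsupp hp1 hm1 hsq π2 πn hK hL2 hπ2
  -- `π² = πp`
  have h2p : π2 = πp := by
    have hks : π2 ∈ Function.support aX := Function.mem_support.2 (by rw [hπ2]; decide)
    rw [hsupp, Set.mem_insert_iff, Set.mem_singleton_iff] at hks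
    rcases hks with h | h
    · exact h
    · rw [h, hm1] at hπ2
      exact absurd hπ2 (by decide)
  have hmne : aX πm ≠ 0 := by rw [hm1]; decide
  have hscm : πm.IsSupercuspidal := hsc πm hmne fun h' => hne (h'.trans h2p).symm
  have hmn : πm ≠ πn := fun h' => hL2 (h' ▸ hsq πm hmne)
  refine ⟨πm, hscm, hmn, fun fH φ hfH hφ hm => ?_⟩
  obtain ⟨-, hsum⟩ := hid fH φ hfH hφ hm
  rw [← hsum, tsum_pair aX (fun π => π.smoothTrace νQv φ) hne hsupp, hp1, hm1, ← h2p]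
  push_cast
  ring


/-! ## §4 The HEAD by composition: the closer's `stub_StCharTS` statement, TOKEN FOR TOKEN (up to `Places`/`HLocal`/`GpLocal` ↦ `Pl`/`HLoc`/`GLoc`) -/

open scoped Classical in
/-- **(N-1273S) ⟸ the six organs + the closer's row N6-ns** — [Rogawski1990, Lemma 12.7.3 ∕ Cor. 12.7.4] signed, for the inner form `U(H)(L⁺_v)`, as registered
(`F0U3LettersRung1.stub_StCharTS` ≡ `F0P3bCMCharIdentityTestPaydown.stub_steinbergCharTransferSigned`): LH6-p01's ★ `stCharTS_of_quasiSplit_of_transferExists`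
(frame `e : U(Φ₃)(L⁺_v) ≃ U(H)(L⁺_v)`, sign `ε_v(H) = χ(a)` [§4.3 (4.3.2); §14.4], smooth transfer from `hT` = the closer's registered `stub_N6ns` [Prop. 4.9.1 (a)]
BY NAME — count-neutral) applied to `QST_of_organs`. [cite: Rogawski1990, Lemma 12.7.3 & Cor. 12.7.4 p. 195; §14.4 pp. 234–237; §4.9 Prop. 4.9.1 (a) p. 55] -/
theorem StCharTS_of_organs (hβ : type_of% stub_StSpectralHyp) (hfin : type_of% stub_StSupportFiniteSqInt)
    (hnorm : type_of% stub_StEllipticNormTwo) (hsgn : type_of% stub_StSignBalance)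
    (hnc : type_of% stub_StNoncuspidalMember) (hcu : type_of% stub_StCuspidalMember)
    (hT : Literature.NumberTheory.Rogawski1990.LocalTransferExplicitNonsplitClosed) :
  ∀ (L : Type) [Field L] [NumberField L] [IsCMField L] (H : Matrix (Fin 3) (Fin 3) L) (μ : HeckeCharacter L)
    [∀ v : Pl L, MeasurableSpace (HLoc L v)] [∀ v : Pl L, BorelSpace (HLoc L v)]
    [∀ v : Pl L, MeasurableSpace (GLoc L H v)] [∀ v : Pl L, BorelSpace (GLoc L H v)]
    (νH : ∀ v : Pl L, Measure (HLoc L v)) (νG : ∀ v : Pl L, Measure (GLoc L H v))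
    [∀ v, (νH v).IsHaarMeasure] [∀ v, (νH v).IsMulRightInvariant] [∀ v, (νG v).IsHaarMeasure] [∀ v, (νG v).IsMulRightInvariant]
    (hμu : μ.IsUnitary)
    (_hμω : ∀ x : Literature.NumberTheory.GaloisRepresentations.ideleGroup ↥(maximalRealSubfield L),
      μ (AdeleRing.ideleBaseChange (↥(maximalRealSubfield L)) L x) = quadraticHeckeCharCM L x)
    (hherm : (H.map (cmConjRingHom L))ᵀ = H)
    (hanis : ∀ x : Fin 3 → L, Literature.AlgebraicGeometry.ShimuraVarieties.hermForm (cmConjRingHom L) H x x = 0 → x = 0),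
    letI : ∀ (v : Pl L) (a : HLoc L v), MeasurableSpace (HLoc L v ⧸ Subgroup.centralizer ({a} : Set (HLoc L v))) := fun _ _ => borel _
    haveI : ∀ (v : Pl L) (a : HLoc L v), BorelSpace (HLoc L v ⧸ Subgroup.centralizer ({a} : Set (HLoc L v))) := fun _ _ => ⟨rfl⟩
    letI : ∀ (v : Pl L) (γ : GLoc L H v), MeasurableSpace (GLoc L H v ⧸ Subgroup.centralizer ({γ} : Set (GLoc L H v))) := fun _ _ => borel _
    haveI : ∀ (v : Pl L) (γ : GLoc L H v), BorelSpace (GLoc L H v ⧸ Subgroup.centralizer ({γ} : Set (GLoc L H v))) := fun _ _ => ⟨rfl⟩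
    ∀ (mH : ∀ v : Pl L, OrbitalMeasureFamily (HLoc L v)) (mG : ∀ v : Pl L, OrbitalMeasureFamily (GLoc L H v)),
      (∀ v : Pl L, (mH v).IsCanonical (IsLocalGRegular L v) (νH v) ∧
          (mG v).IsCanonical (fun γ => IsRegularElt (γ.val : GL (Fin 3) (UnitaryGroup.LocalRing L v))) (νG v)) →
      ∀ (ξ : OneDimAutRepH L) (v : Pl L), (∀ w : PlacesOver L v, IsCMField.complexConj L • w.1 = w.1) →
      ∀ (T : GL (Fin 3) (UnitaryGroup.LocalRing L v)) (a : UnitaryGroup.LocalRing L v) (ha : IsUnit a)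
        (h : formCongr (conjLocal L (IsCMField.complexConj L) v) T (H.map (algebraMap L (UnitaryGroup.LocalRing L v))) =
          a • (Matrix.of fun i j : Fin 3 => if i.val + j.val + 1 = 3 then (1 : L) else 0).map (algebraMap L (UnitaryGroup.LocalRing L v))),
      ∀ [MeasurableSpace (Gqs L v ⧸ Subgroup.center (Gqs L v))] [BorelSpace (Gqs L v ⧸ Subgroup.center (Gqs L v))]
        (μZ : Measure (Gqs L v ⧸ Subgroup.center (Gqs L v))) [μZ.IsHaarMeasure],
      ∀ (π₁ πSt : IrrClass (HLoc L v)),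
        HLengthTwoLabels L v
          (torusCharPair (conjLocal L (IsCMField.complexConj L) v) (cmLocalForm L 2 v) (cmLocalForm_eq_over L 2 v) 0
            ((torusLocalComponent L (IsCMField.complexConj L) v ξ.η).comp
                (quotConj (conjLocal L (IsCMField.complexConj L) v) (conjLocal_conjLocal_cm L v)) *
              halfModulusChar (UnitaryGroup.LocalRing L v))
            (torusLocalComponent L (IsCMField.complexConj L) v ξ.ψ))
          ((torusLocalComponent L (IsCMField.complexConj L) v ξ.ψ).comp (localDet (IsCMField.complexConj L) v (isUnit_antidiagOne_det L 1))) π₁ πSt →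
        (∀ fH : HLoc L v → ℂ, IsLocSmooth fH → π₁.smoothTrace (νH v) fH = charDist (ξ.xiLocalChar v) (νH v) fH) →
      ∀ (π2 πn : IrrClass (Gqs L v)),
        KeysCaseTwoLabels L v (μ.semilocalComponent L v) (torusLocalComponent L (IsCMField.complexConj L) v ξ.η)
          (torusLocalComponent L (IsCMField.complexConj L) v ξ.ψ) π2 πn →
        ¬ πn.IsSquareIntegrable μZ →
        ∃ πs : IrrClass (GLoc L H v), πs.IsSupercuspidal ∧ πs ≠ IrrClass.comap (cmDatumLocalCongr L v T ha h).symm πn ∧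
          ∀ (fH : HLoc L v → ℂ) (f : GLoc L H v → ℂ), IsLocSmooth fH → IsLocSmooth f →
            IsLocalDeltaTransfer L H v ((finExplicitCollection L H μ (finExplicitDelta_conj_left_all L H μ) (finExplicitDelta_conj_right_all L H μ)) v) (mH v) (mG v) fH f →
            πSt.smoothTrace (νH v) fH =
              (if ∃ z : UnitaryGroup.LocalRing L v, IsUnit z ∧ a = z * conjLocal L (IsCMField.complexConj L) v z then (1 : ℂ) else -1) *
                ((IrrClass.comap (cmDatumLocalCongr L v T ha h).symm π2).smoothTrace (νG v) f - πs.smoothTrace (νG v) f) :=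
  F0P3cStCharTSOfQuasiSplit.stCharTS_of_quasiSplit_of_transferExists hT (QST_of_organs hβ hfin hnorm hsgn hnc hcu)


end Summit.HodgeConjecture.HodgeConjecture.Cruxes.H413.F0P3cStCharTSPaydown

end
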